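import Mathlib
import Literature.MathematicalPhysics.QuantumFieldTheory.Balaban1983to89.Setup
import Literature.MathematicalPhysics.QuantumFieldTheory.Balaban1983to89.B14
import Literature.MathematicalPhysics.QuantumFieldTheory.Balaban1983to89.Step
import Literature.MathematicalPhysics.QuantumFieldTheory.Balaban1983to89.B12Beta
import Literature.MathematicalPhysics.QuantumFieldTheory.Balaban1983to89.B14Thm2

/-!
# `Balaban1983to89.B14FlowStep` — the located step T11.F of the cell: B14 p. 255–256, (2.6) ⇒ (2.7)–(2.9), and (2.46)

T. Bałaban, *Convergent renormalization expansions for lattice gauge theories*, Commun. Math. Phys. **119**,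
243–285 (1988) [Balaban1988Convergent] (cell paper B14; journal page = PDF page + 242; renders
`HOME/b2b-balaban-ref1/pages/1988-cmp119-convergent-renormalization/…-p013-x2.png`, `…-p014-x2.png` read for this
module).  CITATION HEADER (lean-in-tree rule): this module is a KERNEL-CHECKED RE-DERIVATION, at statement level and
over real sequences, of ONE printed sentence of B14 §2 and of the coupling-sum step inside (2.46):

* p. 255 [13], after (2.6): *"where n > m, and β₀ > 0 can be chosen arbitrarily small, if g is sufficiently small. The
  inequalities follow from the renormalization group equations (0.20) [I], and from the properties of the β-functions.
  They imply the following inequalities:"* (2.7) *"where p is a positive integer. From the above inequalities we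
  obtain"* (2.8) *"and"* (2.9) (p. 256 [14]) — with `ε_j = g_j A₀ (log g_j⁻²)^{p₀}` (2.4) and `R_j` = the least power
  `L^s ≥ (log g_j⁻²)^r` (2.5);
* p. 263 [21], (2.46): *"R₁ Σ_{n=1}^{k} |Γ_n| Σ_{j=1}^{n} g_j^{κ₀} < R₁ Σ_{n=1}^{k} |Γ_n| g_n^{κ₀−6} < Σ_{n=1}^{k} |Γ_n| ,
  for κ₀ ≥ 7 and g sufficiently small."*

WHAT IS PROVED HERE (nothing of the series is asserted; every display is re-derived from stated hypotheses):
1. `flowIneq27_of_26`, `flowIneq28_of_26`, `flowIneq29_of_27` — the sentence *"They imply the following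
   inequalities"* is TRUE as a statement about real sequences: the typed (2.6) (`B14.FlowIneq26`, first and last
   members) implies the typed (2.7) (`B14.FlowIneq27`), (2.8) (`B14.FlowIneq28`, for `Setup`'s profile
   `ε_j = g_j · p0Profile A₀ p (g_j)`) and (2.9) (`FlowIneq29` below, over sizes obeying `B14.IsRj`), PROVIDED the
   couplings are small in an EXPLICIT, p-dependent way that the paper leaves as "if g is sufficiently small":
   `log γ⁻² ≥ 4p + 2` (for the first member of (2.7)), `log γ⁻² ≥ p/β₀` (second member), `γ²β′ ≤ 1` and
   `γ²β′ ≤ β₀(2+β₀)` (middle members of (2.6)/(2.7)), `1 + β₀ ≤ L` ((2.9), first member) and `L β₀ ≤ 1` ((2.9), last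
   member; the SHARP requirement is only `Lβ₀γ²β′ ≤ 1`, `third_member_29_sharp`, v1.1) — collected in `SmallnessFor γ β′ β₀ L p`
   (non-vacuous: `smallnessFor_example`); that SOME p-dependent smallness is needed is witnessed by
   `ineq27a_needs_smallness` (non-monotone reading) and `ineq27b_needs_smallness` (v1.1).  CONSTANT CENSUS: the
   first member of (2.8) is printed with the factor `(1+β₀)`; from (2.6)+(2.7) AS PRINTED one gets `(1+β₀)²`
   (`eps28a_sq_of_26`); the printed factor holds (a) for MONOTONE couplings `g_m ≤ g_n` (which the sign β_j ≥ 0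
   gives), `flowIneq28_of_26_monotone`, or (b) after shrinking the β₀ of (2.6) to a β₁ with `(1+β₁)² ≤ 1+β₀`
   (`flowIneq28_of_26`) — i.e. exactly by "β₀ > 0 can be chosen arbitrarily small"; harmless, recorded in the cell's
   DIVERGENCE.md (row D-sb14.1).
2. `flowControl_of_betaSign` — with [I] (0.20) (`Flow.SatisfiesRG`), the interval hypothesis `0 < g_k ≤ γ`, the
   PRINTED upper bound `β_{j+1}(g_j) ≤ β′` ([Balaban1987RG1] p. 264 "uniformly bounded") and the UNPRINTED sign
   `β_{j+1}(g_j) ≥ 0` ALONG THE FLOW (only realized values enter, so the history-dependence of β_j noted on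
   [Balaban1987RG1] p. 298 — cell GAPS.md G-ref2-1 — is immaterial here), all of (2.6)–(2.9) hold with the printed
   constants.  `flow26d_iff_partialSum` records the EXACT condition under which the last member of (2.6) holds
   (a lower bound `−β₀(2+β₀)/g_m²` on the partial sums of the β-terms, not a pointwise sign — cf. GAPS.md G-ref2-2).
3. `sumIneq246_of_betaPos`, `bounds246_of_betaPos` — with a POSITIVE lower bound `b ≤ β_{j+1}(g_j)` along the
   flow (the cell's located unprinted input T09.F, `Dag.Leaves.betaPositive` as bound in `DagBinding`) and
   `γ⁴ ≤ b`, `γ ≤ 1/2`, the middle and last members of (2.46) hold for every `κ₀ ≥ 7` (using `Step.sum_sixth_powers_le`);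
   `sumIneq246_needs_positive_b` — the sign alone (b = 0) does NOT give (2.46) (constant flow g ≡ 1/2, β ≡ 0,
   n = 65), sharpening `Step.interval_hyp_not_sufficient_for_2_46`.
4. (v1.2, section F) WHICH MEMBERS NEED THE SIGN.  From (0.20), `0 < g_k ≤ γ`, `SmallnessFor` and the PRINTED
   TWO-SIDED bound `|β_{j+1}(g_j)| ≤ β′` alone ([Balaban1987RG1] p. 264): the first three members of (2.6), the
   second member of (2.7), the FIRST member of (2.8) (`flowIneq28a_signfree`, via the monotonicity of
   `x (log x⁻²)^p`, `eps_profile_mono`) and the second/third members of (2.9) hold for ALL pairs `m < n`; the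
   remaining members ((2.6d), (2.7a), (2.8b), (2.9a)) hold for every pair whose LAG obeys
   `(n − m) γ² β′ ≤ β₀(2+β₀)` (`pairFlow_of_betaAbs_lag`; adjacent scales `adjacentFlow_of_betaAbs` — the forms
   "(1+β₀)ε_k", `R_k ≤ (L+1)R_{k+1}` consumed by [Balaban1988Convergent] §3 (3.7)–(3.19) and the `hflow` hypothesis of
   `B14Sect3.ineq38_scalar`), and (2.7a)/(2.9a) even under the logarithmic-room condition of
   `flow27a_of_betaLower_logroom`.  `flowControl_of_partialSum` gives the whole of (2.6)–(2.9) for all pairs from a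
   lower bound `−B` on ALL partial sums with `B γ² ≤ β₀(2+β₀)` (printed constants, including (2.8)'s `(1+β₀)`);
   `partialSum_ge_of_card_neg_le` feeds it from "at most N₀ negative β-terms per window"; `sum246_sharp` records the
   sharp power `g_n^{κ₀−2}/(2b)` in (2.46).  So, among the consumers of (2.6)–(2.9) LOCATED by the cell
   (MISSING-B14.md v2 §8; not a claim about every page of [III]–[IV]), the SIGN of β is consumed only by the p. 255
   display as stated (all `n > m`), by the unbounded-lag uses of (2.9a)/(2.7a) in [Balaban1989LargeFieldII] (1.81)
   p. 385 and p. 386, and — as a positive lower bound — by (2.46).  (v1.3) `pairFlow_of_betaAbs_le_Rn` +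
   `lag_condition_of_le_Rn` (+ `sq_logpow_mono`, `isRj_le_mul_logpow`): the lag condition for lags `≤ R_n` — the
   [Balaban1989LargeFieldII] (1.23) consumer — IS the γ-smallness `Lβ′γ²(log γ⁻²)^p ≤ β₀/2`; section G
   `printed_hyps_fail_26d_27a`: an explicit flow (`g_k = (e^{20}+k)^{−1/2}`, `β ≡ −1`, `K = 10^{11}`) satisfying
   (0.20), the interval hypothesis, `|β| ≤ β′` and `SmallnessFor e^{−10} 1 ½ 2 2`, violating (2.6d) and (2.7a) —
   the printed hypotheses alone do NOT give the unbounded-lag members.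
5. (v1.4, section H) THE (0.31)-READING of [Balaban1988Convergent] Thm 1's hypothesis "(I.0.33)" (cell DIVERGENCE
   D2(b); `B14.H033LogRunning` ↔ `Step.Discrete031`): from the endpoint running `1/g_K² + b(K−k) ≤ 1/g_k² ≤
   1/g_K² + β′(K−k)` (`0 < b ≤ β′`) — the CONCLUSION (0.31) of the unproved [Balaban1987RG1] Thm 2 — plus the
   printed `β ≤ β′`, (0.20), `0 < g_k ≤ γ` and explicit γ-smallness, WITHOUT any pointwise sign: `1/g_n² ≤
   (β′/b)/g_m²` for all `m ≤ n` (`inv_sq_le_of_discrete031`), hence (2.7a)/(2.9a) for ALL pairs with the printed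
   constants when `p·log(β′/b) ≤ (β₀/2) log γ⁻²` (`flow27a_of_discrete031`), (2.46) for all `n ≤ K` for γ small
   depending on `κ₀, b, β′` (`sumIneq246_of_discrete031`), and (2.6d)/(2.8b) with the constant `(β′/b)^{1/2}` in
   place of `1+β₀` (`pairFlow_of_discrete031`).  Under this reading the located step has NO residual beyond G1
   ((0.31) itself) and that one constant substitution (`(β′/b)^{1/2} ≤ 1+β₀` ⟸ `b, β′ → b₀`, one-loop asymptotic
   freedom — again a property of the β-functions, not printed).
6. (v1.5, section I) END TO END WITH [I]'s PRINTED ONE-LOOP SPLIT (`B12Beta.OneLoopSplit`, bookkeeping on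
   [Balaban1987RG1] (1.3)/(1.6) pp. 260–261 and (2.12)–(2.14) p. 268: `β_j = β⁰_j + r_j`, `β⁰_j` coupling-free, `r_j`
   vanishing at zero coupling): `flowControl_of_oneLoopSplit` — along a flow in `]0,γ]` solving (0.20), the two
   inputs (AF-0) `2b ≤ β⁰_j` and (AF-1) `|r_j(x)| ≤ Cx` on `]0,γ]` (`Cγ ≤ b`, `0 < b`), which are EXACTLY the unprinted
   inputs the cell located for [Balaban1987RG1] Thm 2 (GAPS G-b12-1, G-b12-2; `B12Beta.betaLower_of_split`), together
   with the printed `β ≤ β′` and the explicit smallness give ALL of (2.6)–(2.9) with the printed constants AND (2.46);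
   `trajectory_flowControl_of_oneLoopSplit` — composed with the backward construction
   `B12Beta.thm2Conclusion_of_split` / `Step.couplingTrajectory_exists`: for every `K` and every renormalised coupling
   `g ∈ ]0,γ]` a trajectory with `g_K = g` solving (0.20), obeying (0.31) (`Step.Discrete031 b β′`), with sizes `R_j`
   as in (2.5) (`isRj_exists`) and all the flow inequalities.  So the residual of the located step is not a THIRD
   unprinted input: under either reading of "(I.0.33)" it is contained in the pair (AF-0), (AF-1) of cell node T09.F.
7. (v1.6, section J) AVERAGED ASYMPTOTIC FREEDOM WITH A DEFECT SUFFICES, (2.46) INCLUDED.  From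
   `b(n−m) − B ≤ Σ_{j∈[m,n)} β_{j+1}(g_j)` for all `m ≤ n ≤ K` (`b > 0`) — equivalently (`avgAF_iff_defectedRunning`)
   the lower half of (0.31) up to an additive constant, `1/g_n² + b(n−m) − B ≤ 1/g_m²` — plus (0.20), `0 < g_k ≤ γ`,
   the printed `β ≤ β′`, `SmallnessFor` and the γ-smallness `Bγ² ≤ β₀(2+β₀)`, `Bγ² ≤ 1/2`,
   `(√2)^{κ₀−6}(2γ⁴/b + γ⁶) < 1`: ALL of (2.6)–(2.9) with the printed constants AND (2.46) (`flowControl_of_avgAF`,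
   `sumIneq246_of_avgAF`).  The hypothesis follows from EVENTUAL asymptotic freedom `β_{j+1}(g_j) ≥ b` for `j ≥ k₀`
   plus the PRINTED two-sided bound `|β| ≤ β′` with `B = (b+β′)k₀` (`avgAF_of_eventualLower`,
   `flowControl_of_eventualLower`), from the limit form `β_{j+1}(g_j) ≥ −c₀θ^j` (all j), `≥ b` (j ≥ k₀) with
   `B = bk₀ + c₀/(1−θ)` (`avgAF_of_limitLower`, `flowControl_of_limitLower`), and from [I]'s one-loop split with
   (AF-0) ONLY FOR `j ≥ k₀` + (AF-1) + the printed two-sided bound (`flowControl_of_eventualOneLoopSplit`); (v1.7) also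
   from any SUMMABLE lower envelope `β_{j+1}(g_j) ≥ −c_j`, `Σc_j ≤ C_tot` (`avgAF_of_summableLower`,
   `flowControl_of_summableLower`) and from AF off an exceptional set of bounded size — the shape of
   Bauerschmidt–Brydges–Slade's (A1) (`avgAF_of_exceptional`, `flowControl_of_exceptional`); (v1.9) and from a DRIFT
   of the coupling-free parts `b(n−m) − A ≤ Σ_{[m,n)} β⁰_{j+1}` plus uniformly small remainders `|r_{j+1}(g_j)| ≤ ρ < b`
   (the cell's (T-drift) form; `avgAF_of_driftSplit`, `flowControl_of_driftSplit`).  Hence on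
   the [III] side the signs of the finitely many small-scale one-loop coefficients are consumed by NO located use of
   the flow (they cost γ-smallness only); with `FlowStepRuns` §10 on the [I] side, the finite list of small-k signs
   is consumed only by the LITERAL lower half of (0.31) for all `k ≤ K`.
8. (v1.10, section K) WHERE the middle member of (2.46) is consumed.  (K-a) The GLOBAL budget does not need it: since
   `|Γ_n| ≤ |T₁⁽ⁿ⁾| = L^{−4n}|T_η|` (p. 263: volumes in the corresponding scales), the FIRST member of (2.46) and
   `0 ≤ g_j ≤ γ` alone give `|𝐑_k(U_k)| ≤ R₁γ^{κ₀}(Σ_n nL^{−4n})|T_η| ≤ R₁γ^{κ₀}|T_η|/14` (`L ≥ 2`;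
   `sum246_first_le_global`, `rk_le_global_of_244`), hence (2.49) with the 𝐑-part booked against `|T_η|`
   (`ineq249T_of_223`, no `hsum`/`hsmall`) — all that the `|T_η|`-extensive (2.50) p. 264 consumes.  (K-b) What the
   middle member adds is a bound on `Σ_{j≤n} g_j^{κ₀}` UNIFORM IN n — `O(1)` per point of each layer at its own scale,
   the form meant by p. 260 *"The sum over j is controlled by g_j^{κ₀}"* and used where the accumulated marginal
   𝐑-terms enter per unit volume of the current layer (the `𝐑′_k ⊂ 𝐄_k` treatment of the (k+1)-th step, pp. 271/276;
   [Balaban1989LargeFieldII] (1.69) p. 377 and the per-large-field-domain budget p. 380 ll. 12–17; cell MISSING-B14.md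
   v4/v5 §8 C13) — and NO such k-uniform bound follows from
   (0.20) + interval + sign (`layerSum_unbounded_printOnly`); under averaged asymptotic freedom it is section J's
   `sumIneq246_of_avgAF`.  The [III]-side consumer of asymptotic freedom is thereby relocated, not removed.
   (v1.11) EXACT strength of the per-layer form: positivity at ANY fixed polynomial rate `β_{j+1}(g_j) ≥ c·g_j^M`,
   `M < κ₀ − 2`, already gives K-uniform layer summability — `pow_step_of_betaPowerLower` (Bernoulli telescoping
   `q c g_j^{2q+2+M} ≤ g_{j+1}^{2q} − g_j^{2q}`), `powSum_le_of_betaPowerLower`, `layerSum_le_of_betaPowerLower`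
   (`Σ_{j≤n} g_j^{κ₀} ≤ (g_n^{2q}/(qc) + g_n^{2q+2+M}) g_n^{κ₀−(2q+2+M)}`; `M = 0` is `Step.sum_sixth_powers_le`).
   (v1.12, DOCSTRING ONLY; declarations byte-unchanged) the p. 276 quotation in section K restored to the printed
   spelling «analylsis» [sic] (cross-read C-ref5-8: v1.10/v1.11 had silently normalised it); the B16-side locus of the
   per-layer consumer (C13(iii)) now names p. 380 ll. 12–17 (locator only, no new quotation) next to (1.69) p. 377.
CENSUS CONSEQUENCE (cell LEMMAS.md T11.F / GAPS.md G-r2.1, G-f2.1): after this module the located step B14 p. 255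
has NO residual beyond (i) the sign / positive lower bound of the β-functions (1.22) of [I] — printed nowhere in the
series ([Balaban1987RG1] p. 264: "We will investigate other properties in a separate paper"; [Balaban1989LargeFieldII]
p. 355: "has not been published yet") — and (ii) the explicit smallness of γ relative to p ∈ {p₀, r, q₀, q₁, …} and
β₀ ≤ 1/L listed above, which is what "if g is sufficiently small" has to mean.  Printed analogues of the ELEMENTARY
half (not used, recorded for the audit): Bauerschmidt–Brydges–Slade, Ann. Henri Poincaré 16 (2015) 1033, Lemma 2.1
(arXiv:1211.2477); Dimock–Yuan, Ann. Henri Poincaré 25 (2024) 5113 = arXiv:2303.07916, Lemma `english`/(candy) and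
the remark (basicbound), where the positivity `β_k ≥ (n−1)C₋ > 0` IS proved for Gross–Neveu₂ (Lemma `eleven`).
Vocabulary: `Setup.Flow`, `Flow.SatisfiesRG`, `Flow.InInterval`, `Setup.p0Profile`/`epsK`; `B14.FlowIneq26/27/28`,
`B14.IsRj`, `B14.flow26_*`; `Step.inv_sq_telescope`, `Step.B14_2_6b/c`, `Step.sum_sixth_powers_le`,
`Step.InInterval` (raw-sequence form).  Unit `b2b-balaban-strat-b14` (strategist, located step B14); companion prose
`HOME/MISSING-B14.md`.  HONEST FRAMING: value = a kernel certificate for one displayed implication with its constants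
and an exact statement of what remains unprinted — a typed skeleton / census item, NOT progress on any open problem.
-/

namespace Literature.MathematicalPhysics.QuantumFieldTheory.Balaban1983to89.B14FlowStep

open Literature.MathematicalPhysics.QuantumFieldTheory.Balaban1983to89

/-! ## Typed displays not already in `B14`: (2.9) and the middle member of (2.46) -/

/-- **(2.9)** p. 256 [14], verbatim: *"R_n ≤ L R_m , R_m ≤ L(1 + g_n² β′(n−m))^{β₀} R_n ≤ (L+1)(n−m)^{β₀} R_n ."*
Typed (first two members) for a sequence of sizes `R : ℕ → ℕ` along a coupling sequence `g`, block size `L`, for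
all `m < n ≤ K`; the sizes are tied to the couplings by (2.5) = `B14.IsRj` in the theorems below; the third member is
`third_members`. [cite: Balaban1988Convergent, (2.9) p.256] -/
def FlowIneq29 (R : ℕ → ℕ) (g : ℕ → ℝ) (L : ℕ) (β' β₀ : ℝ) (K : ℕ) : Prop :=
  ∀ m n, m < n → n ≤ K →
    (R n : ℝ) ≤ L * R m ∧ (R m : ℝ) ≤ L * (1 + (g n) ^ 2 * β' * ((n : ℝ) - m)) ^ β₀ * R n

/-- **(2.46), middle member** p. 263 [21]: *"Σ_{j=1}^{n} g_j^{κ₀} < g_n^{κ₀−6}"* (the coupling-sum step between the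
first and second members of (2.46), *"for κ₀ ≥ 7 and g sufficiently small"*), for every `n ≤ K`; ℕ-exponent
`κ₀ − 6` is the printed one when `κ₀ ≥ 7`. [cite: Balaban1988Convergent, (2.46) p.263] -/
def SumIneq246 (g : ℕ → ℝ) (κ₀ : ℕ) (K : ℕ) : Prop :=
  ∀ n, n ≤ K → ∑ j ∈ Finset.Icc 1 n, (g j) ^ κ₀ < (g n) ^ (κ₀ - 6)

/-- What "β₀ > 0 can be chosen arbitrarily small, if g is sufficiently small" (p. 255) has to provide for the
passage (2.6) ⇒ (2.7)–(2.9) with exponent `p` and block size `L`: the explicit restrictions used below (γ = the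
bound of the interval hypothesis `0 < g_k ≤ γ`, β′ = the upper bound of the β-functions).  Each field is consumed
by the member named in the module docstring. [cite: Balaban1988Convergent, (2.6)–(2.9) pp.255–256] -/
structure SmallnessFor (γ β' β₀ : ℝ) (L p : ℕ) : Prop where
  γ_pos : 0 < γ
  γ_lt_one : γ < 1
  β'_nonneg : 0 ≤ β'
  β₀_pos : 0 < β₀
  β₀_le_one : β₀ ≤ 1
  h26c : γ ^ 2 * β' ≤ β₀ * (2 + β₀)
  h27c : γ ^ 2 * β' ≤ 1
  h27a : 4 * (p : ℝ) + 2 ≤ Real.log (γ ^ 2)⁻¹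
  h27b : (p : ℝ) ≤ β₀ * Real.log (γ ^ 2)⁻¹
  hL : 2 ≤ L
  h29c : (L : ℝ) * β₀ ≤ 1

/-- Non-vacuity of `SmallnessFor`: `γ = e^{−10}`, `β′ = 1`, `β₀ = 1/2`, `L = 2`, `p = 2`. [folklore] -/
theorem smallnessFor_example : SmallnessFor (Real.exp (-10)) 1 (1 / 2) 2 2 := by
  have hγ : Real.exp (-10) < 1 := Real.exp_lt_one_iff.mpr (by norm_num)
  have hγ2 : Real.exp (-10) ^ 2 ≤ 1 := by
    have := Real.exp_pos (-10)
    nlinarith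
  have hlog : Real.log (Real.exp (-10) ^ 2)⁻¹ = 20 := by
    rw [Real.log_inv, Real.log_pow, Real.log_exp]; norm_num
  refine ⟨Real.exp_pos _, hγ, by norm_num, by norm_num, by norm_num, ?_, ?_, ?_, ?_, le_rfl, by norm_num⟩
  · nlinarith
  · linarith
  · rw [hlog]; norm_num
  · rw [hlog]; norm_num

/-! ## A. Elementary real inequalities -/

/-- `exp y ≤ 1 + 2y` for `0 ≤ y ≤ 1/2`. [folklore] -/
theorem exp_le_one_add_two_mul {y : ℝ} (hy0 : 0 ≤ y) (hy : y ≤ 1 / 2) :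
    Real.exp y ≤ 1 + 2 * y := by
  have h1 : |y| ≤ 1 := by rw [abs_of_nonneg hy0]; linarith
  have h2 := Real.abs_exp_sub_one_sub_id_le h1
  have h3 : Real.exp y - 1 - y ≤ y ^ 2 := le_trans (le_abs_self _) h2
  nlinarith

/-- Core of the first member of (2.7): if `Am ≥ A − 2β₀`, `0 ≤ β₀ ≤ 1` and `A ≥ 4p + 2`, then
`A^p ≤ (1+β₀) Am^p`. [folklore] -/
theorem logpow_27a {A Am β₀ : ℝ} {p : ℕ} (hβ₀ : 0 ≤ β₀) (hβ₁ : β₀ ≤ 1)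
    (hAm : A - 2 * β₀ ≤ Am) (hA : 4 * (p : ℝ) + 2 ≤ A) : A ^ p ≤ (1 + β₀) * Am ^ p := by
  rcases Nat.eq_zero_or_pos p with hp | hp
  · subst hp; simp; linarith
  have hp1 : (1:ℝ) ≤ p := by exact_mod_cast hp
  set B := A - 2 * β₀ with hB
  have hBpos : 0 < B := by rw [hB]; linarith
  have hB4 : 4 * (p:ℝ) ≤ B := by rw [hB]; linarith
  set x := 2 * β₀ / B with hx
  have hx0 : 0 ≤ x := by positivity
  have hAeq : A = B * (1 + x) := by
    rw [hx]; field_simp; ring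
  have hpx : (p:ℝ) * x ≤ β₀ / 2 := by
    have e : (p:ℝ) * x = (2 * p * β₀) / B := by rw [hx]; ring
    rw [e, div_le_iff₀ hBpos]
    have := mul_le_mul_of_nonneg_left hB4 hβ₀
    linarith
  have h1 : (1 + x) ^ p ≤ 1 + β₀ := by
    -- `(1+x)^p ≤ exp(px)` (the tree has this as `…RSTProj.one_add_pow_le_exp` in an unrelated module; inlined)
    have hexp : (1 + x) ^ p ≤ Real.exp (p * x) := by
      calc (1 + x) ^ p ≤ (Real.exp x) ^ p :=
            pow_le_pow_left₀ (by linarith) (by linarith [Real.add_one_le_exp x]) p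
        _ = Real.exp (p * x) := by rw [← Real.exp_nat_mul]
    calc (1 + x) ^ p ≤ Real.exp (p * x) := hexp
      _ ≤ Real.exp (β₀ / 2) := Real.exp_le_exp.mpr hpx
      _ ≤ 1 + 2 * (β₀ / 2) := exp_le_one_add_two_mul (by linarith) (by linarith)
      _ = 1 + β₀ := by ring
  have hBA : B ^ p ≤ Am ^ p := pow_le_pow_left₀ hBpos.le hAm p
  calc A ^ p = B ^ p * (1 + x) ^ p := by rw [hAeq, mul_pow]
    _ ≤ B ^ p * (1 + β₀) := mul_le_mul_of_nonneg_left h1 (pow_nonneg hBpos.le p)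
    _ ≤ Am ^ p * (1 + β₀) := mul_le_mul_of_nonneg_right hBA (by linarith)
    _ = (1 + β₀) * Am ^ p := by ring

/-- Core of the second member of (2.7): if `0 ≤ Am ≤ A + y`, `A > 0`, `y ≥ 0` and `p ≤ β₀ A`, then
`Am^p ≤ e^{β₀ y} A^p`. [folklore] -/
theorem logpow_27b {A Am y β₀ : ℝ} {p : ℕ} (hA : 0 < A) (hAm0 : 0 ≤ Am)
    (hAm : Am ≤ A + y) (hy : 0 ≤ y) (hsmall : (p : ℝ) ≤ β₀ * A) :
    Am ^ p ≤ Real.exp (β₀ * y) * A ^ p := by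
  have h1 : Am ^ p ≤ (A + y) ^ p := pow_le_pow_left₀ hAm0 hAm p
  have h2 : (A + y) ^ p = A ^ p * (1 + y / A) ^ p := by
    rw [← mul_pow]; congr 1; field_simp
  have hyA : 0 ≤ y / A := by positivity
  have h3 : (1 + y / A) ^ p ≤ Real.exp (p * (y / A)) := by
    calc (1 + y / A) ^ p ≤ (Real.exp (y / A)) ^ p :=
          pow_le_pow_left₀ (by linarith) (by linarith [Real.add_one_le_exp (y / A)]) p
      _ = Real.exp (p * (y / A)) := by rw [← Real.exp_nat_mul]
  have h4 : (p : ℝ) * (y / A) ≤ β₀ * y := by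
    rw [mul_div_assoc', div_le_iff₀ hA]
    have := mul_le_mul_of_nonneg_left hsmall hy
    linarith
  calc Am ^ p ≤ (A + y) ^ p := h1
    _ = A ^ p * (1 + y / A) ^ p := h2
    _ ≤ A ^ p * Real.exp (p * (y / A)) := mul_le_mul_of_nonneg_left h3 (pow_nonneg hA.le p)
    _ ≤ A ^ p * Real.exp (β₀ * y) :=
        mul_le_mul_of_nonneg_left (Real.exp_le_exp.mpr h4) (pow_nonneg hA.le p)
    _ = Real.exp (β₀ * y) * A ^ p := by ring

/-- `log g⁻² = −2 log g`. [folklore] -/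
theorem log_inv_sq (g : ℝ) : Real.log (g ^ 2)⁻¹ = -2 * Real.log g := by
  rw [Real.log_inv, Real.log_pow]; push_cast; ring

/-- `log γ⁻² ≤ log g⁻²` for `0 < g ≤ γ`. [folklore] -/
theorem log_inv_sq_mono {g γ : ℝ} (hg : 0 < g) (hgγ : g ≤ γ) :
    Real.log (γ ^ 2)⁻¹ ≤ Real.log (g ^ 2)⁻¹ := by
  have hγ : 0 < γ := lt_of_lt_of_le hg hgγ
  apply Real.log_le_log (by positivity)
  rw [inv_le_inv₀ (by positivity) (by positivity)]
  exact pow_le_pow_left₀ hg.le hgγ 2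

/-- `0 ≤ log g⁻²` for `0 < g ≤ 1`. [folklore] -/
theorem log_inv_sq_nonneg {g : ℝ} (hg : 0 < g) (hg1 : g ≤ 1) : 0 ≤ Real.log (g ^ 2)⁻¹ := by
  apply Real.log_nonneg
  rw [one_le_inv₀ (by positivity)]
  exact pow_le_one₀ hg.le hg1

/-- **(2.7), first member, pointwise**: `g_m ≤ (1+β₀) g_n` (last member of (2.6)), `0 ≤ β₀ ≤ 1` and
`log g_n⁻² ≥ 4p + 2` give `(log g_n⁻²)^p ≤ (1+β₀)(log g_m⁻²)^p`. [cite: Balaban1988Convergent, (2.7) p.255] -/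
theorem ineq27a {gm gn β₀ : ℝ} {p : ℕ} (hm : 0 < gm) (hn : 0 < gn) (hβ₀ : 0 ≤ β₀) (hβ₁ : β₀ ≤ 1)
    (h26d : gm ≤ (1 + β₀) * gn) (hsmall : 4 * (p : ℝ) + 2 ≤ Real.log (gn ^ 2)⁻¹) :
    (Real.log (gn ^ 2)⁻¹) ^ p ≤ (1 + β₀) * (Real.log (gm ^ 2)⁻¹) ^ p := by
  apply logpow_27a hβ₀ hβ₁ _ hsmall
  rw [log_inv_sq gm, log_inv_sq gn]
  have h1 : Real.log gm ≤ Real.log ((1 + β₀) * gn) := Real.log_le_log hm h26d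
  rw [Real.log_mul (ne_of_gt (by linarith)) (ne_of_gt hn)] at h1
  have h2 : Real.log (1 + β₀) ≤ β₀ := by
    have := Real.log_le_sub_one_of_pos (show 0 < 1 + β₀ by linarith); linarith
  linarith

/-- The first member of (2.7) with factor `1` (no smallness) for MONOTONE couplings `g_m ≤ g_n ≤ 1`. [cite: Balaban1988Convergent, (2.7) p.255] -/
theorem ineq27a_of_monotone {gm gn : ℝ} {p : ℕ} (hm : 0 < gm) (hn1 : gn ≤ 1) (hmn : gm ≤ gn) :
    (Real.log (gn ^ 2)⁻¹) ^ p ≤ (Real.log (gm ^ 2)⁻¹) ^ p :=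
  pow_le_pow_left₀ (log_inv_sq_nonneg (lt_of_lt_of_le hm hmn) hn1) (log_inv_sq_mono hm hmn) p

/-- **(2.7), second member, pointwise**: `g_n² ≤ (1+X) g_m²` (first member of (2.6) squared, `X = g_n²β′(n−m) ≥ 0`),
`0 < g_m ≤ 1`, `0 < g_n < 1` and `p ≤ β₀ log g_n⁻²` give `(log g_m⁻²)^p ≤ (1+X)^{β₀} (log g_n⁻²)^p`. [cite: Balaban1988Convergent, (2.7) p.255] -/
theorem ineq27b {gm gn X β₀ : ℝ} {p : ℕ} (hm : 0 < gm) (hm1 : gm ≤ 1) (hn : 0 < gn) (hn1 : gn < 1)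
    (hX : 0 ≤ X) (h26a : gn ^ 2 ≤ (1 + X) * gm ^ 2)
    (hsmall : (p : ℝ) ≤ β₀ * Real.log (gn ^ 2)⁻¹) :
    (Real.log (gm ^ 2)⁻¹) ^ p ≤ (1 + X) ^ β₀ * (Real.log (gn ^ 2)⁻¹) ^ p := by
  have hX1 : 0 < 1 + X := by linarith
  have hApos : 0 < Real.log (gn ^ 2)⁻¹ := by
    apply Real.log_pos
    rw [one_lt_inv₀ (by positivity)]
    exact pow_lt_one₀ hn.le hn1 two_ne_zero
  rw [Real.rpow_def_of_pos hX1, mul_comm (Real.log (1 + X)) β₀]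
  apply logpow_27b hApos (log_inv_sq_nonneg hm hm1) _ (Real.log_nonneg (by linarith)) hsmall
  have h1 : (gm ^ 2)⁻¹ ≤ (1 + X) * (gn ^ 2)⁻¹ := by
    have hgm2 : 0 < gm ^ 2 := by positivity
    have hgn2 : 0 < gn ^ 2 := by positivity
    rw [← one_div, ← div_eq_mul_inv, div_le_div_iff₀ hgm2 hgn2, one_mul]
    exact h26a
  have h2 : Real.log (gm ^ 2)⁻¹ ≤ Real.log ((1 + X) * (gn ^ 2)⁻¹) :=
    Real.log_le_log (by positivity) h1
  rw [Real.log_mul (ne_of_gt hX1) (ne_of_gt (by positivity))] at h2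
  linarith

/-- **(2.7)/(2.8)/(2.9), third members, pointwise**: `(1 + c d)^{β₀} ≤ (1+β₀) d^{β₀}` for `0 ≤ c ≤ 1`, `d ≥ 1`,
`0 ≤ β₀ ≤ 1` (with `c = g_n² β′`, `d = n − m`). [cite: Balaban1988Convergent, (2.7) p.255] -/
theorem ineq27c {c d β₀ : ℝ} (hc0 : 0 ≤ c) (hc1 : c ≤ 1) (hd : 1 ≤ d) (hβ₀ : 0 ≤ β₀)
    (hβ₁ : β₀ ≤ 1) : (1 + c * d) ^ β₀ ≤ (1 + β₀) * d ^ β₀ := by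
  have h1 : 1 + c * d ≤ (1 + c) * d := by nlinarith
  have h2 : (1 + c * d) ^ β₀ ≤ ((1 + c) * d) ^ β₀ :=
    Real.rpow_le_rpow (by positivity) h1 hβ₀
  rw [Real.mul_rpow (by positivity) (by positivity)] at h2
  have h3 : (1 + c) ^ β₀ ≤ 1 + β₀ * c :=
    rpow_one_add_le_one_add_mul_self (by linarith) hβ₀ hβ₁
  have h4 : (1 + c) ^ β₀ ≤ 1 + β₀ := by nlinarith
  calc (1 + c * d) ^ β₀ ≤ (1 + c) ^ β₀ * d ^ β₀ := h2
    _ ≤ (1 + β₀) * d ^ β₀ :=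
        mul_le_mul_of_nonneg_right h4 (Real.rpow_nonneg (by positivity) β₀)

/-! ## B. "They imply the following inequalities": (2.6) ⇒ (2.7), (2.8), (2.9) over real sequences -/

section Implication
variable {g : ℕ → ℝ} {γ β' β₀ : ℝ} {L p K : ℕ}

/-- `n − m ≥ 1` as reals for `m < n`. [folklore] -/
theorem one_le_sub_of_lt {m n : ℕ} (hmn : m < n) : (1 : ℝ) ≤ (n : ℝ) - m := by
  have : m + 1 ≤ n := hmn
  have : ((m : ℝ) + 1) ≤ n := by exact_mod_cast this
  linarith

/-- The quantity `X = g_n² β′ (n−m)` is nonnegative. [folklore] -/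
theorem X_nonneg (hβ' : 0 ≤ β') (gn : ℝ) {m n : ℕ} (hmn : m ≤ n) :
    0 ≤ gn ^ 2 * β' * ((n : ℝ) - m) := by
  have : (m : ℝ) ≤ n := by exact_mod_cast hmn
  have : 0 ≤ (n : ℝ) - m := by linarith
  positivity

/-- **The full chain of (2.6)** from its typed first member and the arithmetic middle members (`Step.B14_2_6b`,
`Step.B14_2_6c`): `g_n ≤ (1+β₀)(n−m)^{1/2} g_m` for `m < n ≤ K`, given `g_n²β′ ≤ γ²β′ ≤ β₀(2+β₀)`. [cite: Balaban1988Convergent, (2.6) p.255] -/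
theorem chain26 (S : SmallnessFor γ β' β₀ L p) (hI : Step.InInterval γ K g)
    (h26 : B14.FlowIneq26 g β' β₀ K) {m n : ℕ} (hmn : m < n) (hnK : n ≤ K) :
    g n ≤ (1 + β₀) * Real.sqrt ((n : ℝ) - m) * g m := by
  have hm : 0 < g m := (hI m (le_trans hmn.le hnK)).1
  have hn : 0 < g n := (hI n hnK).1
  have hnγ : g n ≤ γ := (hI n hnK).2
  have h1 := (h26 m n hmn hnK).1
  have h2 := Step.B14_2_6b (c := (g n) ^ 2) (β' := β') (d := (n : ℝ) - m) (by positivity)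
    S.β'_nonneg (one_le_sub_of_lt hmn)
  have hsmall : (g n) ^ 2 * β' ≤ β₀ * (2 + β₀) := by
    have : (g n) ^ 2 ≤ γ ^ 2 := pow_le_pow_left₀ hn.le hnγ 2
    have := mul_le_mul_of_nonneg_right this S.β'_nonneg
    linarith [S.h26c]
  have h3 := Step.B14_2_6c (c := (g n) ^ 2) S.β₀_pos.le hsmall
  calc g n ≤ Real.sqrt (1 + (g n) ^ 2 * β' * ((n : ℝ) - m)) * g m := h1
    _ ≤ Real.sqrt (1 + (g n) ^ 2 * β') * Real.sqrt ((n : ℝ) - m) * g m :=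
        mul_le_mul_of_nonneg_right h2 hm.le
    _ ≤ (1 + β₀) * Real.sqrt ((n : ℝ) - m) * g m := by
        apply mul_le_mul_of_nonneg_right _ hm.le
        exact mul_le_mul_of_nonneg_right h3 (Real.sqrt_nonneg _)

/-- **(2.6) ⇒ (2.7)** (both members, every `m < n ≤ K`) under `SmallnessFor γ β′ β₀ L p` and `0 < g_k ≤ γ`. [cite: Balaban1988Convergent, (2.7) p.255] -/
theorem flowIneq27_of_26 (S : SmallnessFor γ β' β₀ L p) (hI : Step.InInterval γ K g)
    (h26 : B14.FlowIneq26 g β' β₀ K) : B14.FlowIneq27 g β' β₀ p K := by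
  intro m n hmn hnK
  have hm : 0 < g m := (hI m (le_trans hmn.le hnK)).1
  have hn : 0 < g n := (hI n hnK).1
  have hmγ : g m ≤ γ := (hI m (le_trans hmn.le hnK)).2
  have hnγ : g n ≤ γ := (hI n hnK).2
  have hlogn := log_inv_sq_mono hn hnγ
  obtain ⟨h26a, h26d⟩ := h26 m n hmn hnK
  have hX := X_nonneg S.β'_nonneg (g n) hmn.le
  have h26a2 : (g n) ^ 2 ≤ (1 + (g n) ^ 2 * β' * ((n : ℝ) - m)) * (g m) ^ 2 := by
    have h0 : 0 ≤ Real.sqrt (1 + (g n) ^ 2 * β' * ((n : ℝ) - m)) * g m := by positivity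
    have := pow_le_pow_left₀ hn.le h26a 2
    rw [mul_pow, Real.sq_sqrt (by linarith)] at this
    exact this
  exact ⟨ineq27a hm hn S.β₀_pos.le S.β₀_le_one h26d (le_trans S.h27a hlogn),
    ineq27b hm (le_trans hmγ S.γ_lt_one.le) hn (lt_of_le_of_lt hnγ S.γ_lt_one) hX h26a2
      (le_trans S.h27b (mul_le_mul_of_nonneg_left hlogn S.β₀_pos.le))⟩

/-- **(2.6)+(2.7) ⇒ first member of (2.8) with the SQUARED factor**: `ε_n ≤ (1+β₀)² (n−m)^{1/2} ε_m`
(`ε_j = g_j · p0Profile A₀ p (g_j)`), for general (not necessarily monotone) couplings — what the printed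
derivation literally yields (the print has `(1+β₀)`; see `flowIneq28_of_26_monotone`, `flowIneq28_of_26`). [cite: Balaban1988Convergent, (2.8) p.256] -/
theorem eps28a_sq_of_26 (S : SmallnessFor γ β' β₀ L p) {A₀ : ℝ} (hA₀ : 0 ≤ A₀)
    (hI : Step.InInterval γ K g) (h26 : B14.FlowIneq26 g β' β₀ K) {m n : ℕ} (hmn : m < n) (hnK : n ≤ K) :
    g n * p0Profile A₀ p (g n) ≤
      (1 + β₀) ^ 2 * Real.sqrt ((n : ℝ) - m) * (g m * p0Profile A₀ p (g m)) := by
  have hm : 0 < g m := (hI m (le_trans hmn.le hnK)).1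
  have hn : 0 < g n := (hI n hnK).1
  have hnγ : g n ≤ γ := (hI n hnK).2
  have hc := chain26 S hI h26 hmn hnK
  have h27a := (flowIneq27_of_26 S hI h26 m n hmn hnK).1
  have hPn0 : 0 ≤ Real.log ((g n) ^ 2)⁻¹ := log_inv_sq_nonneg hn (le_trans hnγ S.γ_lt_one.le)
  have hb : 0 ≤ 1 + β₀ := by have := S.β₀_pos; linarith
  unfold p0Profile
  calc g n * (A₀ * Real.log (g n ^ 2)⁻¹ ^ p)
      ≤ ((1 + β₀) * Real.sqrt ((n : ℝ) - m) * g m) * (A₀ * ((1 + β₀) * Real.log (g m ^ 2)⁻¹ ^ p)) :=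
        mul_le_mul hc (mul_le_mul_of_nonneg_left h27a hA₀) (mul_nonneg hA₀ (pow_nonneg hPn0 p))
          (by positivity)
    _ = (1 + β₀) ^ 2 * Real.sqrt ((n : ℝ) - m) * (g m * (A₀ * Real.log (g m ^ 2)⁻¹ ^ p)) := by ring

/-- **(2.6) ⇒ (2.8) AS PRINTED for monotone couplings** (`g_m ≤ g_n` for `m ≤ n ≤ K`, which the sign β_j ≥ 0
gives): `B14.FlowIneq28 ε g β′ β₀ K` with `ε_j = g_j · p0Profile A₀ p (g_j)` = `Setup.epsK` along a flow. [cite: Balaban1988Convergent, (2.8) p.256] -/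
theorem flowIneq28_of_26_monotone (S : SmallnessFor γ β' β₀ L p) {A₀ : ℝ} (hA₀ : 0 ≤ A₀)
    (hI : Step.InInterval γ K g) (h26 : B14.FlowIneq26 g β' β₀ K)
    (hmono : ∀ m n, m ≤ n → n ≤ K → g m ≤ g n) :
    B14.FlowIneq28 (fun k => g k * p0Profile A₀ p (g k)) g β' β₀ K := by
  have h27 := flowIneq27_of_26 S hI h26
  intro m n hmn hnK
  have hm : 0 < g m := (hI m (le_trans hmn.le hnK)).1
  have hn : 0 < g n := (hI n hnK).1
  have hnγ : g n ≤ γ := (hI n hnK).2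
  have hmn' : g m ≤ g n := hmono m n hmn.le hnK
  have hPn0 : 0 ≤ Real.log ((g n) ^ 2)⁻¹ := log_inv_sq_nonneg hn (le_trans hnγ S.γ_lt_one.le)
  have hPmono : Real.log ((g n) ^ 2)⁻¹ ≤ Real.log ((g m) ^ 2)⁻¹ := log_inv_sq_mono hm hmn'
  have hPpow : (Real.log ((g n) ^ 2)⁻¹) ^ p ≤ (Real.log ((g m) ^ 2)⁻¹) ^ p :=
    pow_le_pow_left₀ hPn0 hPmono p
  have hc := chain26 S hI h26 hmn hnK
  obtain ⟨_, h27b⟩ := h27 m n hmn hnK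
  have h26d : g m ≤ (1 + β₀) * g n := (h26 m n hmn hnK).2
  unfold p0Profile
  refine ⟨?_, ?_⟩
  · have hfac : 0 ≤ (1 + β₀) * Real.sqrt ((n : ℝ) - m) * g m := by
      have := S.β₀_pos; positivity
    calc g n * (A₀ * Real.log (g n ^ 2)⁻¹ ^ p)
        ≤ ((1 + β₀) * Real.sqrt ((n : ℝ) - m) * g m) * (A₀ * Real.log (g m ^ 2)⁻¹ ^ p) :=
          mul_le_mul hc (mul_le_mul_of_nonneg_left hPpow hA₀)
            (mul_nonneg hA₀ (pow_nonneg hPn0 p)) hfac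
      _ = (1 + β₀) * Real.sqrt ((n : ℝ) - m) * (g m * (A₀ * Real.log (g m ^ 2)⁻¹ ^ p)) := by
          ring
  · have hfac : 0 ≤ (1 + β₀) * g n := by have := S.β₀_pos; positivity
    calc g m * (A₀ * Real.log (g m ^ 2)⁻¹ ^ p)
        ≤ ((1 + β₀) * g n) *
            (A₀ * ((1 + g n ^ 2 * β' * ((n : ℝ) - m)) ^ β₀ * Real.log (g n ^ 2)⁻¹ ^ p)) :=
          mul_le_mul h26d (mul_le_mul_of_nonneg_left h27b hA₀)
            (mul_nonneg hA₀ (pow_nonneg (le_trans hPn0 hPmono) p)) hfac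
      _ = (1 + β₀) * (1 + g n ^ 2 * β' * ((n : ℝ) - m)) ^ β₀ *
            (g n * (A₀ * Real.log (g n ^ 2)⁻¹ ^ p)) := by ring

/-- **(2.6) ⇒ (2.8) AS PRINTED, general couplings, by shrinking the β₀ of (2.6)** ("β₀ > 0 can be chosen
arbitrarily small"): if (2.6) holds with `β₁ ≤ β₀`, `(1+β₁)² ≤ 1+β₀`, then (2.8) holds with `β₀`. [cite: Balaban1988Convergent, (2.8) p.256] -/
theorem flowIneq28_of_26 {β₁ : ℝ} (S : SmallnessFor γ β' β₁ L p) {A₀ : ℝ} (hA₀ : 0 ≤ A₀)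
    (hβ₁₀ : β₁ ≤ β₀) (hsq : (1 + β₁) ^ 2 ≤ 1 + β₀)
    (hI : Step.InInterval γ K g) (h26 : B14.FlowIneq26 g β' β₁ K) :
    B14.FlowIneq28 (fun k => g k * p0Profile A₀ p (g k)) g β' β₀ K := by
  have h27 := flowIneq27_of_26 S hI h26
  intro m n hmn hnK
  have hm : 0 < g m := (hI m (le_trans hmn.le hnK)).1
  have hn : 0 < g n := (hI n hnK).1
  have hnγ : g n ≤ γ := (hI n hnK).2
  have hmγ : g m ≤ γ := (hI m (le_trans hmn.le hnK)).2
  have hPn0 : 0 ≤ Real.log ((g n) ^ 2)⁻¹ := log_inv_sq_nonneg hn (le_trans hnγ S.γ_lt_one.le)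
  have hPm0 : 0 ≤ Real.log ((g m) ^ 2)⁻¹ := log_inv_sq_nonneg hm (le_trans hmγ S.γ_lt_one.le)
  have hεm0 : 0 ≤ g m * p0Profile A₀ p (g m) := by
    unfold p0Profile; exact mul_nonneg hm.le (mul_nonneg hA₀ (pow_nonneg hPm0 p))
  have hεn0 : 0 ≤ g n * p0Profile A₀ p (g n) := by
    unfold p0Profile; exact mul_nonneg hn.le (mul_nonneg hA₀ (pow_nonneg hPn0 p))
  refine ⟨?_, ?_⟩
  · have h := eps28a_sq_of_26 S hA₀ hI h26 hmn hnK
    refine le_trans h ?_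
    have hs : 0 ≤ Real.sqrt ((n : ℝ) - m) := Real.sqrt_nonneg _
    have : (1 + β₁) ^ 2 * Real.sqrt ((n : ℝ) - m) ≤ (1 + β₀) * Real.sqrt ((n : ℝ) - m) :=
      mul_le_mul_of_nonneg_right hsq hs
    exact mul_le_mul_of_nonneg_right this hεm0
  · obtain ⟨_, h27b⟩ := h27 m n hmn hnK
    have h26d : g m ≤ (1 + β₁) * g n := (h26 m n hmn hnK).2
    have h26d' : g m ≤ (1 + β₀) * g n := le_trans h26d (by nlinarith)
    have hX := X_nonneg S.β'_nonneg (g n) hmn.le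
    have hXmono : (1 + g n ^ 2 * β' * ((n : ℝ) - m)) ^ β₁ ≤ (1 + g n ^ 2 * β' * ((n : ℝ) - m)) ^ β₀ :=
      Real.rpow_le_rpow_of_exponent_le (by linarith) hβ₁₀
    have h27b' : Real.log (g m ^ 2)⁻¹ ^ p ≤ (1 + g n ^ 2 * β' * ((n : ℝ) - m)) ^ β₀ * Real.log (g n ^ 2)⁻¹ ^ p :=
      le_trans h27b (mul_le_mul_of_nonneg_right hXmono (pow_nonneg hPn0 p))
    have hfac : 0 ≤ (1 + β₀) * g n := by
      have := S.β₀_pos; have : 0 < β₀ := by linarith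
      positivity
    unfold p0Profile
    calc g m * (A₀ * Real.log (g m ^ 2)⁻¹ ^ p)
        ≤ ((1 + β₀) * g n) *
            (A₀ * ((1 + g n ^ 2 * β' * ((n : ℝ) - m)) ^ β₀ * Real.log (g n ^ 2)⁻¹ ^ p)) :=
          mul_le_mul h26d' (mul_le_mul_of_nonneg_left h27b' hA₀)
            (mul_nonneg hA₀ (pow_nonneg hPm0 p)) hfac
      _ = (1 + β₀) * (1 + g n ^ 2 * β' * ((n : ℝ) - m)) ^ β₀ *
            (g n * (A₀ * Real.log (g n ^ 2)⁻¹ ^ p)) := by ring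

/-- **(2.7) ⇒ (2.9)** for sizes obeying (2.5) (`B14.IsRj L p (g_j) (R_j)`, exponent `r = p`), given
`1 + β₀ ≤ L` (first member) and positivity of the couplings. [cite: Balaban1988Convergent, (2.9) p.256] -/
theorem flowIneq29_of_27 (hL : 2 ≤ L) (hβ₀ : 0 ≤ β₀) (hβL : 1 + β₀ ≤ (L : ℝ)) (hβ' : 0 ≤ β')
    (hI : Step.InInterval γ K g) (hγ1 : γ ≤ 1) (R : ℕ → ℕ) (hR : ∀ j, j ≤ K → B14.IsRj L p (g j) (R j))
    (h27 : B14.FlowIneq27 g β' β₀ p K) : FlowIneq29 R g L β' β₀ K := by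
  have hL2 : (2 : ℝ) ≤ L := by exact_mod_cast hL
  have hL0 : (0 : ℝ) < L := by linarith
  have hLn : 1 ≤ L := by omega
  intro m n hmn hnK
  obtain ⟨h27a, h27b⟩ := h27 m n hmn hnK
  obtain ⟨sn, hRn, hlen, hminn⟩ := hR n hnK
  obtain ⟨sm, hRm, hlem, hminm⟩ := hR m (le_trans hmn.le hnK)
  have hn : 0 < g n := (hI n hnK).1
  have hm : 0 < g m := (hI m (le_trans hmn.le hnK)).1
  set Pn := (Real.log ((g n) ^ 2)⁻¹) ^ p with hPn
  set Pm := (Real.log ((g m) ^ 2)⁻¹) ^ p with hPm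
  set X := (g n) ^ 2 * β' * ((n : ℝ) - m) with hX
  have hPm0 : 0 ≤ Pm := pow_nonneg (log_inv_sq_nonneg hm (le_trans (hI m (le_trans hmn.le hnK)).2 hγ1)) p
  have hRn_one : (1 : ℝ) ≤ R n := by
    rw [hRn]; exact_mod_cast Nat.one_le_pow _ _ (by omega)
  refine ⟨?_, ?_⟩
  · have h1 : Pn ≤ ((L ^ (sm + 1) : ℕ) : ℝ) := by
      calc Pn ≤ (1 + β₀) * Pm := h27a
        _ ≤ (L : ℝ) * Pm := mul_le_mul_of_nonneg_right hβL hPm0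
        _ ≤ (L : ℝ) * (R m : ℝ) := mul_le_mul_of_nonneg_left hlem hL0.le
        _ = ((L ^ (sm + 1) : ℕ) : ℝ) := by rw [hRm]; push_cast; ring
    have h2 : sn ≤ sm + 1 := hminn (sm + 1) h1
    calc (R n : ℝ) = ((L ^ sn : ℕ) : ℝ) := by rw [hRn]
      _ ≤ ((L ^ (sm + 1) : ℕ) : ℝ) := by exact_mod_cast Nat.pow_le_pow_right hLn h2
      _ = (L : ℝ) * (R m : ℝ) := by rw [hRm]; push_cast; ring
  · have hX0 : 0 ≤ X := by rw [hX]; exact X_nonneg hβ' (g n) hmn.le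
    have hXr1 : 1 ≤ (1 + X) ^ β₀ := Real.one_le_rpow (by linarith) hβ₀
    rcases Nat.eq_zero_or_pos sm with hsm | hsm
    · have hRm1 : (R m : ℝ) = 1 := by rw [hRm, hsm]; simp
      rw [hRm1]
      have : (1 : ℝ) ≤ (L : ℝ) * (1 + X) ^ β₀ := by nlinarith
      nlinarith
    · have hnot : ¬ (sm ≤ sm - 1) := by omega
      have hgt : ((L ^ (sm - 1) : ℕ) : ℝ) < Pm :=
        not_le.mp (fun h => hnot (hminm (sm - 1) h))
      have e : (R m : ℝ) = (L : ℝ) * ((L ^ (sm - 1) : ℕ) : ℝ) := by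
        rw [hRm]; push_cast
        rw [← pow_succ']; congr 1; omega
      rw [e]
      calc (L : ℝ) * ((L ^ (sm - 1) : ℕ) : ℝ) ≤ (L : ℝ) * Pm :=
            mul_le_mul_of_nonneg_left hgt.le hL0.le
        _ ≤ (L : ℝ) * ((1 + X) ^ β₀ * Pn) := mul_le_mul_of_nonneg_left h27b hL0.le
        _ ≤ (L : ℝ) * ((1 + X) ^ β₀ * (R n : ℝ)) := by
            apply mul_le_mul_of_nonneg_left _ hL0.le
            exact mul_le_mul_of_nonneg_left hlen (le_trans zero_le_one hXr1)
        _ = (L : ℝ) * (1 + X) ^ β₀ * (R n : ℝ) := by ring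

/-- **The third members of (2.7), (2.8), (2.9)** for `m < n ≤ K`: `(1+X)^{β₀} ≤ (1+β₀)(n−m)^{β₀}`,
`(1+β₀)(1+X)^{β₀} ≤ (1+β₀)²(n−m)^{β₀}`, `L(1+X)^{β₀} ≤ (L+1)(n−m)^{β₀}` (`X = g_n²β′(n−m)`), given `γ²β′ ≤ 1`,
`β₀ ≤ 1` and — for the last one — `Lβ₀ ≤ 1`. [cite: Balaban1988Convergent, (2.7)–(2.9) pp.255–256] -/
theorem third_members (S : SmallnessFor γ β' β₀ L p) (hI : Step.InInterval γ K g)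
    {m n : ℕ} (hmn : m < n) (hnK : n ≤ K) :
    (1 + (g n) ^ 2 * β' * ((n : ℝ) - m)) ^ β₀ ≤ (1 + β₀) * ((n : ℝ) - m) ^ β₀ ∧
    (1 + β₀) * (1 + (g n) ^ 2 * β' * ((n : ℝ) - m)) ^ β₀ ≤ (1 + β₀) ^ 2 * ((n : ℝ) - m) ^ β₀ ∧
    (L : ℝ) * (1 + (g n) ^ 2 * β' * ((n : ℝ) - m)) ^ β₀ ≤ ((L : ℝ) + 1) * ((n : ℝ) - m) ^ β₀ := by
  have hn : 0 < g n := (hI n hnK).1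
  have hnγ : g n ≤ γ := (hI n hnK).2
  have hd := one_le_sub_of_lt hmn
  have hc0 : 0 ≤ (g n) ^ 2 * β' := by have := S.β'_nonneg; positivity
  have hc1 : (g n) ^ 2 * β' ≤ 1 := by
    have : (g n) ^ 2 ≤ γ ^ 2 := pow_le_pow_left₀ hn.le hnγ 2
    have := mul_le_mul_of_nonneg_right this S.β'_nonneg
    linarith [S.h27c]
  have h := ineq27c hc0 hc1 hd S.β₀_pos.le S.β₀_le_one
  have hdr : 0 ≤ ((n : ℝ) - m) ^ β₀ := Real.rpow_nonneg (by linarith) β₀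
  refine ⟨h, ?_, ?_⟩
  · have hb : 0 ≤ 1 + β₀ := by have := S.β₀_pos; linarith
    calc (1 + β₀) * (1 + (g n) ^ 2 * β' * ((n : ℝ) - m)) ^ β₀
        ≤ (1 + β₀) * ((1 + β₀) * ((n : ℝ) - m) ^ β₀) := mul_le_mul_of_nonneg_left h hb
      _ = (1 + β₀) ^ 2 * ((n : ℝ) - m) ^ β₀ := by ring
  · have hL0 : (0 : ℝ) ≤ L := by positivity
    calc (L : ℝ) * (1 + (g n) ^ 2 * β' * ((n : ℝ) - m)) ^ β₀
        ≤ (L : ℝ) * ((1 + β₀) * ((n : ℝ) - m) ^ β₀) := mul_le_mul_of_nonneg_left h hL0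
      _ = ((L : ℝ) + (L : ℝ) * β₀) * ((n : ℝ) - m) ^ β₀ := by ring
      _ ≤ ((L : ℝ) + 1) * ((n : ℝ) - m) ^ β₀ := by
          apply mul_le_mul_of_nonneg_right _ hdr
          linarith [S.h29c]

end Implication

/-! ## C. Along an RG flow: (0.20) + 0 ≤ β ≤ β′ + smallness ⇒ (2.6)–(2.9) with the printed constants -/

section AlongFlow
variable (F : Flow) (K : ℕ) {γ β' β₀ : ℝ} {L p : ℕ}

/-- Monotone couplings from the sign of β along the flow: (0.20) and `β_{j+1}(g_j) ≥ 0` for `j < K` give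
`g_m ≤ g_n` for `m ≤ n ≤ K`. [cite: Balaban1987RG1, (0.20) p.256] -/
theorem g_mono_of_betaNonneg (hpos : ∀ j, j ≤ K → 0 < F.g j)
    (hrg : F.SatisfiesRG K) (hlb : ∀ j, j < K → 0 ≤ F.β (j + 1) (F.g j))
    {m n : ℕ} (hmn : m ≤ n) (hnK : n ≤ K) : F.g m ≤ F.g n := by
  have hm : 0 < F.g m := hpos m (le_trans hmn hnK)
  have hn : 0 < F.g n := hpos n hnK
  have hinv := B14.inv_sq_le_of_rg_nonneg F K hrg hlb m n hmn hnK
  have hsq : F.g m ^ 2 ≤ F.g n ^ 2 := by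
    rwa [one_div_le_one_div (by positivity) (by positivity)] at hinv
  exact (pow_le_pow_iff_left₀ hm.le hn.le two_ne_zero).1 hsq

/-- **The EXACT content of the last member of (2.6)**: along a flow satisfying (0.20) with positive couplings,
`g_m ≤ (1+β₀) g_n` holds IFF the partial sum of the β-terms between the two scales is bounded below by
`−β₀(2+β₀)/g_m²` — a condition on partial sums, weaker than the pointwise sign (cell GAPS.md G-ref2-2/3). [cite: Balaban1988Convergent, (2.6) p.255] -/
theorem flow26d_iff_partialSum (β₀ : ℝ) (hpos : ∀ j, j ≤ K → 0 < F.g j) (hrg : F.SatisfiesRG K)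
    {m n : ℕ} (hmn : m ≤ n) (hnK : n ≤ K) (hβ₀ : 0 ≤ β₀) :
    F.g m ≤ (1 + β₀) * F.g n ↔
      -(β₀ * (2 + β₀)) / (F.g m) ^ 2 ≤ ∑ j ∈ Finset.Ico m n, F.β (j + 1) (F.g j) := by
  have hm : 0 < F.g m := hpos m (le_trans hmn hnK)
  have hn : 0 < F.g n := hpos n hnK
  have tel : ∑ j ∈ Finset.Ico m n, F.β (j + 1) (F.g j) = 1 / (F.g m) ^ 2 - 1 / (F.g n) ^ 2 := by
    have := Step.inv_sq_telescope ((Step.rgEq_iff F K).mp hrg) hmn hnK; linarith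
  rw [tel]
  have key : F.g m ≤ (1 + β₀) * F.g n ↔ (F.g m) ^ 2 ≤ ((1 + β₀) * F.g n) ^ 2 :=
    (pow_le_pow_iff_left₀ hm.le (by positivity) two_ne_zero).symm
  rw [key]
  have e : (1 / F.g m ^ 2 - 1 / F.g n ^ 2) * F.g m ^ 2 = 1 - F.g m ^ 2 / F.g n ^ 2 := by
    field_simp
  have hn2 : 0 < F.g n ^ 2 := by positivity
  constructor
  · intro h
    rw [div_le_iff₀ (by positivity), e]
    have : F.g m ^ 2 / F.g n ^ 2 ≤ (1 + β₀) ^ 2 := by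
      rw [div_le_iff₀ hn2]; rw [mul_pow] at h; exact h
    nlinarith
  · intro h
    rw [div_le_iff₀ (by positivity), e] at h
    have : F.g m ^ 2 / F.g n ^ 2 ≤ (1 + β₀) ^ 2 := by nlinarith
    rw [div_le_iff₀ hn2] at this
    rw [mul_pow]; exact this

/-- **T11.F modulo the sign of β.**  For a flow satisfying (0.20) up to `K`, in the interval `]0, γ]`, with
`0 ≤ β_{j+1}(g_j) ≤ β′` along the flow and `SmallnessFor γ β′ β₀ L p`: (2.6) (`B14.FlowIneq26`), (2.7)
(`B14.FlowIneq27`, exponent `p`), (2.8) (`B14.FlowIneq28` for `Setup.epsK A₀ p`, `A₀ ≥ 0`) and (2.9) (`FlowIneq29`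
for any sizes obeying (2.5) with `r = p`) all hold with the PRINTED constants.  The sign is the one unprinted input
(cell T09.F); (2.46) needs more (`sumIneq246_needs_positive_b`, `flowControl_of_betaPos`). [cite: Balaban1988Convergent, (2.6)–(2.9) pp.255–256] -/
theorem flowControl_of_betaSign (S : SmallnessFor γ β' β₀ L p) {A₀ : ℝ} (hA₀ : 0 ≤ A₀)
    (R : ℕ → ℕ) (hR : ∀ j, j ≤ K → B14.IsRj L p (F.g j) (R j))
    (hrg : F.SatisfiesRG K) (hI : F.InInterval γ K)
    (hub : ∀ j, j < K → F.β (j + 1) (F.g j) ≤ β') (hlb : ∀ j, j < K → 0 ≤ F.β (j + 1) (F.g j)) :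
    B14.FlowIneq26 F.g β' β₀ K ∧ B14.FlowIneq27 F.g β' β₀ p K ∧
      B14.FlowIneq28 (epsK A₀ p F) F.g β' β₀ K ∧ FlowIneq29 R F.g L β' β₀ K := by
  have hpos : ∀ j, j ≤ K → 0 < F.g j := fun j hj => (hI j hj).1
  have hI' : Step.InInterval γ K F.g := (Step.inInterval_iff F γ K).mp hI
  have h26 : B14.FlowIneq26 F.g β' β₀ K :=
    B14.flowIneq26_of_rg_two_sided F K β' β₀ S.β'_nonneg S.β₀_pos.le hpos hrg hub hlb
  have h27 := flowIneq27_of_26 S hI' h26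
  have hβL : 1 + β₀ ≤ (L : ℝ) := by
    have := S.β₀_le_one; have : (2 : ℝ) ≤ L := by exact_mod_cast S.hL
    linarith
  refine ⟨h26, h27, ?_, flowIneq29_of_27 S.hL S.β₀_pos.le hβL S.β'_nonneg hI' S.γ_lt_one.le R hR h27⟩
  exact flowIneq28_of_26_monotone S hA₀ hI' h26
    (fun m n hmn hnK => g_mono_of_betaNonneg F K hpos hrg hlb hmn hnK)

end AlongFlow

/-! ## D. (2.46): the coupling-sum step needs — and follows from — a POSITIVE lower bound on β along the flow -/

section Sum246
variable (F : Flow) (K : ℕ)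

/-- Running from a lower bound `b` on the β-terms along the flow: `1/g_n² + b(n−m) ≤ 1/g_m²` for `m ≤ n ≤ K`
(telescoped (0.20), `Step.inv_sq_telescope`). [cite: Balaban1987RG1, (0.20) p.256] -/
theorem running_of_betaLower {b : ℝ}
    (hrg : F.SatisfiesRG K) (hlb : ∀ j, j < K → b ≤ F.β (j + 1) (F.g j))
    {m n : ℕ} (hmn : m ≤ n) (hnK : n ≤ K) :
    1 / (F.g n) ^ 2 + b * ((n : ℝ) - m) ≤ 1 / (F.g m) ^ 2 := by
  have tel := Step.inv_sq_telescope ((Step.rgEq_iff F K).mp hrg) hmn hnK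
  have hsum : ∑ _j ∈ Finset.Ico m n, b ≤ ∑ j ∈ Finset.Ico m n, F.β (j + 1) (F.g j) := by
    apply Finset.sum_le_sum
    intro j hj
    exact hlb j (lt_of_lt_of_le (Finset.mem_Ico.mp hj).2 hnK)
  have hc : ∑ _j ∈ Finset.Ico m n, b = b * ((n : ℝ) - m) := by
    rw [Finset.sum_const, Nat.card_Ico, nsmul_eq_mul, Nat.cast_sub hmn]; ring
  linarith

/-- **(2.46), middle member, at one `n`**: (0.20), `b ≤ β_{j+1}(g_j)` along the flow with `b > 0`, positive
couplings, `g_n⁴ ≤ b` and `g_n ≤ 1/2` give `Σ_{j=1}^{n} g_j^{κ₀} < g_n^{κ₀−6}` for every `κ₀ ≥ 7`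
(via `Step.sum_sixth_powers_le`: `Σ_{j<n} g_j⁶ ≤ g_n⁴/(2b)`). [cite: Balaban1988Convergent, (2.46) p.263] -/
theorem sum246_of_betaPos {b : ℝ} (hb : 0 < b)
    (hpos : ∀ j, j ≤ K → 0 < F.g j) (hrg : F.SatisfiesRG K)
    (hlb : ∀ j, j < K → b ≤ F.β (j + 1) (F.g j))
    {n : ℕ} (hnK : n ≤ K) (hg4 : (F.g n) ^ 4 ≤ b) (hg12 : F.g n ≤ 1 / 2)
    {κ₀ : ℕ} (hκ : 7 ≤ κ₀) :
    ∑ j ∈ Finset.Icc 1 n, (F.g j) ^ κ₀ < (F.g n) ^ (κ₀ - 6) := by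
  have hn : 0 < F.g n := hpos n hnK
  have hlb0 : ∀ j, j < K → 0 ≤ F.β (j + 1) (F.g j) := fun j hj => le_trans hb.le (hlb j hj)
  have hterm : ∀ j ∈ Finset.Icc 1 n, (F.g j) ^ κ₀ ≤ (F.g j) ^ 6 * (F.g n) ^ (κ₀ - 6) := by
    intro j hj
    have hjn : j ≤ n := (Finset.mem_Icc.mp hj).2
    have hj0 : 0 < F.g j := hpos j (le_trans hjn hnK)
    have hle : F.g j ≤ F.g n := g_mono_of_betaNonneg F K hpos hrg hlb0 hjn hnK
    have e : (F.g j) ^ κ₀ = (F.g j) ^ 6 * (F.g j) ^ (κ₀ - 6) := by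
      rw [← pow_add]; congr 1; omega
    rw [e]
    exact mul_le_mul_of_nonneg_left (pow_le_pow_left₀ hj0.le hle _) (by positivity)
  have h1 : ∑ j ∈ Finset.Icc 1 n, (F.g j) ^ κ₀ ≤
      (∑ j ∈ Finset.Icc 1 n, (F.g j) ^ 6) * (F.g n) ^ (κ₀ - 6) := by
    rw [Finset.sum_mul]; exact Finset.sum_le_sum hterm
  have h2 : ∑ j ∈ Finset.Icc 1 n, (F.g j) ^ 6 ≤ ∑ j ∈ Finset.range (n + 1), (F.g j) ^ 6 := by
    apply Finset.sum_le_sum_of_subset_of_nonneg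
    · intro j hj
      rw [Finset.mem_range]; exact Nat.lt_succ_of_le (Finset.mem_Icc.mp hj).2
    · intro j _ _; positivity
  have h3 : ∑ j ∈ Finset.range n, (F.g j) ^ 6 ≤ 1 / (2 * b * (1 / (F.g n) ^ 2) ^ 2) := by
    apply Step.sum_sixth_powers_le (by positivity) hb
    · intro j hj; exact hpos j (le_trans hj.le hnK)
    · intro j hj; exact running_of_betaLower F K hrg hlb hj.le hnK
  have h3' : 1 / (2 * b * (1 / (F.g n) ^ 2) ^ 2) = (F.g n) ^ 4 / (2 * b) := by
    field_simp
  have h4 : ∑ j ∈ Finset.range (n + 1), (F.g j) ^ 6 ≤ (F.g n) ^ 4 / (2 * b) + (F.g n) ^ 6 := by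
    rw [Finset.sum_range_succ, ← h3']; linarith
  have h5 : (F.g n) ^ 4 / (2 * b) ≤ 1 / 2 := by
    rw [div_le_iff₀ (by positivity)]; linarith
  have h6 : (F.g n) ^ 6 < 1 / 2 := by
    have : (F.g n) ^ 6 ≤ (1 / 2) ^ 6 := pow_le_pow_left₀ hn.le hg12 6
    linarith [show ((1:ℝ) / 2) ^ 6 < 1 / 2 by norm_num]
  have hS : ∑ j ∈ Finset.Icc 1 n, (F.g j) ^ 6 < 1 := by linarith
  have hpow : 0 < (F.g n) ^ (κ₀ - 6) := by positivity
  calc ∑ j ∈ Finset.Icc 1 n, (F.g j) ^ κ₀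
      ≤ (∑ j ∈ Finset.Icc 1 n, (F.g j) ^ 6) * (F.g n) ^ (κ₀ - 6) := h1
    _ < 1 * (F.g n) ^ (κ₀ - 6) := mul_lt_mul_of_pos_right hS hpow
    _ = (F.g n) ^ (κ₀ - 6) := one_mul _

/-- **(2.46), middle member, for the whole run** (`SumIneq246`): from (0.20), the interval hypothesis with
`γ⁴ ≤ b`, `γ ≤ 1/2`, and `b ≤ β_{j+1}(g_j)` (b > 0) along the flow. [cite: Balaban1988Convergent, (2.46) p.263] -/
theorem sumIneq246_of_betaPos {b γ : ℝ} (hb : 0 < b) (hγ4 : γ ^ 4 ≤ b) (hγ2 : γ ≤ 1 / 2)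
    (hrg : F.SatisfiesRG K) (hI : F.InInterval γ K)
    (hlb : ∀ j, j < K → b ≤ F.β (j + 1) (F.g j)) {κ₀ : ℕ} (hκ : 7 ≤ κ₀) :
    SumIneq246 F.g κ₀ K := by
  intro n hnK
  have hpos : ∀ j, j ≤ K → 0 < F.g j := fun j hj => (hI j hj).1
  have hn := hI n hnK
  refine sum246_of_betaPos F K hb hpos hrg hlb hnK ?_ (le_trans hn.2 hγ2) hκ
  exact le_trans (pow_le_pow_left₀ hn.1.le hn.2 4) hγ4

/-- **(2.46), middle and last members, in the shape of the (2.46) clause of `B14.Bounds245to249`**: from the first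
member (what (2.44) summed over j gives, `|𝐑_k| ≤ R₁ Σ_n |Γ_n| Σ_{j≤n} g_j^{κ₀}`), nonnegative volumes,
`R₁ ≥ 0` with `R₁ g_n^{κ₀−6} ≤ 1` ("for … g sufficiently small"), and the positivity hypotheses of
`sumIneq246_of_betaPos`. [cite: Balaban1988Convergent, (2.46) p.263] -/
theorem bounds246_of_betaPos {b γ R₁ Rtot : ℝ} (hb : 0 < b) (hγ4 : γ ^ 4 ≤ b) (hγ2 : γ ≤ 1 / 2)
    (hR₁ : 0 ≤ R₁) (hrg : F.SatisfiesRG K) (hI : F.InInterval γ K)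
    (hlb : ∀ j, j < K → b ≤ F.β (j + 1) (F.g j)) {κ₀ : ℕ} (hκ : 7 ≤ κ₀)
    (gammaVol : ℕ → ℝ) (hvol : ∀ n, 0 ≤ gammaVol n) {k : ℕ} (hk : k ≤ K)
    (hsmall : ∀ n, n ≤ K → R₁ * (F.g n) ^ (κ₀ - 6) ≤ 1)
    (hfirst : |Rtot| ≤ R₁ * ∑ n ∈ Finset.Icc 1 k, gammaVol n * ∑ j ∈ Finset.Icc 1 n, (F.g j) ^ κ₀) :
    |Rtot| ≤ R₁ * ∑ n ∈ Finset.Icc 1 k, gammaVol n * (F.g n) ^ (κ₀ - 6) ∧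
      R₁ * ∑ n ∈ Finset.Icc 1 k, gammaVol n * (F.g n) ^ (κ₀ - 6) ≤ ∑ n ∈ Finset.Icc 1 k, gammaVol n := by
  have hsum := sumIneq246_of_betaPos F K hb hγ4 hγ2 hrg hI hlb hκ
  refine ⟨?_, ?_⟩
  · refine le_trans hfirst (mul_le_mul_of_nonneg_left ?_ hR₁)
    apply Finset.sum_le_sum
    intro n hn
    have hnK : n ≤ K := le_trans (Finset.mem_Icc.mp hn).2 hk
    exact mul_le_mul_of_nonneg_left (hsum n hnK).le (hvol n)
  · rw [Finset.mul_sum]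
    apply Finset.sum_le_sum
    intro n hn
    have hnK : n ≤ K := le_trans (Finset.mem_Icc.mp hn).2 hk
    calc R₁ * (gammaVol n * (F.g n) ^ (κ₀ - 6)) = gammaVol n * (R₁ * (F.g n) ^ (κ₀ - 6)) := by ring
      _ ≤ gammaVol n * 1 := mul_le_mul_of_nonneg_left (hsmall n hnK) (hvol n)
      _ = gammaVol n := mul_one _

/-- NEGATIVE bookkeeping fact (census): the SIGN of β (b = 0) is NOT enough for (2.46) — the constant flow
`g_j ≡ 1/2`, `β ≡ 0` satisfies (0.20), the interval hypothesis with `γ = 1/2` and `β ≥ 0` along the flow, and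
violates `SumIneq246` with `κ₀ = 7` at `K = n = 65` (65·2⁻⁷ > 2⁻¹); sharpens `Step.interval_hyp_not_sufficient_for_2_46`. [cite: Balaban1988Convergent, (2.46) p.263] -/
theorem sumIneq246_needs_positive_b :
    ∃ F : Flow, F.SatisfiesRG 65 ∧ F.InInterval (1 / 2) 65 ∧ (∀ j, j < 65 → 0 ≤ F.β (j + 1) (F.g j)) ∧
      ¬ SumIneq246 F.g 7 65 := by
  refine ⟨⟨fun _ => 1 / 2, fun _ _ => 0⟩, ?_, ?_, ?_, ?_⟩
  · intro k _; simp
  · intro k _; norm_num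
  · intro j _; simp
  · intro h
    have := h 65 le_rfl
    simp only [Finset.sum_const, Nat.card_Icc] at this
    norm_num at this

/-- **T11.F with the positive lower bound** (the cell's leaf `betaPositive`, bound along the flow as in
`DagBinding`): everything of `flowControl_of_betaSign` AND (2.46) (`SumIneq246`, every `κ₀ ≥ 7`), given in
addition `0 < b ≤ β_{j+1}(g_j)`, `γ⁴ ≤ b`, `γ ≤ 1/2`. [cite: Balaban1988Convergent, (2.6)–(2.9) p.255 and (2.46) p.263] -/
theorem flowControl_of_betaPos {γ β' β₀ : ℝ} {L p : ℕ} (S : SmallnessFor γ β' β₀ L p) {A₀ b : ℝ}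
    (hA₀ : 0 ≤ A₀) (hb : 0 < b) (hγ4 : γ ^ 4 ≤ b) (hγ2 : γ ≤ 1 / 2)
    (R : ℕ → ℕ) (hR : ∀ j, j ≤ K → B14.IsRj L p (F.g j) (R j))
    (hrg : F.SatisfiesRG K) (hI : F.InInterval γ K)
    (hub : ∀ j, j < K → F.β (j + 1) (F.g j) ≤ β') (hlb : ∀ j, j < K → b ≤ F.β (j + 1) (F.g j))
    {κ₀ : ℕ} (hκ : 7 ≤ κ₀) :
    (B14.FlowIneq26 F.g β' β₀ K ∧ B14.FlowIneq27 F.g β' β₀ p K ∧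
      B14.FlowIneq28 (epsK A₀ p F) F.g β' β₀ K ∧ FlowIneq29 R F.g L β' β₀ K) ∧ SumIneq246 F.g κ₀ K :=
  ⟨flowControl_of_betaSign F K S hA₀ R hR hrg hI hub (fun j hj => le_trans hb.le (hlb j hj)),
   sumIneq246_of_betaPos F K hb hγ4 hγ2 hrg hI hlb hκ⟩

end Sum246

/-! ## E. (v1.1) "Similar inequalities hold for other constants" — (2.28); sharp form of the (2.9) restriction;
NECESSITY witnesses for the smallness of `SmallnessFor` -/

section V11
variable {g : ℕ → ℝ} {γ β' β₀ : ℝ} {L p K : ℕ}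

/-- **"Similar inequalities hold for other constants, which will be introduced later"** (p. 256 [14]) — the case of
(2.28) p. 259, `α_{0,j} = g_j C₀ (log g_j⁻²)^{q₀}`, `α_{1,j} = g_j C₁ (log g_j⁻²)^{q₁}` (`B14.alphaJ C q`): the
(2.8)-shaped inequalities hold for `α_{·,j}` exactly as for `ε_j` (same proof, exponent `q`, prefactor `C ≥ 0`), for
monotone couplings under `SmallnessFor γ β′ β₀ L q`. [cite: Balaban1988Convergent, (2.28) p.259] -/
theorem flowIneq28_alphaJ_of_26_monotone (S : SmallnessFor γ β' β₀ L p) {C : ℝ} (hC : 0 ≤ C)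
    (hI : Step.InInterval γ K g) (h26 : B14.FlowIneq26 g β' β₀ K)
    (hmono : ∀ m n, m ≤ n → n ≤ K → g m ≤ g n) :
    B14.FlowIneq28 (fun k => B14.alphaJ C p (g k)) g β' β₀ K := by
  have h := flowIneq28_of_26_monotone S hC hI h26 hmono
  have e : (fun k => B14.alphaJ C p (g k)) = (fun k => g k * p0Profile C p (g k)) := by
    funext k; unfold B14.alphaJ p0Profile; ring
  rw [e]; exact h

/-- **(2.9), third member, SHARP restriction**: `L(1 + g_n²β′(n−m))^{β₀} ≤ (L+1)(n−m)^{β₀}` needs only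
`L β₀ (γ²β′) ≤ 1` (not `Lβ₀ ≤ 1`): since `(1+cd)^{β₀} ≤ (1 + β₀ c) d^{β₀}` with `c = g_n²β′ ≤ γ²β′ ≤ 1`.  So the
restriction recorded as `SmallnessFor.h29c` is sufficient, not necessary; for small γ it holds for every β₀ ≤ 1 and
every L. [cite: Balaban1988Convergent, (2.9) p.256] -/
theorem third_member_29_sharp (hβ' : 0 ≤ β') (hβ₀ : 0 ≤ β₀) (hβ₁ : β₀ ≤ 1) (hc1 : γ ^ 2 * β' ≤ 1)
    (hsharp : (L : ℝ) * β₀ * (γ ^ 2 * β') ≤ 1) (hI : Step.InInterval γ K g)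
    {m n : ℕ} (hmn : m < n) (hnK : n ≤ K) :
    (L : ℝ) * (1 + (g n) ^ 2 * β' * ((n : ℝ) - m)) ^ β₀ ≤ ((L : ℝ) + 1) * ((n : ℝ) - m) ^ β₀ := by
  have hn : 0 < g n := (hI n hnK).1
  have hnγ : g n ≤ γ := (hI n hnK).2
  have hd := one_le_sub_of_lt hmn
  set c := (g n) ^ 2 * β' with hc
  set d := (n : ℝ) - m with hd'
  have hc0 : 0 ≤ c := by rw [hc]; positivity
  have hcγ : c ≤ γ ^ 2 * β' := by
    rw [hc]; exact mul_le_mul_of_nonneg_right (pow_le_pow_left₀ hn.le hnγ 2) hβ'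
  have hc1' : c ≤ 1 := le_trans hcγ hc1
  have h1 : 1 + c * d ≤ (1 + c) * d := by nlinarith
  have h2 : (1 + c * d) ^ β₀ ≤ ((1 + c) * d) ^ β₀ := Real.rpow_le_rpow (by positivity) h1 hβ₀
  rw [Real.mul_rpow (by positivity) (by linarith)] at h2
  have h3 : (1 + c) ^ β₀ ≤ 1 + β₀ * c := rpow_one_add_le_one_add_mul_self (by linarith) hβ₀ hβ₁
  have hdr : 0 ≤ d ^ β₀ := Real.rpow_nonneg (by linarith) β₀
  have hL0 : (0 : ℝ) ≤ L := by positivity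
  have hLc : (L : ℝ) * β₀ * c ≤ 1 :=
    le_trans (mul_le_mul_of_nonneg_left hcγ (by positivity)) hsharp
  calc (L : ℝ) * (1 + c * d) ^ β₀ ≤ (L : ℝ) * ((1 + c) ^ β₀ * d ^ β₀) := mul_le_mul_of_nonneg_left h2 hL0
    _ ≤ (L : ℝ) * ((1 + β₀ * c) * d ^ β₀) := by
        apply mul_le_mul_of_nonneg_left _ hL0
        exact mul_le_mul_of_nonneg_right h3 hdr
    _ = ((L : ℝ) + (L : ℝ) * β₀ * c) * d ^ β₀ := by ring
    _ ≤ ((L : ℝ) + 1) * d ^ β₀ := by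
        apply mul_le_mul_of_nonneg_right _ hdr
        linarith

/-- NECESSITY WITNESS for the smallness in the FIRST member of (2.7) (non-monotone reading of (2.6)): with
`g_m = 1/4`, `g_n = 1/8`, `β₀ = 1`, `p = 2` the last member of (2.6) holds (`g_m ≤ 2 g_n`), all couplings lie in
`]0, ½]`, and `(log g_n⁻²)² ≤ (1+β₀)(log g_m⁻²)²` FAILS (`36 (log 2)² > 32 (log 2)²`): some p-dependent smallness
of the couplings (here `SmallnessFor.h27a`, violated: `log 64 < 10`) is needed; cf. `ineq27a_of_monotone` (none
needed for monotone couplings). [cite: Balaban1988Convergent, (2.7) p.255] -/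
theorem ineq27a_needs_smallness :
    ¬ (∀ (gm gn β₀ : ℝ) (p : ℕ), 0 < gm → gm ≤ 1 / 2 → 0 < gn → gn ≤ 1 / 2 → 0 ≤ β₀ → β₀ ≤ 1 →
        gm ≤ (1 + β₀) * gn → (Real.log (gn ^ 2)⁻¹) ^ p ≤ (1 + β₀) * (Real.log (gm ^ 2)⁻¹) ^ p) := by
  intro h
  have := h (1 / 4) (1 / 8) 1 2 (by norm_num) (by norm_num) (by norm_num) (by norm_num) (by norm_num)
    (by norm_num) (by norm_num)
  have e1 : Real.log (((1 : ℝ) / 8) ^ 2)⁻¹ = 6 * Real.log 2 := by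
    rw [show (((1 : ℝ) / 8) ^ 2)⁻¹ = 2 ^ 6 by norm_num, Real.log_pow]; norm_num
  have e2 : Real.log (((1 : ℝ) / 4) ^ 2)⁻¹ = 4 * Real.log 2 := by
    rw [show (((1 : ℝ) / 4) ^ 2)⁻¹ = 2 ^ 4 by norm_num, Real.log_pow]; norm_num
  rw [e1, e2] at this
  have hl : 0 < Real.log 2 := Real.log_pos (by norm_num)
  nlinarith

/-- NECESSITY WITNESS for the smallness in the SECOND member of (2.7): with `g_n = 1/2`, `g_m² = 1/8`
(`g_m = (1/8)^{1/2}`), `X = 1`, `β₀ = 1`, `p = 2` the first member of (2.6) holds with equality in squared form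
(`g_n² = (1+X) g_m²`), the couplings lie in `]0, ½]`, and `(log g_m⁻²)² ≤ (1+X)^{β₀}(log g_n⁻²)²` FAILS
(`9 (log 2)² > 8 (log 2)²`); here `p ≤ β₀ log g_n⁻²` (`SmallnessFor.h27b`) is violated (`2 > log 4`).  To first
order in X the condition `log g_n⁻² ≥ p/β₀` is exactly what the second member requires. [cite: Balaban1988Convergent, (2.7) p.255] -/
theorem ineq27b_needs_smallness :
    ¬ (∀ (gm gn X β₀ : ℝ) (p : ℕ), 0 < gm → gm ≤ 1 / 2 → 0 < gn → gn ≤ 1 / 2 → 0 ≤ X → 0 ≤ β₀ → β₀ ≤ 1 →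
        gn ^ 2 ≤ (1 + X) * gm ^ 2 →
          (Real.log (gm ^ 2)⁻¹) ^ p ≤ (1 + X) ^ β₀ * (Real.log (gn ^ 2)⁻¹) ^ p) := by
  intro h
  have hgm : (0 : ℝ) < Real.sqrt (1 / 8) := Real.sqrt_pos.mpr (by norm_num)
  have hgm2 : Real.sqrt (1 / 8) ^ 2 = 1 / 8 := Real.sq_sqrt (by norm_num)
  have hgmle : Real.sqrt (1 / 8) ≤ 1 / 2 := by
    rw [show (1 : ℝ) / 2 = Real.sqrt ((1 / 2) ^ 2) by rw [Real.sqrt_sq (by norm_num)]]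
    exact Real.sqrt_le_sqrt (by norm_num)
  have := h (Real.sqrt (1 / 8)) (1 / 2) 1 1 2 hgm hgmle (by norm_num) (by norm_num) (by norm_num) (by norm_num)
    le_rfl (by rw [hgm2]; norm_num)
  rw [hgm2, Real.rpow_one] at this
  have e1 : Real.log (((1 : ℝ) / 8))⁻¹ = 3 * Real.log 2 := by
    rw [show (((1 : ℝ) / 8))⁻¹ = 2 ^ 3 by norm_num, Real.log_pow]; norm_num
  have e2 : Real.log (((1 : ℝ) / 2) ^ 2)⁻¹ = 2 * Real.log 2 := by
    rw [show (((1 : ℝ) / 2) ^ 2)⁻¹ = 2 ^ 2 by norm_num, Real.log_pow]; norm_num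
  rw [e1, e2] at this
  have hl : 0 < Real.log 2 := Real.log_pos (by norm_num)
  nlinarith

end V11

/-! ## F. (v1.2) WHICH members of (2.6)–(2.9) need the sign of β — sign-free and lag-bounded members from the
PRINTED two-sided bound `|β_{j+1}(g_j)| ≤ β′` ([Balaban1987RG1] p. 264: "uniformly bounded on this interval"), and
the located CONSUMERS of the flow inequalities (cell MISSING-B14.md v2 §8).

Census result of this section (every item kernel-checked below; "sign-free" = from (0.20), `0 < g_k ≤ γ`, the printed
UPPER bound `β ≤ β′` and `SmallnessFor`; "lag-bounded" = additionally the printed LOWER bound `−β′ ≤ β` and a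
restriction `(n − m) γ² β′ ≤ β₀(2+β₀)` on the lag of the pair):
* sign-free for ALL pairs `m < n`: (2.6) first three members (`B14.flow26_upper_of_rg`, `chain26`-arithmetic),
  (2.7) second member (`flowIneq27b_signfree`), **(2.8) FIRST member** `ε_n ≤ (1+β₀)(n−m)^{1/2} ε_m`
  (`flowIneq28a_signfree` — by the monotonicity of `x (log x⁻²)^p` on `]0, γ]`, `eps_profile_mono`; this is the member
  consumed at ADJACENT scales by [Balaban1988Convergent] §3 (3.7), (3.8), (3.12)–(3.14), (3.19): "(1+β₀)ε_k"), (2.9)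
  second and third members (`ineq29b_pair`, `third_members`);
* lag-bounded: (2.6) last member (`flow26d_of_betaLower_lag`), (2.7) first member, (2.8) second member, (2.9) first
  member (`pairFlow_of_betaAbs_lag`; adjacent scales: `adjacentFlow_of_betaAbs`; lags `≤ R_n`: `pairFlow_of_betaAbs_le_Rn`,
  whose lag condition is the γ-smallness `Lβ′γ²(log γ⁻²)^p ≤ β₀/2`, `lag_condition_of_le_Rn`); for (2.7a)/(2.9a) the lag may even
  be as large as the "log-room" condition `p·log(1 + g_m²β′(n−m)) ≤ (β₀/2) log g_m⁻²` allows (`ineq27a_logroom`,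
  `flow27a_of_betaLower_logroom`);
* the SIGN (exactly: a lower bound `−B` on all partial sums with `B γ² ≤ β₀(2+β₀)`, `flowControl_of_partialSum`;
  e.g. finitely many negative β-terms, `partialSum_ge_of_card_neg_le`) is consumed — among the consumers LOCATED by the
  cell, not a claim about every page of [III]–[IV] — only by the p. 255 display AS STATED (all `n > m`, i.e. lags up
  to `K`), by the unbounded-lag uses of (2.9a)/(2.7a) in [Balaban1989LargeFieldII] (1.81) p. 385 and p. 386
  ("2p₀(g_{j(X)}) + 2p₀(g_{j(Y)}) − 2p₀(g_{j(Z)}) ≥ 2(1+β₀)⁻¹p₀(g_{j+1})"), and — as a POSITIVE lower bound — by (2.46)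
  (`sumIneq246_needs_positive_b`; sharp power: `sum246_sharp`). -/

section Consumers
variable (F : Flow) (K : ℕ) {γ β' β₀ : ℝ} {L p : ℕ}

/-- `x ↦ x · A₀ (log x⁻²)^p` is NONDECREASING on `]0, y]` as soon as `log y⁻² ≥ 2p` (so on `]0, γ]` under
`SmallnessFor.h27a`): for `0 < x ≤ y < 1`, `x (log x⁻²)^p ≤ y (log y⁻²)^p`.  Proof: with `a = log x⁻² ≥ b = log y⁻²`,
`(a/b)^p ≤ e^{p(a−b)/b} ≤ e^{(a−b)/2} = y/x`. [folklore] -/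
theorem eps_profile_mono {x y A₀ : ℝ} {p : ℕ} (hA₀ : 0 ≤ A₀) (hx : 0 < x) (hxy : x ≤ y) (hy1 : y < 1)
    (hp : 2 * (p : ℝ) ≤ Real.log (y ^ 2)⁻¹) :
    x * p0Profile A₀ p x ≤ y * p0Profile A₀ p y := by
  have hy : 0 < y := lt_of_lt_of_le hx hxy
  unfold p0Profile
  set a := Real.log (x ^ 2)⁻¹ with ha
  set b := Real.log (y ^ 2)⁻¹ with hb
  have hbpos : 0 < b := by
    rw [hb]; apply Real.log_pos
    rw [one_lt_inv₀ (by positivity)]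
    exact pow_lt_one₀ hy.le hy1 two_ne_zero
  have hba : b ≤ a := log_inv_sq_mono hx hxy
  have hab : a - b = 2 * Real.log (y / x) := by
    rw [ha, hb, log_inv_sq, log_inv_sq, Real.log_div hy.ne' hx.ne']; ring
  have key : a ^ p ≤ Real.exp ((1 / 2) * (a - b)) * b ^ p :=
    logpow_27b hbpos (by linarith) (by linarith) (by linarith) (by linarith)
  have hexp : Real.exp ((1 / 2) * (a - b)) = y / x := by
    rw [hab, show (1 : ℝ) / 2 * (2 * Real.log (y / x)) = Real.log (y / x) by ring,
      Real.exp_log (by positivity)]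
  rw [hexp] at key
  have h1 : x * a ^ p ≤ y * b ^ p := by
    have := mul_le_mul_of_nonneg_left key hx.le
    calc x * a ^ p ≤ x * (y / x * b ^ p) := this
      _ = y * b ^ p := by field_simp
  calc x * (A₀ * a ^ p) = A₀ * (x * a ^ p) := by ring
    _ ≤ A₀ * (y * b ^ p) := mul_le_mul_of_nonneg_left h1 hA₀
    _ = y * (A₀ * b ^ p) := by ring

/-- **(2.8), FIRST member, SIGN-FREE, every pair `m < n ≤ K`**: `ε_n ≤ (1+β₀)(n−m)^{1/2} ε_m` (`ε_j = Setup.epsK A₀ p`)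
from (0.20), `0 < g_k ≤ γ`, the PRINTED upper bound `β_{j+1}(g_j) ≤ β′` and `SmallnessFor γ β′ β₀ L p` — no sign,
no monotonicity of the couplings: if `g_n ≤ g_m` then `ε_n ≤ ε_m` by `eps_profile_mono`; if `g_m < g_n` then
`(log g_n⁻²)^p ≤ (log g_m⁻²)^p` and `g_n ≤ (1+β₀)(n−m)^{1/2}g_m` by the first three members of (2.6).  This is the
member consumed, with `n = k+1`, `m = k`, by [Balaban1988Convergent] §3 ("(1+β₀)ε_k" in (3.7), (3.8) p. 266,
(3.12)–(3.14) p. 267, p. 268 and (3.19); the hypothesis `hflow : ε′ ≤ (1+β₀)ε` of `B14Sect3.ineq38_scalar`). [cite: Balaban1988Convergent, (2.8) p.256] -/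
theorem flowIneq28a_signfree (S : SmallnessFor γ β' β₀ L p) {A₀ : ℝ} (hA₀ : 0 ≤ A₀)
    (hrg : F.SatisfiesRG K) (hI : F.InInterval γ K) (hub : ∀ j, j < K → F.β (j + 1) (F.g j) ≤ β')
    {m n : ℕ} (hmn : m < n) (hnK : n ≤ K) :
    epsK A₀ p F n ≤ (1 + β₀) * Real.sqrt ((n : ℝ) - m) * epsK A₀ p F m := by
  have hpos : ∀ j, j ≤ K → 0 < F.g j := fun j hj => (hI j hj).1
  have hm : 0 < F.g m := hpos m (le_trans hmn.le hnK)
  have hn : 0 < F.g n := hpos n hnK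
  have hmγ : F.g m ≤ γ := (hI m (le_trans hmn.le hnK)).2
  have hnγ : F.g n ≤ γ := (hI n hnK).2
  have hd := one_le_sub_of_lt hmn
  have hsq1 : 1 ≤ Real.sqrt ((n : ℝ) - m) := by
    rw [show (1 : ℝ) = Real.sqrt 1 by simp]; exact Real.sqrt_le_sqrt hd
  have hfac1 : 1 ≤ (1 + β₀) * Real.sqrt ((n : ℝ) - m) := by
    have := S.β₀_pos; nlinarith
  have hPm0 : 0 ≤ Real.log ((F.g m) ^ 2)⁻¹ := log_inv_sq_nonneg hm (le_trans hmγ S.γ_lt_one.le)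
  have hεm0 : 0 ≤ F.g m * p0Profile A₀ p (F.g m) := by
    unfold p0Profile; exact mul_nonneg hm.le (mul_nonneg hA₀ (pow_nonneg hPm0 p))
  unfold epsK
  rcases le_or_gt (F.g n) (F.g m) with hle | hlt
  · have h2p : 2 * (p : ℝ) ≤ Real.log ((F.g m) ^ 2)⁻¹ :=
      le_trans (by linarith [S.h27a]) (log_inv_sq_mono hm hmγ)
    have hmono := eps_profile_mono hA₀ hn hle (lt_of_le_of_lt hmγ S.γ_lt_one) h2p
    calc F.g n * p0Profile A₀ p (F.g n) ≤ F.g m * p0Profile A₀ p (F.g m) := hmono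
      _ = 1 * (F.g m * p0Profile A₀ p (F.g m)) := (one_mul _).symm
      _ ≤ (1 + β₀) * Real.sqrt ((n : ℝ) - m) * (F.g m * p0Profile A₀ p (F.g m)) :=
          mul_le_mul_of_nonneg_right hfac1 hεm0
  · have h26a := B14.flow26_upper_of_rg F K β' S.β'_nonneg hpos hrg hub m n hmn hnK
    have h2 := Step.B14_2_6b (c := (F.g n) ^ 2) (β' := β') (d := (n : ℝ) - m) (by positivity)
      S.β'_nonneg hd
    have hsmall : (F.g n) ^ 2 * β' ≤ β₀ * (2 + β₀) := by
      have : (F.g n) ^ 2 ≤ γ ^ 2 := pow_le_pow_left₀ hn.le hnγ 2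
      have := mul_le_mul_of_nonneg_right this S.β'_nonneg
      linarith [S.h26c]
    have h3 := Step.B14_2_6c (c := (F.g n) ^ 2) S.β₀_pos.le hsmall
    have hc : F.g n ≤ (1 + β₀) * Real.sqrt ((n : ℝ) - m) * F.g m := by
      calc F.g n ≤ Real.sqrt (1 + (F.g n) ^ 2 * β' * ((n : ℝ) - m)) * F.g m := h26a
        _ ≤ Real.sqrt (1 + (F.g n) ^ 2 * β') * Real.sqrt ((n : ℝ) - m) * F.g m :=
            mul_le_mul_of_nonneg_right h2 hm.le
        _ ≤ (1 + β₀) * Real.sqrt ((n : ℝ) - m) * F.g m := by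
            apply mul_le_mul_of_nonneg_right _ hm.le
            exact mul_le_mul_of_nonneg_right h3 (Real.sqrt_nonneg _)
    have hPn0 : 0 ≤ Real.log ((F.g n) ^ 2)⁻¹ := log_inv_sq_nonneg hn (le_trans hnγ S.γ_lt_one.le)
    have hPpow : (Real.log ((F.g n) ^ 2)⁻¹) ^ p ≤ (Real.log ((F.g m) ^ 2)⁻¹) ^ p :=
      pow_le_pow_left₀ hPn0 (log_inv_sq_mono hm hlt.le) p
    have hfac : 0 ≤ (1 + β₀) * Real.sqrt ((n : ℝ) - m) * F.g m := by
      have := S.β₀_pos; positivity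
    unfold p0Profile
    calc F.g n * (A₀ * Real.log (F.g n ^ 2)⁻¹ ^ p)
        ≤ ((1 + β₀) * Real.sqrt ((n : ℝ) - m) * F.g m) * (A₀ * Real.log (F.g m ^ 2)⁻¹ ^ p) :=
          mul_le_mul hc (mul_le_mul_of_nonneg_left hPpow hA₀) (mul_nonneg hA₀ (pow_nonneg hPn0 p)) hfac
      _ = (1 + β₀) * Real.sqrt ((n : ℝ) - m) * (F.g m * (A₀ * Real.log (F.g m ^ 2)⁻¹ ^ p)) := by ring

/-- **(2.7), SECOND member, SIGN-FREE, every pair `m < n ≤ K`**: from (0.20), `0 < g_k ≤ γ`, the PRINTED upper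
bound `β ≤ β′` (through the first member of (2.6) squared) and `SmallnessFor.h27b`. [cite: Balaban1988Convergent, (2.7) p.255] -/
theorem flowIneq27b_signfree (S : SmallnessFor γ β' β₀ L p)
    (hrg : F.SatisfiesRG K) (hI : F.InInterval γ K) (hub : ∀ j, j < K → F.β (j + 1) (F.g j) ≤ β')
    {m n : ℕ} (hmn : m < n) (hnK : n ≤ K) :
    (Real.log ((F.g m) ^ 2)⁻¹) ^ p ≤
      (1 + (F.g n) ^ 2 * β' * ((n : ℝ) - m)) ^ β₀ * (Real.log ((F.g n) ^ 2)⁻¹) ^ p := by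
  have hpos : ∀ j, j ≤ K → 0 < F.g j := fun j hj => (hI j hj).1
  have hm : 0 < F.g m := hpos m (le_trans hmn.le hnK)
  have hn : 0 < F.g n := hpos n hnK
  have hmγ : F.g m ≤ γ := (hI m (le_trans hmn.le hnK)).2
  have hnγ : F.g n ≤ γ := (hI n hnK).2
  have h26a := B14.flow26_upper_of_rg F K β' S.β'_nonneg hpos hrg hub m n hmn hnK
  have hX := X_nonneg S.β'_nonneg (F.g n) hmn.le
  have h26a2 : (F.g n) ^ 2 ≤ (1 + (F.g n) ^ 2 * β' * ((n : ℝ) - m)) * (F.g m) ^ 2 := by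
    have h0 : 0 ≤ Real.sqrt (1 + (F.g n) ^ 2 * β' * ((n : ℝ) - m)) * F.g m := by positivity
    have := pow_le_pow_left₀ hn.le h26a 2
    rw [mul_pow, Real.sq_sqrt (by linarith)] at this
    exact this
  exact ineq27b hm (le_trans hmγ S.γ_lt_one.le) hn (lt_of_le_of_lt hnγ S.γ_lt_one) hX h26a2
    (le_trans S.h27b (mul_le_mul_of_nonneg_left (log_inv_sq_mono hn hnγ) S.β₀_pos.le))

/-- **(2.9), FIRST member, for ONE pair**, from a (2.7a)-type inequality with any constant `C ≤ L`:
`(log g_n⁻²)^p ≤ C (log g_m⁻²)^p` and the minimality in (2.5) (`B14.IsRj`) give `R_n ≤ L R_m`. [cite: Balaban1988Convergent, (2.9) p.256] -/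
theorem ineq29a_pair {L p : ℕ} (hL : 1 ≤ L) {gm gn C : ℝ} (hC : C ≤ (L : ℝ))
    (hPm0 : 0 ≤ (Real.log (gm ^ 2)⁻¹) ^ p) {Rm Rn : ℕ}
    (hRm : B14.IsRj L p gm Rm) (hRn : B14.IsRj L p gn Rn)
    (h27a : (Real.log (gn ^ 2)⁻¹) ^ p ≤ C * (Real.log (gm ^ 2)⁻¹) ^ p) :
    (Rn : ℝ) ≤ L * Rm := by
  obtain ⟨sn, hRn', _, hminn⟩ := hRn
  obtain ⟨sm, hRm', hlem, _⟩ := hRm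
  have hL0 : (0 : ℝ) ≤ L := by positivity
  have h1 : (Real.log (gn ^ 2)⁻¹) ^ p ≤ ((L ^ (sm + 1) : ℕ) : ℝ) := by
    calc (Real.log (gn ^ 2)⁻¹) ^ p ≤ C * (Real.log (gm ^ 2)⁻¹) ^ p := h27a
      _ ≤ (L : ℝ) * (Real.log (gm ^ 2)⁻¹) ^ p := mul_le_mul_of_nonneg_right hC hPm0
      _ ≤ (L : ℝ) * (Rm : ℝ) := mul_le_mul_of_nonneg_left hlem hL0
      _ = ((L ^ (sm + 1) : ℕ) : ℝ) := by rw [hRm']; push_cast; ring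
  have h2 : sn ≤ sm + 1 := hminn (sm + 1) h1
  calc (Rn : ℝ) = ((L ^ sn : ℕ) : ℝ) := by rw [hRn']
    _ ≤ ((L ^ (sm + 1) : ℕ) : ℝ) := by exact_mod_cast Nat.pow_le_pow_right hL h2
    _ = (L : ℝ) * (Rm : ℝ) := by rw [hRm']; push_cast; ring

/-- **(2.9), SECOND member, for ONE pair**, from the (2.7b) inequality of the pair and (2.5): with `Θ = (1+X)^{β₀} ≥ 1`,
`(log g_m⁻²)^p ≤ Θ (log g_n⁻²)^p` gives `R_m ≤ L Θ R_n` (`L ≥ 1`).  Sign-free in the sense of this section, since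
(2.7b) is. [cite: Balaban1988Convergent, (2.9) p.256] -/
theorem ineq29b_pair {L p : ℕ} (hL : 1 ≤ L) {gm gn Θ : ℝ} (hΘ : 1 ≤ Θ) {Rm Rn : ℕ}
    (hRm : B14.IsRj L p gm Rm) (hRn : B14.IsRj L p gn Rn)
    (h27b : (Real.log (gm ^ 2)⁻¹) ^ p ≤ Θ * (Real.log (gn ^ 2)⁻¹) ^ p) :
    (Rm : ℝ) ≤ L * Θ * Rn := by
  obtain ⟨sn, hRn', hlen, _⟩ := hRn
  obtain ⟨sm, hRm', _, hminm⟩ := hRm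
  have hL0 : (0 : ℝ) ≤ L := by positivity
  have hL1 : (1 : ℝ) ≤ L := by exact_mod_cast hL
  have hRn_one : (1 : ℝ) ≤ Rn := by
    rw [hRn']; exact_mod_cast Nat.one_le_pow _ _ (by omega)
  set Pm := (Real.log (gm ^ 2)⁻¹) ^ p with hPm
  set Pn := (Real.log (gn ^ 2)⁻¹) ^ p with hPn
  rcases Nat.eq_zero_or_pos sm with hsm | hsm
  · have hRm1 : (Rm : ℝ) = 1 := by rw [hRm', hsm]; simp
    rw [hRm1]
    have : (1 : ℝ) ≤ (L : ℝ) * Θ := by nlinarith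
    nlinarith
  · have hnot : ¬ (sm ≤ sm - 1) := by omega
    have hgt : ((L ^ (sm - 1) : ℕ) : ℝ) < Pm := not_le.mp (fun h => hnot (hminm (sm - 1) h))
    have e : (Rm : ℝ) = (L : ℝ) * ((L ^ (sm - 1) : ℕ) : ℝ) := by
      rw [hRm']; push_cast
      rw [← pow_succ']; congr 1; omega
    rw [e]
    have hΘ0 : 0 ≤ Θ := le_trans zero_le_one hΘ
    calc (L : ℝ) * ((L ^ (sm - 1) : ℕ) : ℝ) ≤ (L : ℝ) * Pm := mul_le_mul_of_nonneg_left hgt.le hL0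
      _ ≤ (L : ℝ) * (Θ * Pn) := mul_le_mul_of_nonneg_left h27b hL0
      _ ≤ (L : ℝ) * (Θ * (Rn : ℝ)) := by
          apply mul_le_mul_of_nonneg_left _ hL0
          exact mul_le_mul_of_nonneg_left hlen hΘ0
      _ = (L : ℝ) * Θ * (Rn : ℝ) := by ring

/-- **Reverse ratio from the printed LOWER bound `−β′ ≤ β`**: (0.20) telescoped gives `1/g_n² ≤ 1/g_m² + β′(n−m)`,
i.e. `g_m ≤ (1 + g_m² β′ (n−m))^{1/2} g_n` for `m ≤ n ≤ K` — the coupling can DEcrease between the scales `m < n` by at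
most this factor. [cite: Balaban1987RG1, (0.20) p.256] -/
theorem flow26d_rev_of_betaLower (hβ' : 0 ≤ β') (hpos : ∀ j, j ≤ K → 0 < F.g j) (hrg : F.SatisfiesRG K)
    (hlb : ∀ j, j < K → -β' ≤ F.β (j + 1) (F.g j)) {m n : ℕ} (hmn : m ≤ n) (hnK : n ≤ K) :
    F.g m ≤ Real.sqrt (1 + (F.g m) ^ 2 * β' * ((n : ℝ) - m)) * F.g n := by
  have hm : 0 < F.g m := hpos m (le_trans hmn hnK)
  have hn : 0 < F.g n := hpos n hnK
  have hd : (0 : ℝ) ≤ (n : ℝ) - m := by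
    have : (m : ℝ) ≤ n := by exact_mod_cast hmn
    linarith
  have hc : 0 ≤ β' * ((n : ℝ) - m) := mul_nonneg hβ' hd
  have h1 : 1 / (F.g n) ^ 2 ≤ 1 / (F.g m) ^ 2 + β' * ((n : ℝ) - m) := by
    have := running_of_betaLower F K hrg hlb hmn hnK; linarith
  have hsq := B14.sq_le_of_inv_sq_le (F.g n) (F.g m) (β' * ((n : ℝ) - m)) hn hm hc h1
  have heq : (1 + (F.g m) ^ 2 * (β' * ((n : ℝ) - m))) = 1 + (F.g m) ^ 2 * β' * ((n : ℝ) - m) := by ring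
  rw [heq] at hsq
  have hfac : 0 ≤ 1 + (F.g m) ^ 2 * β' * ((n : ℝ) - m) := by
    have : 0 ≤ (F.g m) ^ 2 * β' * ((n : ℝ) - m) := by positivity
    linarith
  calc F.g m = Real.sqrt ((F.g m) ^ 2) := by rw [Real.sqrt_sq hm.le]
    _ ≤ Real.sqrt ((1 + (F.g m) ^ 2 * β' * ((n : ℝ) - m)) * (F.g n) ^ 2) := Real.sqrt_le_sqrt hsq
    _ = Real.sqrt (1 + (F.g m) ^ 2 * β' * ((n : ℝ) - m)) * F.g n := by
        rw [Real.sqrt_mul hfac, Real.sqrt_sq hn.le]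

/-- **(2.6), LAST member, from a lower bound on the PARTIAL SUM of the pair** (the exact condition of
`flow26d_iff_partialSum` made usable): `Σ_{j∈[m,n)} β_{j+1}(g_j) ≥ −B` and `B g_m² ≤ β₀(2+β₀)` give
`g_m ≤ (1+β₀) g_n`. [cite: Balaban1988Convergent, (2.6) p.255] -/
theorem flow26d_of_partialSum_ge {B : ℝ} (hβ₀ : 0 ≤ β₀) (hpos : ∀ j, j ≤ K → 0 < F.g j)
    (hrg : F.SatisfiesRG K) {m n : ℕ} (hmn : m ≤ n) (hnK : n ≤ K)
    (hps : -B ≤ ∑ j ∈ Finset.Ico m n, F.β (j + 1) (F.g j)) (hB : B * (F.g m) ^ 2 ≤ β₀ * (2 + β₀)) :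
    F.g m ≤ (1 + β₀) * F.g n := by
  rw [flow26d_iff_partialSum F K β₀ hpos hrg hmn hnK hβ₀]
  have hm : 0 < F.g m := hpos m (le_trans hmn hnK)
  have hm2 : 0 < (F.g m) ^ 2 := by positivity
  have key : -(β₀ * (2 + β₀)) / (F.g m) ^ 2 ≤ -B := by
    rw [div_le_iff₀ hm2]; linarith
  linarith

/-- **(2.6), LAST member, LAG-BOUNDED, from the PRINTED lower bound `−β′ ≤ β`**: for `m ≤ n ≤ K` with
`(n−m) g_m² β′ ≤ β₀(2+β₀)` — in particular for every pair whose lag satisfies `(n−m) γ² β′ ≤ β₀(2+β₀)` —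
`g_m ≤ (1+β₀) g_n`.  No sign of β is used. [cite: Balaban1988Convergent, (2.6) p.255] -/
theorem flow26d_of_betaLower_lag (hβ₀ : 0 ≤ β₀) (hpos : ∀ j, j ≤ K → 0 < F.g j)
    (hrg : F.SatisfiesRG K) (hlb : ∀ j, j < K → -β' ≤ F.β (j + 1) (F.g j))
    {m n : ℕ} (hmn : m ≤ n) (hnK : n ≤ K) (hlag : ((n : ℝ) - m) * (F.g m) ^ 2 * β' ≤ β₀ * (2 + β₀)) :
    F.g m ≤ (1 + β₀) * F.g n := by
  apply flow26d_of_partialSum_ge F K (B := β' * ((n : ℝ) - m)) hβ₀ hpos hrg hmn hnK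
  · have := running_of_betaLower F K hrg hlb hmn hnK
    have tel := Step.inv_sq_telescope ((Step.rgEq_iff F K).mp hrg) hmn hnK
    linarith
  · have e : β' * ((n : ℝ) - m) * (F.g m) ^ 2 = ((n : ℝ) - m) * (F.g m) ^ 2 * β' := by ring
    rw [e]; exact hlag

/-- A lower bound on partial sums from "finitely many negative β-terms" (the shape of the weakest printed hypothesis
for the elementary half, Bauerschmidt–Brydges–Slade, Ann. Henri Poincaré 16 (2015), Assumption (A1)): if
`β_{j+1}(g_j) ≥ −β′` for all `j < K` and at most `N₀` of the indices `j ∈ [m, n)` carry a negative β-term, then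
`Σ_{j∈[m,n)} β_{j+1}(g_j) ≥ −β′ N₀`. [folklore] -/
theorem partialSum_ge_of_card_neg_le (hβ' : 0 ≤ β') (hlb : ∀ j, j < K → -β' ≤ F.β (j + 1) (F.g j))
    {m n : ℕ} (hnK : n ≤ K) {N₀ : ℝ}
    (hcard : (((Finset.Ico m n).filter (fun j => F.β (j + 1) (F.g j) < 0)).card : ℝ) ≤ N₀) :
    -(β' * N₀) ≤ ∑ j ∈ Finset.Ico m n, F.β (j + 1) (F.g j) := by
  classical
  set s := Finset.Ico m n with hs
  set bad := s.filter (fun j => F.β (j + 1) (F.g j) < 0) with hbad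
  have hsplit := Finset.sum_filter_add_sum_filter_not s (fun j => F.β (j + 1) (F.g j) < 0)
    (fun j => F.β (j + 1) (F.g j))
  have hgood : 0 ≤ ∑ j ∈ s.filter (fun j => ¬ F.β (j + 1) (F.g j) < 0), F.β (j + 1) (F.g j) := by
    apply Finset.sum_nonneg
    intro j hj
    exact not_lt.mp (Finset.mem_filter.mp hj).2
  have hbadsum : -β' * (bad.card : ℝ) ≤ ∑ j ∈ bad, F.β (j + 1) (F.g j) := by
    have : ∑ _j ∈ bad, (-β') ≤ ∑ j ∈ bad, F.β (j + 1) (F.g j) := by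
      apply Finset.sum_le_sum
      intro j hj
      have hjs : j ∈ s := (Finset.mem_filter.mp hj).1
      exact hlb j (lt_of_lt_of_le (Finset.mem_Ico.mp hjs).2 hnK)
    rw [Finset.sum_const, nsmul_eq_mul] at this
    linarith
  have hb : -β' * N₀ ≤ -β' * (bad.card : ℝ) := by nlinarith
  rw [← hsplit]
  linarith

/-- `log g_n⁻² ≤ log g_m⁻² + log(1 + g_m² β′ (n−m))` for `m ≤ n ≤ K`, from (0.20) and the printed LOWER bound
`−β′ ≤ β` — the logarithmic size of the couplings grows at most LOGARITHMICALLY in the lag. [cite: Balaban1987RG1, (0.20) p.256] -/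
theorem log_inv_sq_le_of_betaLower (hβ' : 0 ≤ β') (hpos : ∀ j, j ≤ K → 0 < F.g j) (hrg : F.SatisfiesRG K)
    (hlb : ∀ j, j < K → -β' ≤ F.β (j + 1) (F.g j)) {m n : ℕ} (hmn : m ≤ n) (hnK : n ≤ K) :
    Real.log ((F.g n) ^ 2)⁻¹ ≤ Real.log ((F.g m) ^ 2)⁻¹ + Real.log (1 + (F.g m) ^ 2 * β' * ((n : ℝ) - m)) := by
  have hm : 0 < F.g m := hpos m (le_trans hmn hnK)
  have hn : 0 < F.g n := hpos n hnK
  have hd : (0 : ℝ) ≤ (n : ℝ) - m := by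
    have : (m : ℝ) ≤ n := by exact_mod_cast hmn
    linarith
  have hX : 0 ≤ (F.g m) ^ 2 * β' * ((n : ℝ) - m) := by positivity
  have h1 : 1 / (F.g n) ^ 2 ≤ 1 / (F.g m) ^ 2 + β' * ((n : ℝ) - m) := by
    have := running_of_betaLower F K hrg hlb hmn hnK; linarith
  have hm2 : 0 < (F.g m) ^ 2 := by positivity
  have h2 : ((F.g n) ^ 2)⁻¹ ≤ ((F.g m) ^ 2)⁻¹ * (1 + (F.g m) ^ 2 * β' * ((n : ℝ) - m)) := by
    have e : ((F.g m) ^ 2)⁻¹ * (1 + (F.g m) ^ 2 * β' * ((n : ℝ) - m)) = 1 / (F.g m) ^ 2 + β' * ((n : ℝ) - m) := by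
      field_simp
    rw [e, ← one_div]; exact h1
  have h3 := Real.log_le_log (by positivity) h2
  rw [Real.log_mul (ne_of_gt (by positivity)) (ne_of_gt (by linarith))] at h3
  exact h3

/-- **(2.7), first member, with LOGARITHMIC room**: if `0 ≤ log g_n⁻² ≤ log g_m⁻² + y` with `y ≥ 0`, `log g_m⁻² > 0`,
`0 ≤ β₀ ≤ 1` and `p y ≤ (β₀/2) log g_m⁻²`, then `(log g_n⁻²)^p ≤ (1+β₀)(log g_m⁻²)^p`.  With
`y = log(1 + g_m²β′(n−m))` (`log_inv_sq_le_of_betaLower`) this allows lags `n − m` up to an inverse POWER of `g_m`,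
far beyond `β₀(2+β₀)/(g_m²β′)`. [folklore] -/
theorem ineq27a_logroom {gm gn y β₀ : ℝ} {p : ℕ} (hA : 0 < Real.log (gm ^ 2)⁻¹)
    (hAn : 0 ≤ Real.log (gn ^ 2)⁻¹) (hy : 0 ≤ y) (hle : Real.log (gn ^ 2)⁻¹ ≤ Real.log (gm ^ 2)⁻¹ + y)
    (hβ₀ : 0 ≤ β₀) (hβ₁ : β₀ ≤ 1) (hroom : (p : ℝ) * y ≤ β₀ / 2 * Real.log (gm ^ 2)⁻¹) :
    (Real.log (gn ^ 2)⁻¹) ^ p ≤ (1 + β₀) * (Real.log (gm ^ 2)⁻¹) ^ p := by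
  set A := Real.log (gm ^ 2)⁻¹ with hAdef
  have hpA : (p : ℝ) / A * A = p := by field_simp
  have key := logpow_27b (A := A) (Am := Real.log (gn ^ 2)⁻¹) (y := y) (β₀ := p / A) hA hAn hle hy
    (ge_of_eq hpA)
  have ht : (p : ℝ) / A * y ≤ β₀ / 2 := by
    rw [div_mul_eq_mul_div, div_le_iff₀ hA]; linarith
  have hexp : Real.exp ((p : ℝ) / A * y) ≤ 1 + β₀ := by
    calc Real.exp ((p : ℝ) / A * y) ≤ Real.exp (β₀ / 2) := Real.exp_le_exp.mpr ht
      _ ≤ 1 + 2 * (β₀ / 2) := exp_le_one_add_two_mul (by linarith) (by linarith)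
      _ = 1 + β₀ := by ring
  calc (Real.log (gn ^ 2)⁻¹) ^ p ≤ Real.exp ((p : ℝ) / A * y) * A ^ p := key
    _ ≤ (1 + β₀) * A ^ p := mul_le_mul_of_nonneg_right hexp (pow_nonneg hA.le p)

/-- **(2.7), first member, along the flow with logarithmic room**, from (0.20), `0 < g_k ≤ γ < 1`, the printed LOWER
bound `−β′ ≤ β`, `0 ≤ β₀ ≤ 1`, for every pair `m ≤ n ≤ K` with `p · log(1 + g_m²β′(n−m)) ≤ (β₀/2) · log g_m⁻²`.
Hence (by `ineq29a_pair`) also `R_n ≤ L R_m` for such pairs.  No sign of β is used. [cite: Balaban1988Convergent, (2.7) p.255] -/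
theorem flow27a_of_betaLower_logroom (hβ' : 0 ≤ β') (hβ₀ : 0 ≤ β₀) (hβ₁ : β₀ ≤ 1) (hγ1 : γ < 1)
    (hrg : F.SatisfiesRG K) (hI : F.InInterval γ K) (hlb : ∀ j, j < K → -β' ≤ F.β (j + 1) (F.g j))
    {m n : ℕ} (hmn : m ≤ n) (hnK : n ≤ K)
    (hroom : (p : ℝ) * Real.log (1 + (F.g m) ^ 2 * β' * ((n : ℝ) - m)) ≤ β₀ / 2 * Real.log ((F.g m) ^ 2)⁻¹) :
    (Real.log ((F.g n) ^ 2)⁻¹) ^ p ≤ (1 + β₀) * (Real.log ((F.g m) ^ 2)⁻¹) ^ p := by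
  have hpos : ∀ j, j ≤ K → 0 < F.g j := fun j hj => (hI j hj).1
  have hm : 0 < F.g m := hpos m (le_trans hmn hnK)
  have hn : 0 < F.g n := hpos n hnK
  have hmγ : F.g m ≤ γ := (hI m (le_trans hmn hnK)).2
  have hnγ : F.g n ≤ γ := (hI n hnK).2
  have hd : (0 : ℝ) ≤ (n : ℝ) - m := by
    have : (m : ℝ) ≤ n := by exact_mod_cast hmn
    linarith
  have hA : 0 < Real.log ((F.g m) ^ 2)⁻¹ := by
    apply Real.log_pos
    rw [one_lt_inv₀ (by positivity)]
    exact pow_lt_one₀ hm.le (lt_of_le_of_lt hmγ hγ1) two_ne_zero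
  have hAn : 0 ≤ Real.log ((F.g n) ^ 2)⁻¹ := log_inv_sq_nonneg hn (le_trans hnγ hγ1.le)
  have hy : 0 ≤ Real.log (1 + (F.g m) ^ 2 * β' * ((n : ℝ) - m)) := by
    apply Real.log_nonneg
    have : 0 ≤ (F.g m) ^ 2 * β' * ((n : ℝ) - m) := by positivity
    linarith
  exact ineq27a_logroom hA hAn hy (log_inv_sq_le_of_betaLower F K hβ' hpos hrg hlb hmn hnK) hβ₀ hβ₁ hroom

/-- **Lag-bounded flow control from PRINTED hypotheses, core form** (lag condition at the pair's own coupling: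
`(n − m) g_m² β′ ≤ β₀(2+β₀)`): (0.20), `0 < g_k ≤ γ`, the printed two-sided bound `−β′ ≤ β_{j+1}(g_j) ≤ β′` and
`SmallnessFor γ β′ β₀ L p` give ALL members of (2.6)–(2.9) for the pair (m,n) with the printed constants.  The
γ-form is `pairFlow_of_betaAbs_lag`; the form for lags `≤ R_n` is `pairFlow_of_betaAbs_le_Rn`. [cite: Balaban1988Convergent, (2.6)–(2.9) pp.255–256] -/
theorem pairFlow_of_betaAbs_lagm (S : SmallnessFor γ β' β₀ L p) {A₀ : ℝ} (hA₀ : 0 ≤ A₀)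
    (R : ℕ → ℕ) (hR : ∀ j, j ≤ K → B14.IsRj L p (F.g j) (R j))
    (hrg : F.SatisfiesRG K) (hI : F.InInterval γ K)
    (hub : ∀ j, j < K → F.β (j + 1) (F.g j) ≤ β') (hlb : ∀ j, j < K → -β' ≤ F.β (j + 1) (F.g j))
    {m n : ℕ} (hmn : m < n) (hnK : n ≤ K) (hlag : ((n : ℝ) - m) * (F.g m) ^ 2 * β' ≤ β₀ * (2 + β₀)) :
    (F.g n ≤ Real.sqrt (1 + (F.g n) ^ 2 * β' * ((n : ℝ) - m)) * F.g m ∧ F.g m ≤ (1 + β₀) * F.g n) ∧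
    ((Real.log ((F.g n) ^ 2)⁻¹) ^ p ≤ (1 + β₀) * (Real.log ((F.g m) ^ 2)⁻¹) ^ p ∧
      (Real.log ((F.g m) ^ 2)⁻¹) ^ p ≤
        (1 + (F.g n) ^ 2 * β' * ((n : ℝ) - m)) ^ β₀ * (Real.log ((F.g n) ^ 2)⁻¹) ^ p) ∧
    (epsK A₀ p F n ≤ (1 + β₀) * Real.sqrt ((n : ℝ) - m) * epsK A₀ p F m ∧
      epsK A₀ p F m ≤ (1 + β₀) * (1 + (F.g n) ^ 2 * β' * ((n : ℝ) - m)) ^ β₀ * epsK A₀ p F n) ∧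
    ((R n : ℝ) ≤ L * R m ∧ (R m : ℝ) ≤ L * (1 + (F.g n) ^ 2 * β' * ((n : ℝ) - m)) ^ β₀ * R n) := by
  have hpos : ∀ j, j ≤ K → 0 < F.g j := fun j hj => (hI j hj).1
  have hm : 0 < F.g m := hpos m (le_trans hmn.le hnK)
  have hn : 0 < F.g n := hpos n hnK
  have hmγ : F.g m ≤ γ := (hI m (le_trans hmn.le hnK)).2
  have hnγ : F.g n ≤ γ := (hI n hnK).2
  -- (2.6)
  have h26a := B14.flow26_upper_of_rg F K β' S.β'_nonneg hpos hrg hub m n hmn hnK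
  have h26d := flow26d_of_betaLower_lag F K S.β₀_pos.le hpos hrg hlb hmn.le hnK hlag
  -- (2.7)
  have h27a := ineq27a hm hn S.β₀_pos.le S.β₀_le_one h26d (le_trans S.h27a (log_inv_sq_mono hn hnγ))
  have h27b := flowIneq27b_signfree F K S hrg hI hub hmn hnK
  -- (2.8)
  have h28a := flowIneq28a_signfree F K S hA₀ hrg hI hub hmn hnK
  have hPm0 : 0 ≤ Real.log ((F.g m) ^ 2)⁻¹ := log_inv_sq_nonneg hm (le_trans hmγ S.γ_lt_one.le)
  have hPn0 : 0 ≤ Real.log ((F.g n) ^ 2)⁻¹ := log_inv_sq_nonneg hn (le_trans hnγ S.γ_lt_one.le)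
  have h28b : epsK A₀ p F m ≤
      (1 + β₀) * (1 + (F.g n) ^ 2 * β' * ((n : ℝ) - m)) ^ β₀ * epsK A₀ p F n := by
    have hfac : 0 ≤ (1 + β₀) * F.g n := by have := S.β₀_pos; positivity
    unfold epsK p0Profile
    calc F.g m * (A₀ * Real.log (F.g m ^ 2)⁻¹ ^ p)
        ≤ ((1 + β₀) * F.g n) *
            (A₀ * ((1 + F.g n ^ 2 * β' * ((n : ℝ) - m)) ^ β₀ * Real.log (F.g n ^ 2)⁻¹ ^ p)) :=
          mul_le_mul h26d (mul_le_mul_of_nonneg_left h27b hA₀)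
            (mul_nonneg hA₀ (pow_nonneg hPm0 p)) hfac
      _ = (1 + β₀) * (1 + F.g n ^ 2 * β' * ((n : ℝ) - m)) ^ β₀ *
            (F.g n * (A₀ * Real.log (F.g n ^ 2)⁻¹ ^ p)) := by ring
  -- (2.9)
  have hL1 : 1 ≤ L := le_trans (by norm_num) S.hL
  have hC : 1 + β₀ ≤ (L : ℝ) := by
    have := S.β₀_le_one; have : (2 : ℝ) ≤ L := by exact_mod_cast S.hL
    linarith
  have h29a := ineq29a_pair hL1 hC (pow_nonneg hPm0 p) (hR m (le_trans hmn.le hnK)) (hR n hnK) h27a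
  have hX := X_nonneg S.β'_nonneg (F.g n) hmn.le
  have hΘ : 1 ≤ (1 + (F.g n) ^ 2 * β' * ((n : ℝ) - m)) ^ β₀ := Real.one_le_rpow (by linarith) S.β₀_pos.le
  have h29b := ineq29b_pair hL1 hΘ (hR m (le_trans hmn.le hnK)) (hR n hnK) h27b
  exact ⟨⟨h26a, h26d⟩, ⟨h27a, h27b⟩, ⟨h28a, h28b⟩, ⟨h29a, h29b⟩⟩

/-- **WHICH MEMBERS NEED THE SIGN — the lag-bounded flow control from PRINTED hypotheses only.**  For a flow
satisfying (0.20) up to `K`, with `0 < g_k ≤ γ`, the PRINTED TWO-SIDED bound `−β′ ≤ β_{j+1}(g_j) ≤ β′` ([I] p. 264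
"uniformly bounded") and `SmallnessFor γ β′ β₀ L p`: for EVERY pair `m < n ≤ K` whose lag obeys
`(n − m) γ² β′ ≤ β₀(2+β₀)`, ALL members of (2.6), (2.7), (2.8) (`ε = Setup.epsK A₀ p`, `A₀ ≥ 0`) and (2.9) (sizes `R`
obeying (2.5) with `r = p`) hold with the PRINTED constants — no sign of β.  (The third members are `third_members`,
unconditionally.)  The sign is therefore needed only for pairs with `(n − m) g_m² β′ > β₀(2+β₀)`. [cite: Balaban1988Convergent, (2.6)–(2.9) pp.255–256] -/
theorem pairFlow_of_betaAbs_lag (S : SmallnessFor γ β' β₀ L p) {A₀ : ℝ} (hA₀ : 0 ≤ A₀)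
    (R : ℕ → ℕ) (hR : ∀ j, j ≤ K → B14.IsRj L p (F.g j) (R j))
    (hrg : F.SatisfiesRG K) (hI : F.InInterval γ K)
    (hub : ∀ j, j < K → F.β (j + 1) (F.g j) ≤ β') (hlb : ∀ j, j < K → -β' ≤ F.β (j + 1) (F.g j))
    {m n : ℕ} (hmn : m < n) (hnK : n ≤ K) (hlag : ((n : ℝ) - m) * γ ^ 2 * β' ≤ β₀ * (2 + β₀)) :
    (F.g n ≤ Real.sqrt (1 + (F.g n) ^ 2 * β' * ((n : ℝ) - m)) * F.g m ∧ F.g m ≤ (1 + β₀) * F.g n) ∧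
    ((Real.log ((F.g n) ^ 2)⁻¹) ^ p ≤ (1 + β₀) * (Real.log ((F.g m) ^ 2)⁻¹) ^ p ∧
      (Real.log ((F.g m) ^ 2)⁻¹) ^ p ≤
        (1 + (F.g n) ^ 2 * β' * ((n : ℝ) - m)) ^ β₀ * (Real.log ((F.g n) ^ 2)⁻¹) ^ p) ∧
    (epsK A₀ p F n ≤ (1 + β₀) * Real.sqrt ((n : ℝ) - m) * epsK A₀ p F m ∧
      epsK A₀ p F m ≤ (1 + β₀) * (1 + (F.g n) ^ 2 * β' * ((n : ℝ) - m)) ^ β₀ * epsK A₀ p F n) ∧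
    ((R n : ℝ) ≤ L * R m ∧ (R m : ℝ) ≤ L * (1 + (F.g n) ^ 2 * β' * ((n : ℝ) - m)) ^ β₀ * R n) := by
  have hm : 0 < F.g m := (hI m (le_trans hmn.le hnK)).1
  have hmγ : F.g m ≤ γ := (hI m (le_trans hmn.le hnK)).2
  have hd : (0 : ℝ) ≤ (n : ℝ) - m := by linarith [one_le_sub_of_lt hmn]
  have hlag' : ((n : ℝ) - m) * (F.g m) ^ 2 * β' ≤ β₀ * (2 + β₀) := by
    have h1 : (F.g m) ^ 2 ≤ γ ^ 2 := pow_le_pow_left₀ hm.le hmγ 2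
    have h2 : ((n : ℝ) - m) * (F.g m) ^ 2 * β' ≤ ((n : ℝ) - m) * γ ^ 2 * β' := by
      have := mul_le_mul_of_nonneg_left h1 hd
      exact mul_le_mul_of_nonneg_right this S.β'_nonneg
    linarith
  exact pairFlow_of_betaAbs_lagm F K S hA₀ R hR hrg hI hub hlb hmn hnK hlag'

/-- **ADJACENT SCALES (lag 1) — the forms actually consumed by [Balaban1988Convergent] §3 and
[Balaban1989LargeFieldII] §1 at neighbouring scales**, from PRINTED hypotheses only ((0.20), `0 < g_k ≤ γ`,
`|β_{k+1}(g_k)| ≤ β′`, `SmallnessFor γ β′ β₀ L p`; the lag condition is `SmallnessFor.h26c`): for `k + 1 ≤ K`,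
`g_{k+1} ≤ (1+β₀) g_k`, `g_k ≤ (1+β₀) g_{k+1}`, `ε_{k+1} ≤ (1+β₀) ε_k` (the `hflow` of `B14Sect3.ineq38_scalar`),
`ε_k ≤ (1+β₀)² ε_{k+1}`, `R_{k+1} ≤ L R_k`, `R_k ≤ (L+1) R_{k+1}`. [cite: Balaban1988Convergent, (3.8) p.266] -/
theorem adjacentFlow_of_betaAbs (S : SmallnessFor γ β' β₀ L p) {A₀ : ℝ} (hA₀ : 0 ≤ A₀)
    (R : ℕ → ℕ) (hR : ∀ j, j ≤ K → B14.IsRj L p (F.g j) (R j))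
    (hrg : F.SatisfiesRG K) (hI : F.InInterval γ K)
    (hub : ∀ j, j < K → F.β (j + 1) (F.g j) ≤ β') (hlb : ∀ j, j < K → -β' ≤ F.β (j + 1) (F.g j))
    {k : ℕ} (hk : k + 1 ≤ K) :
    F.g (k + 1) ≤ (1 + β₀) * F.g k ∧ F.g k ≤ (1 + β₀) * F.g (k + 1) ∧
    epsK A₀ p F (k + 1) ≤ (1 + β₀) * epsK A₀ p F k ∧ epsK A₀ p F k ≤ (1 + β₀) ^ 2 * epsK A₀ p F (k + 1) ∧
    (R (k + 1) : ℝ) ≤ L * R k ∧ (R k : ℝ) ≤ ((L : ℝ) + 1) * R (k + 1) := by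
  have hkk : k < k + 1 := Nat.lt_succ_self k
  have hone : ((k + 1 : ℕ) : ℝ) - k = 1 := by push_cast; ring
  have hlag : (((k + 1 : ℕ) : ℝ) - k) * γ ^ 2 * β' ≤ β₀ * (2 + β₀) := by
    rw [hone, one_mul]; exact S.h26c
  obtain ⟨⟨h26a, h26d⟩, ⟨_, _⟩, ⟨h28a, h28b⟩, ⟨h29a, h29b⟩⟩ :=
    pairFlow_of_betaAbs_lag F K S hA₀ R hR hrg hI hub hlb hkk hk hlag
  obtain ⟨h3a, _, h3c⟩ := third_members (g := F.g) S ((Step.inInterval_iff F γ K).mp hI) hkk hk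
  rw [hone] at h26a h28a h28b h29b h3a h3c
  simp only [mul_one, Real.one_rpow, Real.sqrt_one] at h26a h28a h28b h29b h3a h3c
  have hpos : ∀ j, j ≤ K → 0 < F.g j := fun j hj => (hI j hj).1
  have hk0 : 0 < F.g k := hpos k (le_trans hkk.le hk)
  have hk1 : 0 < F.g (k + 1) := hpos (k + 1) hk
  have hk1γ : F.g (k + 1) ≤ γ := (hI (k + 1) hk).2
  have hsmall : (F.g (k + 1)) ^ 2 * β' ≤ β₀ * (2 + β₀) := by
    have : (F.g (k + 1)) ^ 2 ≤ γ ^ 2 := pow_le_pow_left₀ hk1.le hk1γ 2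
    have := mul_le_mul_of_nonneg_right this S.β'_nonneg
    linarith [S.h26c]
  have h3 := Step.B14_2_6c (c := (F.g (k + 1)) ^ 2) S.β₀_pos.le hsmall
  have hεk1 : 0 ≤ epsK A₀ p F (k + 1) := by
    unfold epsK p0Profile
    exact mul_nonneg hk1.le (mul_nonneg hA₀ (pow_nonneg (log_inv_sq_nonneg hk1 (le_trans hk1γ S.γ_lt_one.le)) p))
  have hRk1 : (0 : ℝ) ≤ R (k + 1) := by positivity
  have hb0 : 0 ≤ 1 + β₀ := by have := S.β₀_pos; linarith
  refine ⟨?_, h26d, h28a, ?_, h29a, ?_⟩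
  · calc F.g (k + 1) ≤ Real.sqrt (1 + F.g (k + 1) ^ 2 * β') * F.g k := h26a
      _ ≤ (1 + β₀) * F.g k := mul_le_mul_of_nonneg_right h3 hk0.le
  · calc epsK A₀ p F k ≤ (1 + β₀) * (1 + F.g (k + 1) ^ 2 * β') ^ β₀ * epsK A₀ p F (k + 1) := h28b
      _ ≤ (1 + β₀) * (1 + β₀) * epsK A₀ p F (k + 1) := by
          apply mul_le_mul_of_nonneg_right _ hεk1
          exact mul_le_mul_of_nonneg_left h3a hb0
      _ = (1 + β₀) ^ 2 * epsK A₀ p F (k + 1) := by ring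
  · calc (R k : ℝ) ≤ (L : ℝ) * (1 + F.g (k + 1) ^ 2 * β') ^ β₀ * R (k + 1) := h29b
      _ ≤ ((L : ℝ) + 1) * R (k + 1) := mul_le_mul_of_nonneg_right h3c hRk1

/-- **FULL flow control from a PARTIAL-SUM lower bound** (repair-census variant V4, now with the PRINTED constant in
(2.8) thanks to `flowIneq28a_signfree`): (0.20), `0 < g_k ≤ γ`, `β ≤ β′`, a bound `Σ_{j∈[m,n)} β_{j+1}(g_j) ≥ −B` for
ALL `m ≤ n ≤ K` with `B γ² ≤ β₀(2+β₀)`, and `SmallnessFor γ β′ β₀ L p` give (2.6) ∧ (2.7) ∧ (2.8) ∧ (2.9) for all pairs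
with the printed constants.  `B = 0` is the sign hypothesis of `flowControl_of_betaSign`; `B = β′N₀` is "at most N₀
negative β-terms in any window" (`partialSum_ge_of_card_neg_le`). [cite: Balaban1988Convergent, (2.6)–(2.9) pp.255–256] -/
theorem flowControl_of_partialSum (S : SmallnessFor γ β' β₀ L p) {A₀ B : ℝ} (hA₀ : 0 ≤ A₀)
    (R : ℕ → ℕ) (hR : ∀ j, j ≤ K → B14.IsRj L p (F.g j) (R j))
    (hrg : F.SatisfiesRG K) (hI : F.InInterval γ K)
    (hub : ∀ j, j < K → F.β (j + 1) (F.g j) ≤ β')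
    (hps : ∀ m n, m ≤ n → n ≤ K → -B ≤ ∑ j ∈ Finset.Ico m n, F.β (j + 1) (F.g j))
    (hB : B * γ ^ 2 ≤ β₀ * (2 + β₀)) :
    B14.FlowIneq26 F.g β' β₀ K ∧ B14.FlowIneq27 F.g β' β₀ p K ∧
      B14.FlowIneq28 (epsK A₀ p F) F.g β' β₀ K ∧ FlowIneq29 R F.g L β' β₀ K := by
  have hpos : ∀ j, j ≤ K → 0 < F.g j := fun j hj => (hI j hj).1
  have hI' : Step.InInterval γ K F.g := (Step.inInterval_iff F γ K).mp hI
  have hB0 : 0 ≤ B := by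
    have := hps 0 0 le_rfl (Nat.zero_le K)
    simp at this
    linarith
  have h26 : B14.FlowIneq26 F.g β' β₀ K := by
    intro m n hmn hnK
    have hm : 0 < F.g m := hpos m (le_trans hmn.le hnK)
    have hmγ : F.g m ≤ γ := (hI m (le_trans hmn.le hnK)).2
    refine ⟨B14.flow26_upper_of_rg F K β' S.β'_nonneg hpos hrg hub m n hmn hnK, ?_⟩
    apply flow26d_of_partialSum_ge F K S.β₀_pos.le hpos hrg hmn.le hnK (hps m n hmn.le hnK)
    have h1 : (F.g m) ^ 2 ≤ γ ^ 2 := pow_le_pow_left₀ hm.le hmγ 2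
    have := mul_le_mul_of_nonneg_left h1 hB0
    linarith
  have h27 := flowIneq27_of_26 S hI' h26
  have hβL : 1 + β₀ ≤ (L : ℝ) := by
    have := S.β₀_le_one; have : (2 : ℝ) ≤ L := by exact_mod_cast S.hL
    linarith
  refine ⟨h26, h27, ?_, flowIneq29_of_27 S.hL S.β₀_pos.le hβL S.β'_nonneg hI' S.γ_lt_one.le R hR h27⟩
  intro m n hmn hnK
  have hm : 0 < F.g m := hpos m (le_trans hmn.le hnK)
  have hn : 0 < F.g n := hpos n hnK
  have hmγ : F.g m ≤ γ := (hI m (le_trans hmn.le hnK)).2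
  have hPm0 : 0 ≤ Real.log ((F.g m) ^ 2)⁻¹ := log_inv_sq_nonneg hm (le_trans hmγ S.γ_lt_one.le)
  refine ⟨flowIneq28a_signfree F K S hA₀ hrg hI hub hmn hnK, ?_⟩
  obtain ⟨_, h27b⟩ := h27 m n hmn hnK
  have h26d : F.g m ≤ (1 + β₀) * F.g n := (h26 m n hmn hnK).2
  have hfac : 0 ≤ (1 + β₀) * F.g n := by have := S.β₀_pos; positivity
  unfold epsK p0Profile
  calc F.g m * (A₀ * Real.log (F.g m ^ 2)⁻¹ ^ p)
      ≤ ((1 + β₀) * F.g n) *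
          (A₀ * ((1 + F.g n ^ 2 * β' * ((n : ℝ) - m)) ^ β₀ * Real.log (F.g n ^ 2)⁻¹ ^ p)) :=
        mul_le_mul h26d (mul_le_mul_of_nonneg_left h27b hA₀)
          (mul_nonneg hA₀ (pow_nonneg hPm0 p)) hfac
    _ = (1 + β₀) * (1 + F.g n ^ 2 * β' * ((n : ℝ) - m)) ^ β₀ *
          (F.g n * (A₀ * Real.log (F.g n ^ 2)⁻¹ ^ p)) := by ring

/-- **(2.46) with the sharp power** (the room in B14's `g_n^{κ₀−6}`): under the hypotheses of `sum246_of_betaPos`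
(without `g_n⁴ ≤ b`, `g_n ≤ 1/2`), `Σ_{j=1}^{n} g_j^{κ₀} ≤ (g_n⁴/(2b) + g_n⁶) g_n^{κ₀−6}` for `κ₀ ≥ 6` — i.e. a loss of
TWO powers of `g_n` relative to one term, as in Bauerschmidt–Brydges–Slade (2015) Lemma 2.1(ii) / Dimock–Yuan (2024)
Remark after Lemma `english`; B14 spends six. [cite: Balaban1988Convergent, (2.46) p.263] -/
theorem sum246_sharp {b : ℝ} (hb : 0 < b)
    (hpos : ∀ j, j ≤ K → 0 < F.g j) (hrg : F.SatisfiesRG K)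
    (hlb : ∀ j, j < K → b ≤ F.β (j + 1) (F.g j))
    {n : ℕ} (hnK : n ≤ K) {κ₀ : ℕ} (hκ : 6 ≤ κ₀) :
    ∑ j ∈ Finset.Icc 1 n, (F.g j) ^ κ₀ ≤ ((F.g n) ^ 4 / (2 * b) + (F.g n) ^ 6) * (F.g n) ^ (κ₀ - 6) := by
  have hn : 0 < F.g n := hpos n hnK
  have hlb0 : ∀ j, j < K → 0 ≤ F.β (j + 1) (F.g j) := fun j hj => le_trans hb.le (hlb j hj)
  have hterm : ∀ j ∈ Finset.Icc 1 n, (F.g j) ^ κ₀ ≤ (F.g j) ^ 6 * (F.g n) ^ (κ₀ - 6) := by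
    intro j hj
    have hjn : j ≤ n := (Finset.mem_Icc.mp hj).2
    have hj0 : 0 < F.g j := hpos j (le_trans hjn hnK)
    have hle : F.g j ≤ F.g n := g_mono_of_betaNonneg F K hpos hrg hlb0 hjn hnK
    have e : (F.g j) ^ κ₀ = (F.g j) ^ 6 * (F.g j) ^ (κ₀ - 6) := by
      rw [← pow_add]; congr 1; omega
    rw [e]
    exact mul_le_mul_of_nonneg_left (pow_le_pow_left₀ hj0.le hle _) (by positivity)
  have h1 : ∑ j ∈ Finset.Icc 1 n, (F.g j) ^ κ₀ ≤
      (∑ j ∈ Finset.Icc 1 n, (F.g j) ^ 6) * (F.g n) ^ (κ₀ - 6) := by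
    rw [Finset.sum_mul]; exact Finset.sum_le_sum hterm
  have h2 : ∑ j ∈ Finset.Icc 1 n, (F.g j) ^ 6 ≤ ∑ j ∈ Finset.range (n + 1), (F.g j) ^ 6 := by
    apply Finset.sum_le_sum_of_subset_of_nonneg
    · intro j hj
      rw [Finset.mem_range]; exact Nat.lt_succ_of_le (Finset.mem_Icc.mp hj).2
    · intro j _ _; positivity
  have h3 : ∑ j ∈ Finset.range n, (F.g j) ^ 6 ≤ 1 / (2 * b * (1 / (F.g n) ^ 2) ^ 2) := by
    apply Step.sum_sixth_powers_le (by positivity) hb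
    · intro j hj; exact hpos j (le_trans hj.le hnK)
    · intro j hj; exact running_of_betaLower F K hrg hlb hj.le hnK
  have h3' : 1 / (2 * b * (1 / (F.g n) ^ 2) ^ 2) = (F.g n) ^ 4 / (2 * b) := by
    field_simp
  have h4 : ∑ j ∈ Finset.range (n + 1), (F.g j) ^ 6 ≤ (F.g n) ^ 4 / (2 * b) + (F.g n) ^ 6 := by
    rw [Finset.sum_range_succ, ← h3']; linarith
  have hpow : 0 ≤ (F.g n) ^ (κ₀ - 6) := by positivity
  calc ∑ j ∈ Finset.Icc 1 n, (F.g j) ^ κ₀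
      ≤ (∑ j ∈ Finset.Icc 1 n, (F.g j) ^ 6) * (F.g n) ^ (κ₀ - 6) := h1
    _ ≤ ((F.g n) ^ 4 / (2 * b) + (F.g n) ^ 6) * (F.g n) ^ (κ₀ - 6) :=
        mul_le_mul_of_nonneg_right (le_trans h2 h4) hpow

/-- `x ↦ x² (log x⁻²)^r` is NONDECREASING on `]0, y]` as soon as `log y⁻² ≥ r` (so on `]0, γ]` when `log γ⁻² ≥ r`):
the profile bounding `g_n² R_n`-type products.  Same mechanism as `eps_profile_mono` (exponent 1 instead of ½). [folklore] -/
theorem sq_logpow_mono {x y : ℝ} {r : ℕ} (hx : 0 < x) (hxy : x ≤ y) (hy1 : y < 1)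
    (hr : (r : ℝ) ≤ Real.log (y ^ 2)⁻¹) :
    x ^ 2 * (Real.log (x ^ 2)⁻¹) ^ r ≤ y ^ 2 * (Real.log (y ^ 2)⁻¹) ^ r := by
  have hy : 0 < y := lt_of_lt_of_le hx hxy
  set a := Real.log (x ^ 2)⁻¹ with ha
  set b := Real.log (y ^ 2)⁻¹ with hb
  have hbpos : 0 < b := by
    rw [hb]; apply Real.log_pos
    rw [one_lt_inv₀ (by positivity)]
    exact pow_lt_one₀ hy.le hy1 two_ne_zero
  have hba : b ≤ a := log_inv_sq_mono hx hxy
  have hab : a - b = 2 * Real.log (y / x) := by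
    rw [ha, hb, log_inv_sq, log_inv_sq, Real.log_div hy.ne' hx.ne']; ring
  have key : a ^ r ≤ Real.exp (1 * (a - b)) * b ^ r :=
    logpow_27b hbpos (by linarith) (by linarith) (by linarith) (by linarith)
  have hexp : Real.exp (1 * (a - b)) = (y / x) ^ 2 := by
    rw [one_mul, hab, show (2 : ℝ) * Real.log (y / x) = ((2 : ℕ) : ℝ) * Real.log (y / x) by norm_num,
      Real.exp_nat_mul, Real.exp_log (by positivity)]
  rw [hexp] at key
  have hx2 : 0 < x ^ 2 := by positivity
  calc x ^ 2 * a ^ r ≤ x ^ 2 * ((y / x) ^ 2 * b ^ r) := mul_le_mul_of_nonneg_left key hx2.le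
    _ = y ^ 2 * b ^ r := by field_simp

/-- From (2.5): `R_n ≤ L (log g_n⁻²)^r` as soon as `(log g_n⁻²)^r ≥ 1` and `L ≥ 1` (minimality of the power `L^s`). [cite: Balaban1988Convergent, (2.5) p.255] -/
theorem isRj_le_mul_logpow {L r : ℕ} (hL : 1 ≤ L) {gn : ℝ} {Rn : ℕ} (hRn : B14.IsRj L r gn Rn)
    (hP1 : 1 ≤ (Real.log (gn ^ 2)⁻¹) ^ r) :
    (Rn : ℝ) ≤ L * (Real.log (gn ^ 2)⁻¹) ^ r := by
  obtain ⟨s, hR, _, hmin⟩ := hRn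
  have hL0 : (0 : ℝ) ≤ L := by positivity
  have hL1 : (1 : ℝ) ≤ L := by exact_mod_cast hL
  rcases Nat.eq_zero_or_pos s with hs | hs
  · rw [hR, hs]
    simp only [pow_zero, Nat.cast_one]
    calc (1 : ℝ) = 1 * 1 := by ring
      _ ≤ (L : ℝ) * (Real.log (gn ^ 2)⁻¹) ^ r := mul_le_mul hL1 hP1 zero_le_one hL0
  · have hnot : ¬ (s ≤ s - 1) := by omega
    have hgt : ((L ^ (s - 1) : ℕ) : ℝ) < (Real.log (gn ^ 2)⁻¹) ^ r :=
      not_le.mp (fun h => hnot (hmin (s - 1) h))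
    have e : (Rn : ℝ) = (L : ℝ) * ((L ^ (s - 1) : ℕ) : ℝ) := by
      rw [hR]; push_cast
      rw [← pow_succ']; congr 1; omega
    rw [e]
    exact mul_le_mul_of_nonneg_left hgt.le hL0

/-- **The lag condition for lags `≤ R_n` IS a γ-smallness** (MISSING-B14.md v2 §8, consumer C4 = [Balaban1989LargeFieldII]
(1.23): `ε_h ≤ (1+β₀)²N^{β₀}ε_k`, `N = k − h ≤ R_k`).  If `0 < g_m`, `0 < g_n ≤ γ < 1`, `g_m² ≤ (1 + g_m²β′ℓ) g_n²` (the reverse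
ratio bound from `−β′ ≤ β`, `flow26d_rev_of_betaLower`), `0 ≤ ℓ ≤ R_n` with `R_n` as in (2.5) (exponent `r`),
`r ≤ log γ⁻²`, `1 ≤ log γ⁻²`, and the smallness `L β′ γ²(log γ⁻²)^r ≤ β₀/2` (`0 ≤ β₀ ≤ 1`), then
`ℓ g_m² β′ ≤ β₀(2+β₀)`.  Proof: `v := ℓ g_n²β′ ≤ Lβ′ g_n²(log g_n⁻²)^r ≤ Lβ′ γ²(log γ⁻²)^r ≤ β₀/2` (`sq_logpow_mono`),
and `u := ℓ g_m²β′ ≤ (1+u) v` gives `u ≤ 2v ≤ β₀`. [folklore] -/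
theorem lag_condition_of_le_Rn {gm gn γ β' β₀ ℓ : ℝ} {L r Rn : ℕ} (hL : 1 ≤ L) (hβ' : 0 ≤ β')
    (hβ₀ : 0 ≤ β₀) (hβ₁ : β₀ ≤ 1) (hm : 0 < gm) (hn : 0 < gn) (hnγ : gn ≤ γ) (hγ1 : γ < 1)
    (hrev : gm ^ 2 ≤ (1 + gm ^ 2 * β' * ℓ) * gn ^ 2) (hℓ0 : 0 ≤ ℓ) (hℓ : ℓ ≤ (Rn : ℝ))
    (hRn : B14.IsRj L r gn Rn) (hr : (r : ℝ) ≤ Real.log (γ ^ 2)⁻¹) (h1 : 1 ≤ Real.log (γ ^ 2)⁻¹)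
    (hsmall : (L : ℝ) * β' * (γ ^ 2 * (Real.log (γ ^ 2)⁻¹) ^ r) ≤ β₀ / 2) :
    ℓ * gm ^ 2 * β' ≤ β₀ * (2 + β₀) := by
  have hlogn : Real.log (γ ^ 2)⁻¹ ≤ Real.log (gn ^ 2)⁻¹ := log_inv_sq_mono hn hnγ
  have hPn1 : 1 ≤ (Real.log (gn ^ 2)⁻¹) ^ r := one_le_pow₀ (le_trans h1 hlogn)
  have hRle : (Rn : ℝ) ≤ L * (Real.log (gn ^ 2)⁻¹) ^ r := isRj_le_mul_logpow hL hRn hPn1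
  have hφ : gn ^ 2 * (Real.log (gn ^ 2)⁻¹) ^ r ≤ γ ^ 2 * (Real.log (γ ^ 2)⁻¹) ^ r :=
    sq_logpow_mono hn hnγ hγ1 hr
  set v := ℓ * gn ^ 2 * β' with hv
  have hv_le : v ≤ β₀ / 2 := by
    have h1' : v ≤ (L : ℝ) * (Real.log (gn ^ 2)⁻¹) ^ r * gn ^ 2 * β' := by
      rw [hv]
      have : 0 ≤ gn ^ 2 * β' := by positivity
      nlinarith [mul_le_mul_of_nonneg_right (le_trans hℓ hRle) this]
    have h2' : (L : ℝ) * (Real.log (gn ^ 2)⁻¹) ^ r * gn ^ 2 * β'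
        = (L : ℝ) * β' * (gn ^ 2 * (Real.log (gn ^ 2)⁻¹) ^ r) := by ring
    have hL0 : (0 : ℝ) ≤ (L : ℝ) * β' := by positivity
    have h3' := mul_le_mul_of_nonneg_left hφ hL0
    linarith
  have hv0 : 0 ≤ v := by rw [hv]; positivity
  -- u ≤ (1+u) v with u = ℓ gm² β'
  set u := ℓ * gm ^ 2 * β' with hu
  have hu0 : 0 ≤ u := by rw [hu]; positivity
  have huv : u ≤ (1 + u) * v := by
    have := mul_le_mul_of_nonneg_left hrev (mul_nonneg hℓ0 hβ')
    -- this : ℓ*β' * gm^2 ≤ ℓ*β' * ((1 + gm^2 β' ℓ) gn^2)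
    have e1 : ℓ * β' * gm ^ 2 = u := by rw [hu]; ring
    have e2 : ℓ * β' * ((1 + gm ^ 2 * β' * ℓ) * gn ^ 2) = (1 + u) * v := by rw [hu, hv]; ring
    rw [e1, e2] at this; exact this
  have hv12 : v ≤ 1 / 2 := le_trans hv_le (by linarith)
  -- u (1 - v) ≤ v  ⇒  u ≤ 2 v ≤ β₀ ≤ β₀ (2 + β₀)
  have hu_le : u ≤ 2 * v := by nlinarith
  nlinarith

/-- **Lags `≤ R_n` — the [Balaban1989LargeFieldII] (1.23)-type consumers, closed form.**  Under (0.20), `0 < g_k ≤ γ`,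
the PRINTED two-sided bound `|β_{j+1}(g_j)| ≤ β′`, `SmallnessFor γ β′ β₀ L p`, and ONE additional explicit
smallness `L β′ γ²(log γ⁻²)^p ≤ β₀/2` (the side conditions `p ≤ log γ⁻²`, `1 ≤ log γ⁻²` of
`lag_condition_of_le_Rn` follow from `SmallnessFor.h27a`): for every pair `m < n ≤ K` with `n − m ≤ R_n`
(`R` obeying (2.5) with exponent `p`), ALL members of (2.6)–(2.9) hold with the printed constants — no sign of β. [cite: Balaban1988Convergent, (2.6)–(2.9) pp.255–256] -/
theorem pairFlow_of_betaAbs_le_Rn (S : SmallnessFor γ β' β₀ L p) {A₀ : ℝ} (hA₀ : 0 ≤ A₀)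
    (R : ℕ → ℕ) (hR : ∀ j, j ≤ K → B14.IsRj L p (F.g j) (R j))
    (hrg : F.SatisfiesRG K) (hI : F.InInterval γ K)
    (hub : ∀ j, j < K → F.β (j + 1) (F.g j) ≤ β') (hlb : ∀ j, j < K → -β' ≤ F.β (j + 1) (F.g j))
    (hsmall : (L : ℝ) * β' * (γ ^ 2 * (Real.log (γ ^ 2)⁻¹) ^ p) ≤ β₀ / 2)
    {m n : ℕ} (hmn : m < n) (hnK : n ≤ K) (hlag : n - m ≤ R n) :
    (F.g n ≤ Real.sqrt (1 + (F.g n) ^ 2 * β' * ((n : ℝ) - m)) * F.g m ∧ F.g m ≤ (1 + β₀) * F.g n) ∧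
    ((Real.log ((F.g n) ^ 2)⁻¹) ^ p ≤ (1 + β₀) * (Real.log ((F.g m) ^ 2)⁻¹) ^ p ∧
      (Real.log ((F.g m) ^ 2)⁻¹) ^ p ≤
        (1 + (F.g n) ^ 2 * β' * ((n : ℝ) - m)) ^ β₀ * (Real.log ((F.g n) ^ 2)⁻¹) ^ p) ∧
    (epsK A₀ p F n ≤ (1 + β₀) * Real.sqrt ((n : ℝ) - m) * epsK A₀ p F m ∧
      epsK A₀ p F m ≤ (1 + β₀) * (1 + (F.g n) ^ 2 * β' * ((n : ℝ) - m)) ^ β₀ * epsK A₀ p F n) ∧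
    ((R n : ℝ) ≤ L * R m ∧ (R m : ℝ) ≤ L * (1 + (F.g n) ^ 2 * β' * ((n : ℝ) - m)) ^ β₀ * R n) := by
  have hpos : ∀ j, j ≤ K → 0 < F.g j := fun j hj => (hI j hj).1
  have hm : 0 < F.g m := hpos m (le_trans hmn.le hnK)
  have hn : 0 < F.g n := hpos n hnK
  have hmγ : F.g m ≤ γ := (hI m (le_trans hmn.le hnK)).2
  have hnγ : F.g n ≤ γ := (hI n hnK).2
  have hd : (0 : ℝ) ≤ (n : ℝ) - m := by linarith [one_le_sub_of_lt hmn]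
  have hrev0 := flow26d_rev_of_betaLower F K S.β'_nonneg hpos hrg hlb hmn.le hnK
  have hrev : (F.g m) ^ 2 ≤ (1 + (F.g m) ^ 2 * β' * ((n : ℝ) - m)) * (F.g n) ^ 2 := by
    have h0 : 0 ≤ Real.sqrt (1 + (F.g m) ^ 2 * β' * ((n : ℝ) - m)) * F.g n := by positivity
    have := pow_le_pow_left₀ hm.le hrev0 2
    have hfac : 0 ≤ 1 + (F.g m) ^ 2 * β' * ((n : ℝ) - m) := by
      have : 0 ≤ (F.g m) ^ 2 * β' * ((n : ℝ) - m) := by have := S.β'_nonneg; positivity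
      linarith
    rw [mul_pow, Real.sq_sqrt hfac] at this
    exact this
  have hℓ : ((n : ℝ) - m) ≤ (R n : ℝ) := by
    have : ((n - m : ℕ) : ℝ) ≤ (R n : ℝ) := by exact_mod_cast hlag
    rwa [Nat.cast_sub hmn.le] at this
  have hr : (p : ℝ) ≤ Real.log (γ ^ 2)⁻¹ := by linarith [S.h27a]
  have h1 : 1 ≤ Real.log (γ ^ 2)⁻¹ := by
    have : (0 : ℝ) ≤ p := Nat.cast_nonneg p
    linarith [S.h27a]
  have hL1 : 1 ≤ L := le_trans (by norm_num) S.hL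
  have hlag' := lag_condition_of_le_Rn hL1 S.β'_nonneg S.β₀_pos.le S.β₀_le_one hm hn hnγ S.γ_lt_one
    hrev hd hℓ (hR n hnK) hr h1 hsmall
  exact pairFlow_of_betaAbs_lagm F K S hA₀ R hR hrg hI hub hlb hmn hnK hlag'

end Consumers

/-! ## G. (v1.3) The PRINTED hypotheses do not give the unbounded-lag members: an explicit admissible counter-flow -/

section CounterFlow

/-- NEGATIVE census fact, kernel form of MISSING-B14.md §5/§6 V2/V11: the flow `g_k = (e^{20} + k)^{−1/2}`, `β ≡ −1`
satisfies EVERYTHING PRINTED that enters (2.6) — the RG equations (0.20) up to `K = 10^{11}`, the interval hypothesis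
`0 < g_k ≤ γ = e^{−10}`, the two-sided bound `|β_{j+1}(g_j)| ≤ β′ = 1` of [I] p. 264 — together with the explicit
smallness `SmallnessFor e^{−10} 1 (1/2) 2 2` (`smallnessFor_example`), and yet VIOLATES the last member of (2.6)
(`g_0 ≤ (1+β₀) g_K`, β₀ = 1/2) and the first member of (2.7) (`(log g_K⁻²)² ≤ (1+β₀)(log g_0⁻²)²`) for the pair
(0, K): the coupling decreases steadily (`1/g_k² = e^{20} + k`), so `g_0/g_K = (1 + 10^{11}e^{−20})^{1/2} > 3/2` and
`log g_K⁻² > 25 > (3/2)^{1/2}·20`.  Hence the p. 255 sentence "follow from (0.20) [I], and from the properties of the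
β-functions" cannot refer to the printed properties alone: a SIGN-type property (T09.F) is used for pairs of large
lag (the lag here, 10^{11}, exceeds β₀(2+β₀)/(γ²β′) = 1.25·e^{20} ≈ 6·10^8, in accordance with
`flow26d_of_betaLower_lag`). [cite: Balaban1988Convergent, (2.6)–(2.7) p.255] -/
theorem printed_hyps_fail_26d_27a :
    ∃ F : Flow, SmallnessFor (Real.exp (-10)) 1 (1 / 2) 2 2 ∧ F.SatisfiesRG (10 ^ 11) ∧
      F.InInterval (Real.exp (-10)) (10 ^ 11) ∧
      (∀ j, j < 10 ^ 11 → |F.β (j + 1) (F.g j)| ≤ 1) ∧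
      ¬ (F.g 0 ≤ (1 + 1 / 2) * F.g (10 ^ 11)) ∧
      ¬ ((Real.log ((F.g (10 ^ 11)) ^ 2)⁻¹) ^ 2 ≤ (1 + 1 / 2) * (Real.log ((F.g 0) ^ 2)⁻¹) ^ 2) := by
  have hE : 0 < Real.exp 20 := Real.exp_pos 20
  have hE1 : Real.exp 1 < 2.7182818286 := Real.exp_one_lt_d9
  have hE0 : 0 < Real.exp 1 := Real.exp_pos 1
  have hexp20 : Real.exp 20 < 5 * 10 ^ 8 := by
    have e : Real.exp 20 = Real.exp 1 ^ 20 := by rw [← Real.exp_nat_mul]; norm_num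
    rw [e]
    calc Real.exp 1 ^ 20 < (2.7182818286 : ℝ) ^ 20 := pow_lt_pow_left₀ hE1 hE0.le (by norm_num)
      _ < 5 * 10 ^ 8 := by norm_num
  have hexp25 : Real.exp 25 < 10 ^ 11 := by
    have e : Real.exp 25 = Real.exp 1 ^ 25 := by rw [← Real.exp_nat_mul]; norm_num
    rw [e]
    calc Real.exp 1 ^ 25 < (2.7182818286 : ℝ) ^ 25 := pow_lt_pow_left₀ hE1 hE0.le (by norm_num)
      _ < 10 ^ 11 := by norm_num
  obtain ⟨g, hgdef⟩ : ∃ g : ℕ → ℝ, ∀ k, g k = 1 / Real.sqrt (Real.exp 20 + k) := ⟨_, fun _ => rfl⟩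
  have hA : ∀ k : ℕ, 0 < Real.exp 20 + k := fun k => by positivity
  have hg2 : ∀ k : ℕ, (g k) ^ 2 = 1 / (Real.exp 20 + k) := fun k => by
    rw [hgdef, div_pow, one_pow, Real.sq_sqrt (hA k).le]
  have hginv : ∀ k : ℕ, 1 / (g k) ^ 2 = Real.exp 20 + k := fun k => by rw [hg2, one_div_one_div]
  have hginv' : ∀ k : ℕ, ((g k) ^ 2)⁻¹ = Real.exp 20 + k := fun k => by rw [← one_div, hginv]
  have hgpos : ∀ k : ℕ, 0 < g k := fun k => by rw [hgdef]; positivity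
  have h20 : Real.exp 20 = Real.exp 10 ^ 2 := by rw [← Real.exp_nat_mul]; norm_num
  have hs : Real.sqrt (Real.exp 20) = Real.exp 10 := by rw [h20, Real.sqrt_sq (Real.exp_pos 10).le]
  refine ⟨⟨g, fun _ _ => -1⟩, smallnessFor_example, ?_, ?_, ?_, ?_, ?_⟩
  · intro k _
    show 1 / (g k) ^ 2 = 1 / (g (k + 1)) ^ 2 + -1
    rw [hginv, hginv]; push_cast; ring
  · intro k _
    show 0 < g k ∧ g k ≤ Real.exp (-10)
    refine ⟨hgpos k, ?_⟩
    have hk0 : (0 : ℝ) ≤ k := Nat.cast_nonneg k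
    calc g k = 1 / Real.sqrt (Real.exp 20 + k) := hgdef k
      _ ≤ 1 / Real.sqrt (Real.exp 20) := by
          apply one_div_le_one_div_of_le (Real.sqrt_pos.mpr hE)
          exact Real.sqrt_le_sqrt (by linarith)
      _ = Real.exp (-10) := by rw [hs, Real.exp_neg, one_div]
  · intro j _
    show |(-1 : ℝ)| ≤ 1
    simp
  · show ¬ (g 0 ≤ (1 + 1 / 2) * g (10 ^ 11))
    intro h
    have hB : (0 : ℝ) < Real.exp 20 + 10 ^ 11 := by positivity
    have hlt : (1 + 1 / 2) * g (10 ^ 11) < g 0 := by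
      apply lt_of_pow_lt_pow_left₀ 2 (hgpos 0).le
      rw [mul_pow, hg2, hg2]
      simp only [Nat.cast_zero, add_zero, Nat.cast_pow, Nat.cast_ofNat]
      have e : ((1 : ℝ) + 1 / 2) ^ 2 * (1 / (Real.exp 20 + 10 ^ 11)) = (9 / 4) / (Real.exp 20 + 10 ^ 11) := by
        ring
      rw [e, div_lt_div_iff₀ hB hE]
      linarith
    exact absurd h (not_le.mpr hlt)
  · show ¬ ((Real.log ((g (10 ^ 11)) ^ 2)⁻¹) ^ 2 ≤ (1 + 1 / 2) * (Real.log ((g 0) ^ 2)⁻¹) ^ 2)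
    intro h
    rw [hginv', hginv'] at h
    simp only [Nat.cast_zero, add_zero, Nat.cast_pow, Nat.cast_ofNat, Real.log_exp] at h
    have hpos : (0 : ℝ) < Real.exp 20 + 10 ^ 11 := by positivity
    have h25 : (25 : ℝ) < Real.log (Real.exp 20 + 10 ^ 11) := by
      rw [Real.lt_log_iff_exp_lt hpos]
      linarith
    have hsq : (25 : ℝ) ^ 2 < (Real.log (Real.exp 20 + 10 ^ 11)) ^ 2 :=
      pow_lt_pow_left₀ h25 (by norm_num) (by norm_num)
    norm_num at hsq h
    linarith

end CounterFlow

/-! ## H. (v1.4) The (0.31)-READING of B14 Thm 1's hypothesis "(I.0.33)" (cell DIVERGENCE D2, `B14.H033LogRunning`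
↔ `Step.Discrete031`, `DagBinding.h033LogRunning_iff_discrete031`): two-sided running FROM THE ENDPOINT,
`1/g_K² + b(K−k) ≤ 1/g_k² ≤ 1/g_K² + β′(K−k)` with `0 < b ≤ β′` — i.e. the CONCLUSION (0.31) of the unproved
[Balaban1987RG1] Thm 2 — and what it gives WITHOUT any pointwise sign of β.

Under this reading the inverse squared coupling can grow between two scales by at most the FIXED factor `β′/b`
(`inv_sq_le_of_discrete031`, cf. `Step.ratio_bound_of_discrete031`), uniformly in the lag; hence (2.7a) and (2.9a)
hold for ALL pairs with the printed constants as soon as `p·log(β′/b) ≤ (β₀/2)·log γ⁻²` (`flow27a_of_discrete031`),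
(2.46) holds for all `n ≤ K` for γ small depending on `κ₀, b, β′` (`sumIneq246_of_discrete031`, via
`Step.sum_sixth_powers_le` with `y = 1/g_K² + b(K−n)`), and (2.6d)/(2.8b) hold with the constant `(1+β₀)` replaced
by `(β′/b)^{1/2}` (`pairFlow_of_discrete031`).  So under the (0.31)-reading the located step T11.F carries NO
residual beyond G1 ((0.31) itself) except this one constant substitution — whose smallness `(β′/b)^{1/2} ≤ 1+β₀`
("β₀ > 0 can be chosen arbitrarily small, if g is sufficiently small") is again a property of the β-functions
(`b, β′ → b₀` as `γ → 0`, one-loop asymptotic freedom), not printed. -/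

section Reading031
variable (F : Flow) (K : ℕ) {γ β' β₀ b gK : ℝ} {L p : ℕ}

/-- Under (0.31) in endpoint form, for `m ≤ n ≤ K`: `1/g_n² ≤ (β′/b)·(1/g_m²)`. [cite: Balaban1987RG1, (0.31) p.259] -/
theorem inv_sq_le_of_discrete031 (hb : 0 < b) (hbβ : b ≤ β') (hgK : 0 < gK)
    (h : Step.Discrete031 b β' K gK F.g) {m n : ℕ} (hmn : m ≤ n) (hnK : n ≤ K) :
    1 / (F.g n) ^ 2 ≤ β' / b * (1 / (F.g m) ^ 2) := by
  have hm := (h m (le_trans hmn hnK)).1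
  have hn := (h n hnK).2
  have hb0 : b ≠ 0 := hb.ne'
  have hKm : (K : ℝ) - n ≤ (K : ℝ) - m := by
    have : (m : ℝ) ≤ n := by exact_mod_cast hmn
    linarith
  have hρ : 1 ≤ β' / b := by rw [le_div_iff₀ hb]; linarith
  have hρ0 : 0 ≤ β' / b := le_trans zero_le_one hρ
  have hgK2 : 0 ≤ 1 / gK ^ 2 := by positivity
  have e : β' / b * (b * ((K : ℝ) - n)) = β' * ((K : ℝ) - n) := by
    field_simp
  calc 1 / (F.g n) ^ 2 ≤ 1 / gK ^ 2 + β' * ((K : ℝ) - n) := hn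
    _ ≤ β' / b * (1 / gK ^ 2 + b * ((K : ℝ) - n)) := by
        rw [mul_add, e]
        have := mul_le_mul_of_nonneg_right hρ hgK2
        linarith
    _ ≤ β' / b * (1 / gK ^ 2 + b * ((K : ℝ) - m)) := by
        apply mul_le_mul_of_nonneg_left _ hρ0
        have := mul_le_mul_of_nonneg_left hKm hb.le
        linarith
    _ ≤ β' / b * (1 / (F.g m) ^ 2) := mul_le_mul_of_nonneg_left hm hρ0

/-- Logarithmic form: under (0.31), `log g_n⁻² ≤ log g_m⁻² + log(β′/b)` for `m ≤ n ≤ K` — a lag-INDEPENDENT additive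
drift. [cite: Balaban1987RG1, (0.31) p.259] -/
theorem log_inv_sq_le_of_discrete031 (hb : 0 < b) (hbβ : b ≤ β') (hgK : 0 < gK)
    (hpos : ∀ j, j ≤ K → 0 < F.g j) (h : Step.Discrete031 b β' K gK F.g) {m n : ℕ} (hmn : m ≤ n)
    (hnK : n ≤ K) :
    Real.log ((F.g n) ^ 2)⁻¹ ≤ Real.log ((F.g m) ^ 2)⁻¹ + Real.log (β' / b) := by
  have h1 := inv_sq_le_of_discrete031 F K hb hbβ hgK h hmn hnK
  have hm : 0 < F.g m := hpos m (le_trans hmn hnK)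
  have hn : 0 < F.g n := hpos n hnK
  rw [one_div, one_div] at h1
  have hρ : 0 < β' / b := div_pos (lt_of_lt_of_le hb hbβ) hb
  have h2 := Real.log_le_log (by positivity) h1
  rw [Real.log_mul hρ.ne' (ne_of_gt (by positivity))] at h2
  linarith

/-- **(2.7), first member, for ALL pairs under the (0.31)-reading** (no sign): with `0 < b ≤ β′`, `0 < g_k ≤ γ < 1`,
`0 ≤ β₀ ≤ 1` and the γ-smallness `p·log(β′/b) ≤ (β₀/2)·log γ⁻²`. [cite: Balaban1988Convergent, (2.7) p.255] -/
theorem flow27a_of_discrete031 (hb : 0 < b) (hbβ : b ≤ β') (hgK : 0 < gK) (hβ₀ : 0 ≤ β₀) (hβ₁ : β₀ ≤ 1)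
    (hγ1 : γ < 1) (hI : F.InInterval γ K) (h : Step.Discrete031 b β' K gK F.g)
    (hroom : (p : ℝ) * Real.log (β' / b) ≤ β₀ / 2 * Real.log (γ ^ 2)⁻¹)
    {m n : ℕ} (hmn : m ≤ n) (hnK : n ≤ K) :
    (Real.log ((F.g n) ^ 2)⁻¹) ^ p ≤ (1 + β₀) * (Real.log ((F.g m) ^ 2)⁻¹) ^ p := by
  have hpos : ∀ j, j ≤ K → 0 < F.g j := fun j hj => (hI j hj).1
  have hm : 0 < F.g m := hpos m (le_trans hmn hnK)
  have hn : 0 < F.g n := hpos n hnK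
  have hmγ : F.g m ≤ γ := (hI m (le_trans hmn hnK)).2
  have hnγ : F.g n ≤ γ := (hI n hnK).2
  have hA : 0 < Real.log ((F.g m) ^ 2)⁻¹ := by
    apply Real.log_pos
    rw [one_lt_inv₀ (by positivity)]
    exact pow_lt_one₀ hm.le (lt_of_le_of_lt hmγ hγ1) two_ne_zero
  have hAn : 0 ≤ Real.log ((F.g n) ^ 2)⁻¹ := log_inv_sq_nonneg hn (le_trans hnγ hγ1.le)
  have hρ1 : 1 ≤ β' / b := by rw [le_div_iff₀ hb]; linarith
  have hy : 0 ≤ Real.log (β' / b) := Real.log_nonneg hρ1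
  have hle := log_inv_sq_le_of_discrete031 F K hb hbβ hgK hpos h hmn hnK
  have hroom' : (p : ℝ) * Real.log (β' / b) ≤ β₀ / 2 * Real.log ((F.g m) ^ 2)⁻¹ :=
    le_trans hroom (mul_le_mul_of_nonneg_left (log_inv_sq_mono hm hmγ) (by linarith))
  exact ineq27a_logroom hA hAn hy hle hβ₀ hβ₁ hroom'

/-- **(2.46), middle member, under the (0.31)-reading** (no pointwise sign): `Σ_{j=1}^{n} g_j^{κ₀} < g_n^{κ₀−6}` for
every `n ≤ K`, from `Step.Discrete031 b β′ K g_K` (`0 < b ≤ β′`), `0 < g_k ≤ γ`, `κ₀ ≥ 6`, and the explicit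
smallness `(β′/b)^{(κ₀−6)/2}((β′/b)²γ⁴/(2b) + γ⁶) < 1` ("for … g sufficiently small", now depending on κ₀, b, β′).
Mechanism: `Step.sum_sixth_powers_le` with `y = 1/g_K² + b(K−n)` gives `Σ_{j<n} g_j⁶ ≤ (β′/b)² g_n⁴/(2b)`, and
`g_j ≤ (β′/b)^{1/2} g_n` (`Step.ratio_bound_of_discrete031`). [cite: Balaban1988Convergent, (2.46) p.263] -/
theorem sumIneq246_of_discrete031 (hb : 0 < b) (hbβ : b ≤ β') (hgK : 0 < gK)
    (hI : F.InInterval γ K) (h : Step.Discrete031 b β' K gK F.g) {κ₀ : ℕ} (hκ : 6 ≤ κ₀)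
    (hsmall : Real.sqrt (β' / b) ^ (κ₀ - 6) * ((β' / b) ^ 2 * γ ^ 4 / (2 * b) + γ ^ 6) < 1) :
    SumIneq246 F.g κ₀ K := by
  intro n hnK
  have hpos : ∀ j, j ≤ K → 0 < F.g j := fun j hj => (hI j hj).1
  have hn : 0 < F.g n := hpos n hnK
  have hnγ : F.g n ≤ γ := (hI n hnK).2
  set ρ := β' / b with hρ
  have hb0 : b ≠ 0 := hb.ne'
  have hρ1 : 1 ≤ ρ := by rw [hρ, le_div_iff₀ hb]; linarith
  have hρ0 : 0 ≤ ρ := le_trans zero_le_one hρ1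
  -- ratio bound g_j ≤ √ρ g_n for j ≤ n
  have hratio : ∀ j, j ≤ n → F.g j ≤ Real.sqrt ρ * F.g n := by
    intro j hj
    have hj0 : 0 < F.g j := hpos j (le_trans hj hnK)
    have hr := Step.ratio_bound_of_discrete031 hb hbβ hgK hpos h hj hnK
    have h2 : (F.g j) ^ 2 ≤ ρ * (F.g n) ^ 2 := by
      rw [hρ, div_mul_eq_mul_div, le_div_iff₀ hb]
      linarith [hr, mul_comm b ((F.g j) ^ 2)]
    have h3 : (F.g j) ^ 2 ≤ (Real.sqrt ρ * F.g n) ^ 2 := by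
      rw [mul_pow, Real.sq_sqrt hρ0]; exact h2
    exact (pow_le_pow_iff_left₀ hj0.le (by positivity) two_ne_zero).1 h3
  -- the running hypothesis of `Step.sum_sixth_powers_le` with y = 1/gK² + b(K − n)
  set y := 1 / gK ^ 2 + b * ((K : ℝ) - n) with hy
  have hKn : (0 : ℝ) ≤ (K : ℝ) - n := by
    have : (n : ℝ) ≤ K := by exact_mod_cast hnK
    linarith
  have hy0 : 0 < y := by rw [hy]; positivity
  have hrun : ∀ j, j < n → y + b * ((n : ℝ) - j) ≤ 1 / (F.g j) ^ 2 := by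
    intro j hj
    have := (h j (le_trans hj.le hnK)).1
    have e : y + b * ((n : ℝ) - j) = 1 / gK ^ 2 + b * ((K : ℝ) - j) := by rw [hy]; ring
    rw [e]; exact this
  have h6 : ∑ j ∈ Finset.range n, (F.g j) ^ 6 ≤ 1 / (2 * b * y ^ 2) :=
    Step.sum_sixth_powers_le hy0 hb (fun j hj => hpos j (le_trans hj.le hnK)) hrun
  -- 1/y ≤ ρ g_n² from the upper running at n
  have hyn : 1 / y ≤ ρ * (F.g n) ^ 2 := by
    have hup := (h n hnK).2
    have h1 : 1 / (F.g n) ^ 2 ≤ ρ * y := by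
      have e : ρ * (b * ((K : ℝ) - n)) = β' * ((K : ℝ) - n) := by rw [hρ]; field_simp
      calc 1 / (F.g n) ^ 2 ≤ 1 / gK ^ 2 + β' * ((K : ℝ) - n) := hup
        _ ≤ ρ * y := by
            rw [hy, mul_add, e]
            have hgK2 : 0 ≤ 1 / gK ^ 2 := by positivity
            have := mul_le_mul_of_nonneg_right hρ1 hgK2
            linarith
    have hgn2 : 0 < (F.g n) ^ 2 := by positivity
    rw [div_le_iff₀ hy0]
    have h2 := (div_le_iff₀ hgn2).mp h1
    nlinarith
  have h6' : ∑ j ∈ Finset.range n, (F.g j) ^ 6 ≤ ρ ^ 2 * (F.g n) ^ 4 / (2 * b) := by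
    have e : 1 / (2 * b * y ^ 2) = (1 / y) ^ 2 / (2 * b) := by
      field_simp
    rw [e] at h6
    have hsq : (1 / y) ^ 2 ≤ (ρ * (F.g n) ^ 2) ^ 2 := pow_le_pow_left₀ (by positivity) hyn 2
    calc ∑ j ∈ Finset.range n, (F.g j) ^ 6 ≤ (1 / y) ^ 2 / (2 * b) := h6
      _ ≤ (ρ * (F.g n) ^ 2) ^ 2 / (2 * b) := div_le_div_of_nonneg_right hsq (by positivity)
      _ = ρ ^ 2 * (F.g n) ^ 4 / (2 * b) := by ring
  -- assemble
  have hterm : ∀ j ∈ Finset.Icc 1 n, (F.g j) ^ κ₀ ≤ (F.g j) ^ 6 * (Real.sqrt ρ * F.g n) ^ (κ₀ - 6) := by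
    intro j hj
    have hjn : j ≤ n := (Finset.mem_Icc.mp hj).2
    have hj0 : 0 < F.g j := hpos j (le_trans hjn hnK)
    have e : (F.g j) ^ κ₀ = (F.g j) ^ 6 * (F.g j) ^ (κ₀ - 6) := by
      rw [← pow_add]; congr 1; omega
    rw [e]
    exact mul_le_mul_of_nonneg_left (pow_le_pow_left₀ hj0.le (hratio j hjn) _) (by positivity)
  have h1 : ∑ j ∈ Finset.Icc 1 n, (F.g j) ^ κ₀ ≤
      (∑ j ∈ Finset.Icc 1 n, (F.g j) ^ 6) * (Real.sqrt ρ * F.g n) ^ (κ₀ - 6) := by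
    rw [Finset.sum_mul]; exact Finset.sum_le_sum hterm
  have h2 : ∑ j ∈ Finset.Icc 1 n, (F.g j) ^ 6 ≤ ∑ j ∈ Finset.range (n + 1), (F.g j) ^ 6 := by
    apply Finset.sum_le_sum_of_subset_of_nonneg
    · intro j hj
      rw [Finset.mem_range]; exact Nat.lt_succ_of_le (Finset.mem_Icc.mp hj).2
    · intro j _ _; positivity
  have h4 : ∑ j ∈ Finset.range (n + 1), (F.g j) ^ 6 ≤ ρ ^ 2 * (F.g n) ^ 4 / (2 * b) + (F.g n) ^ 6 := by
    rw [Finset.sum_range_succ]; linarith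
  have hS : Real.sqrt ρ ^ (κ₀ - 6) * (ρ ^ 2 * (F.g n) ^ 4 / (2 * b) + (F.g n) ^ 6) < 1 := by
    have hg4 : (F.g n) ^ 4 ≤ γ ^ 4 := pow_le_pow_left₀ hn.le hnγ 4
    have hg6 : (F.g n) ^ 6 ≤ γ ^ 6 := pow_le_pow_left₀ hn.le hnγ 6
    have hA : ρ ^ 2 * (F.g n) ^ 4 / (2 * b) + (F.g n) ^ 6 ≤ ρ ^ 2 * γ ^ 4 / (2 * b) + γ ^ 6 := by
      have : ρ ^ 2 * (F.g n) ^ 4 / (2 * b) ≤ ρ ^ 2 * γ ^ 4 / (2 * b) := by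
        apply div_le_div_of_nonneg_right _ (by positivity)
        exact mul_le_mul_of_nonneg_left hg4 (by positivity)
      linarith
    calc Real.sqrt ρ ^ (κ₀ - 6) * (ρ ^ 2 * (F.g n) ^ 4 / (2 * b) + (F.g n) ^ 6)
        ≤ Real.sqrt ρ ^ (κ₀ - 6) * (ρ ^ 2 * γ ^ 4 / (2 * b) + γ ^ 6) :=
          mul_le_mul_of_nonneg_left hA (by positivity)
      _ < 1 := hsmall
  have hpow : 0 < (F.g n) ^ (κ₀ - 6) := by positivity
  calc ∑ j ∈ Finset.Icc 1 n, (F.g j) ^ κ₀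
      ≤ (∑ j ∈ Finset.Icc 1 n, (F.g j) ^ 6) * (Real.sqrt ρ * F.g n) ^ (κ₀ - 6) := h1
    _ ≤ (ρ ^ 2 * (F.g n) ^ 4 / (2 * b) + (F.g n) ^ 6) * (Real.sqrt ρ * F.g n) ^ (κ₀ - 6) :=
        mul_le_mul_of_nonneg_right (le_trans h2 h4) (by positivity)
    _ = (Real.sqrt ρ ^ (κ₀ - 6) * (ρ ^ 2 * (F.g n) ^ 4 / (2 * b) + (F.g n) ^ 6)) * (F.g n) ^ (κ₀ - 6) := by
        rw [mul_pow]; ring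
    _ < 1 * (F.g n) ^ (κ₀ - 6) := mul_lt_mul_of_pos_right hS hpow
    _ = (F.g n) ^ (κ₀ - 6) := one_mul _

/-- **T11.F under the (0.31)-READING — every pair `m < n ≤ K`, no pointwise sign.**  From (0.20), `0 < g_k ≤ γ`,
the printed upper bound `β ≤ β′`, `SmallnessFor γ β′ β₀ L p`, the endpoint running (0.31) = `Step.Discrete031 b β′ K
g_K` (`0 < b ≤ β′`) and the γ-smallness `p·log(β′/b) ≤ (β₀/2)·log γ⁻²`: (2.6) first member and (2.6d) WITH THE
CONSTANT `(β′/b)^{1/2}` in place of `1+β₀`; (2.7) both members, printed constants; (2.8) first member printed,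
second member with `(β′/b)^{1/2}` in place of `1+β₀`; (2.9) first and second members, printed constants (sizes by
(2.5)).  Together with `sumIneq246_of_discrete031` this is all of (2.6)–(2.9), (2.46) modulo ONE constant
substitution; cell MISSING-B14.md v2 §9. [cite: Balaban1988Convergent, (2.6)–(2.9) pp.255–256] -/
theorem pairFlow_of_discrete031 (S : SmallnessFor γ β' β₀ L p) {A₀ : ℝ} (hA₀ : 0 ≤ A₀)
    (R : ℕ → ℕ) (hR : ∀ j, j ≤ K → B14.IsRj L p (F.g j) (R j))
    (hrg : F.SatisfiesRG K) (hI : F.InInterval γ K) (hub : ∀ j, j < K → F.β (j + 1) (F.g j) ≤ β')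
    (hb : 0 < b) (hbβ : b ≤ β') (hgK : 0 < gK) (h031 : Step.Discrete031 b β' K gK F.g)
    (hroom : (p : ℝ) * Real.log (β' / b) ≤ β₀ / 2 * Real.log (γ ^ 2)⁻¹)
    {m n : ℕ} (hmn : m < n) (hnK : n ≤ K) :
    (F.g n ≤ Real.sqrt (1 + (F.g n) ^ 2 * β' * ((n : ℝ) - m)) * F.g m ∧
      F.g m ≤ Real.sqrt (β' / b) * F.g n) ∧
    ((Real.log ((F.g n) ^ 2)⁻¹) ^ p ≤ (1 + β₀) * (Real.log ((F.g m) ^ 2)⁻¹) ^ p ∧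
      (Real.log ((F.g m) ^ 2)⁻¹) ^ p ≤
        (1 + (F.g n) ^ 2 * β' * ((n : ℝ) - m)) ^ β₀ * (Real.log ((F.g n) ^ 2)⁻¹) ^ p) ∧
    (epsK A₀ p F n ≤ (1 + β₀) * Real.sqrt ((n : ℝ) - m) * epsK A₀ p F m ∧
      epsK A₀ p F m ≤ Real.sqrt (β' / b) * (1 + (F.g n) ^ 2 * β' * ((n : ℝ) - m)) ^ β₀ * epsK A₀ p F n) ∧
    ((R n : ℝ) ≤ L * R m ∧ (R m : ℝ) ≤ L * (1 + (F.g n) ^ 2 * β' * ((n : ℝ) - m)) ^ β₀ * R n) := by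
  have hpos : ∀ j, j ≤ K → 0 < F.g j := fun j hj => (hI j hj).1
  have hm : 0 < F.g m := hpos m (le_trans hmn.le hnK)
  have hn : 0 < F.g n := hpos n hnK
  have hmγ : F.g m ≤ γ := (hI m (le_trans hmn.le hnK)).2
  have hnγ : F.g n ≤ γ := (hI n hnK).2
  have hρ0 : 0 ≤ β' / b := (div_pos (lt_of_lt_of_le hb hbβ) hb).le
  -- (2.6)
  have h26a := B14.flow26_upper_of_rg F K β' S.β'_nonneg hpos hrg hub m n hmn hnK
  have h26d : F.g m ≤ Real.sqrt (β' / b) * F.g n := by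
    have hr := Step.ratio_bound_of_discrete031 hb hbβ hgK hpos h031 hmn.le hnK
    have h2 : (F.g m) ^ 2 ≤ β' / b * (F.g n) ^ 2 := by
      rw [div_mul_eq_mul_div, le_div_iff₀ hb]
      linarith [hr, mul_comm b ((F.g m) ^ 2)]
    have h3 : (F.g m) ^ 2 ≤ (Real.sqrt (β' / b) * F.g n) ^ 2 := by
      rw [mul_pow, Real.sq_sqrt hρ0]; exact h2
    exact (pow_le_pow_iff_left₀ hm.le (by positivity) two_ne_zero).1 h3
  -- (2.7)
  have h27a := flow27a_of_discrete031 F K hb hbβ hgK S.β₀_pos.le S.β₀_le_one S.γ_lt_one hI h031 hroom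
    hmn.le hnK
  have h27b := flowIneq27b_signfree F K S hrg hI hub hmn hnK
  -- (2.8)
  have h28a := flowIneq28a_signfree F K S hA₀ hrg hI hub hmn hnK
  have hPm0 : 0 ≤ Real.log ((F.g m) ^ 2)⁻¹ := log_inv_sq_nonneg hm (le_trans hmγ S.γ_lt_one.le)
  have h28b : epsK A₀ p F m ≤
      Real.sqrt (β' / b) * (1 + (F.g n) ^ 2 * β' * ((n : ℝ) - m)) ^ β₀ * epsK A₀ p F n := by
    have hfac : 0 ≤ Real.sqrt (β' / b) * F.g n := by positivity
    unfold epsK p0Profile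
    calc F.g m * (A₀ * Real.log (F.g m ^ 2)⁻¹ ^ p)
        ≤ (Real.sqrt (β' / b) * F.g n) *
            (A₀ * ((1 + F.g n ^ 2 * β' * ((n : ℝ) - m)) ^ β₀ * Real.log (F.g n ^ 2)⁻¹ ^ p)) :=
          mul_le_mul h26d (mul_le_mul_of_nonneg_left h27b hA₀)
            (mul_nonneg hA₀ (pow_nonneg hPm0 p)) hfac
      _ = Real.sqrt (β' / b) * (1 + F.g n ^ 2 * β' * ((n : ℝ) - m)) ^ β₀ *
            (F.g n * (A₀ * Real.log (F.g n ^ 2)⁻¹ ^ p)) := by ring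
  -- (2.9)
  have hL1 : 1 ≤ L := le_trans (by norm_num) S.hL
  have hC : 1 + β₀ ≤ (L : ℝ) := by
    have := S.β₀_le_one; have : (2 : ℝ) ≤ L := by exact_mod_cast S.hL
    linarith
  have h29a := ineq29a_pair hL1 hC (pow_nonneg hPm0 p) (hR m (le_trans hmn.le hnK)) (hR n hnK) h27a
  have hX := X_nonneg S.β'_nonneg (F.g n) hmn.le
  have hΘ : 1 ≤ (1 + (F.g n) ^ 2 * β' * ((n : ℝ) - m)) ^ β₀ := Real.one_le_rpow (by linarith) S.β₀_pos.le
  have h29b := ineq29b_pair hL1 hΘ (hR m (le_trans hmn.le hnK)) (hR n hnK) h27b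
  exact ⟨⟨h26a, h26d⟩, ⟨h27a, h27b⟩, ⟨h28a, h28b⟩, ⟨h29a, h29b⟩⟩

end Reading031

/-! ## I. (v1.5) END TO END with [I]'s printed one-loop split (`B12Beta`): the residual of the located step is
contained in the pair of unprinted inputs (AF-0), (AF-1) located for [Balaban1987RG1] Theorem 2 (cell node T09.F) -/

section EndToEnd
variable {γ β' β₀ : ℝ} {L p : ℕ}

/-- For `L ≥ 2` every coupling value admits a size `R_j` in the sense of (2.5) p. 255 (`B14.IsRj L r g_j R_j`: `R_j` is
the least power `L^s` with `(log g_j⁻²)^r ≤ L^s`).  Elementary: the powers of `L ≥ 2` are unbounded, least exponent by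
well-ordering of `ℕ`. [cite: Balaban1988Convergent, (2.5) p.255] -/
theorem isRj_exists (hL : 2 ≤ L) (r : ℕ) (gj : ℝ) : ∃ Rj : ℕ, B14.IsRj L r gj Rj := by
  classical
  have hex : ∃ s : ℕ, (Real.log (gj ^ 2)⁻¹) ^ r ≤ ((L ^ s : ℕ) : ℝ) := by
    obtain ⟨n, hn⟩ := exists_nat_ge ((Real.log (gj ^ 2)⁻¹) ^ r)
    refine ⟨n, le_trans hn ?_⟩
    have h1L : 1 < L := lt_of_lt_of_le one_lt_two hL
    exact_mod_cast (Nat.lt_pow_self h1L : n < L ^ n).le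
  exact ⟨L ^ Nat.find hex, Nat.find hex, rfl, Nat.find_spec hex, fun s' hs' => Nat.find_min' hex hs'⟩

/-- **T11.F from [I]'s printed one-loop split + (AF-0) + (AF-1)** (interval reading, printed constants).  Along a flow
solving (0.20) up to `K` in `]0,γ]` whose β-functions split as `β_j(x) = β⁰_j + r_j(x)` (`B12Beta`: bookkeeping on
[Balaban1987RG1] (1.3)/(1.6) and (2.12)–(2.14) — `β⁰_j` coupling-free, `r_j` from (2.13)) with (AF-0) `2b ≤ β⁰_j`,
(AF-1) `|r_j(x)| ≤ C x` on `]0,γ]`, `0 ≤ C`, `Cγ ≤ b`, `0 < b`, the PRINTED upper bound `β_j ≤ β′` on `]0,γ]`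
([Balaban1987RG1] p. 264, `Step.BetaUpper`), `SmallnessFor γ β′ β₀ L p`, `γ⁴ ≤ b`, `γ ≤ 1/2`, and sizes `R_j` obeying
(2.5): ALL of (2.6), (2.7), (2.8) (for `ε_j = g_j A₀ (log g_j⁻²)^p`), (2.9) with the printed constants, and (2.46) for
every `κ₀ ≥ 7`.  Proof: `B12Beta.betaLower_of_split` gives `b ≤ β_j` on `]0,γ]`, then `flowControl_of_betaPos`.  The two
hypotheses (AF-0), (AF-1) are NOT in print (cell GAPS G-b12-1, G-b12-2); nothing of the series is asserted.
[cite: Balaban1988Convergent, (2.6)–(2.9) pp.255–256 and (2.46) p.263] -/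
theorem flowControl_of_oneLoopSplit (F : Flow) (K : ℕ) (S : SmallnessFor γ β' β₀ L p) {A₀ b C : ℝ} (hA₀ : 0 ≤ A₀)
    (β0 : ℕ → ℝ) (r : ℕ → ℝ → ℝ) (hsplit : ∀ j x, F.β j x = β0 j + r j x) (hAF0 : ∀ j, 2 * b ≤ β0 j)
    (hAF1 : ∀ j x, 0 < x → x ≤ γ → |r j x| ≤ C * x) (hC : 0 ≤ C) (hCγ : C * γ ≤ b)
    (hb : 0 < b) (hγ4 : γ ^ 4 ≤ b) (hγ2 : γ ≤ 1 / 2) (hU : Step.BetaUpper β' γ F.β)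
    (R : ℕ → ℕ) (hR : ∀ j, j ≤ K → B14.IsRj L p (F.g j) (R j))
    (hrg : F.SatisfiesRG K) (hI : F.InInterval γ K) {κ₀ : ℕ} (hκ : 7 ≤ κ₀) :
    (B14.FlowIneq26 F.g β' β₀ K ∧ B14.FlowIneq27 F.g β' β₀ p K ∧
      B14.FlowIneq28 (epsK A₀ p F) F.g β' β₀ K ∧ FlowIneq29 R F.g L β' β₀ K) ∧ SumIneq246 F.g κ₀ K := by
  have hL : Step.BetaLower b γ F.β := B12Beta.betaLower_of_split F.β β0 r hsplit hAF0 hAF1 hC hCγ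
  have hlb : ∀ j, j < K → b ≤ F.β (j + 1) (F.g j) := fun j hj =>
    hL (j + 1) (F.g j) (hI j hj.le).1 (hI j hj.le).2
  have hub : ∀ j, j < K → F.β (j + 1) (F.g j) ≤ β' := fun j hj =>
    hU (j + 1) (F.g j) (hI j hj.le).1 (hI j hj.le).2
  exact flowControl_of_betaPos F K S hA₀ hb hγ4 hγ2 R hR hrg hI hub hlb hκ

/-- **End to end, existence form** (what [Balaban1988Convergent] Thm 1 p. 262 consumes as "(I.0.33)" together with
(2.6)–(2.9), (2.46)).  Under the hypotheses of `flowControl_of_oneLoopSplit` on a family `β_j = β⁰_j + r_j` plus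
continuity of the `r_j` on `]0,γ]`: for every number of steps `K` and every renormalised coupling `g ∈ ]0,γ]` there are
a trajectory `(g_k)_{k ≤ K} ⊂ ]0,γ]` with `g_K = g` solving (0.20) and obeying the running (0.31) in the form
`Step.Discrete031 b β′`, and sizes `R_j` as in (2.5), such that ALL of (2.6)–(2.9) (printed constants) and (2.46) hold.
`B12Beta.thm2Conclusion_of_split` (backward construction `Step.couplingTrajectory_exists`) composed with `isRj_exists`
and `flowControl_of_oneLoopSplit`.  (AF-0), (AF-1), the upper bound and the continuity are hypotheses whose proofs are
not in print; uniqueness of the trajectory is not claimed. [cite: Balaban1988Convergent, Thm 1 p.262; (2.6)–(2.9) pp.255–256; (2.46) p.263] -/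
theorem trajectory_flowControl_of_oneLoopSplit (βM : ℕ → ℝ → ℝ) (S : SmallnessFor γ β' β₀ L p) {A₀ b C : ℝ}
    (hA₀ : 0 ≤ A₀) (β0 : ℕ → ℝ) (r : ℕ → ℝ → ℝ) (hsplit : ∀ j x, βM j x = β0 j + r j x)
    (hAF0 : ∀ j, 2 * b ≤ β0 j) (hAF1 : ∀ j x, 0 < x → x ≤ γ → |r j x| ≤ C * x) (hC : 0 ≤ C) (hCγ : C * γ ≤ b)
    (hb : 0 < b) (hγ4 : γ ^ 4 ≤ b) (hγ2 : γ ≤ 1 / 2) (hU : Step.BetaUpper β' γ βM)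
    (hcont : ∀ j, ContinuousOn (r j) (Set.Ioc 0 γ)) {κ₀ : ℕ} (hκ : 7 ≤ κ₀) :
    ∀ (K : ℕ) (g : ℝ), 0 < g → g ≤ γ →
      ∃ (gs : ℕ → ℝ) (R : ℕ → ℕ), gs K = g ∧ Step.RGEq K βM gs ∧ Step.InInterval γ K gs ∧
        Step.Discrete031 b β' K g gs ∧ (∀ j, j ≤ K → B14.IsRj L p (gs j) (R j)) ∧
        (B14.FlowIneq26 gs β' β₀ K ∧ B14.FlowIneq27 gs β' β₀ p K ∧
          B14.FlowIneq28 (epsK A₀ p ⟨gs, βM⟩) gs β' β₀ K ∧ FlowIneq29 R gs L β' β₀ K) ∧ SumIneq246 gs κ₀ K := by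
  intro K g hg hgγ
  obtain ⟨gs, hK, hrg, hI, h031⟩ :=
    B12Beta.thm2Conclusion_of_split βM β0 r S.γ_pos hb hsplit hAF0 hAF1 hC hCγ hU hcont K g hg hgγ
  choose R hR using fun j => isRj_exists S.hL p (gs j)
  exact ⟨gs, R, hK, hrg, hI, h031, fun j _ => hR j,
    flowControl_of_oneLoopSplit ⟨gs, βM⟩ K S hA₀ β0 r hsplit hAF0 hAF1 hC hCγ hb hγ4 hγ2 hU R (fun j _ => hR j)
      ((Step.rgEq_iff ⟨gs, βM⟩ K).mpr hrg) ((Step.inInterval_iff ⟨gs, βM⟩ γ K).mpr hI) hκ⟩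

end EndToEnd

/-! ## J. (v1.6) AVERAGED asymptotic freedom with a defect suffices for every located consumer of T11.F, (2.46)
included — in particular (AF-0) is consumed only FROM SOME SCALE ON (the β sub-cell's limit form of the one-loop
split; cell `HOME/BETA-SPEC.md` §0 and `FlowStepRuns` §10 for the [I] side)

Along a flow solving (0.20) up to `K`, call "averaged asymptotic freedom with defect `B`" the partial-sum bound
  (AvAF)  `b·(n − m) − B ≤ Σ_{j∈[m,n)} β_{j+1}(g_j)`  for all `m ≤ n ≤ K`  (`b > 0`; then `B ≥ 0` automatically).
It follows from the pointwise bound `b ≤ β` (`B = 0`, section D); from EVENTUAL asymptotic freedom "`β_{j+1}(g_j) ≥ b`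
for `j ≥ k₀` and `≥ −β′` for all `j`" with `B = (b+β′)k₀` (`avgAF_of_eventualLower` — the early scales are controlled by
the PRINTED two-sided bound `|β| ≤ β′` of [Balaban1987RG1] p. 264 alone); and from the limit form "`β_{j+1}(g_j) ≥
−c₀θ^j` for all `j`, `≥ b` for `j ≥ k₀`" with `B = bk₀ + c₀/(1−θ)` (`avgAF_of_limitLower`).  It gives the DEFECTED
running `1/g_n² + b(n−m) − B ≤ 1/g_m²` (`running_of_avgAF`: the lower half of (0.31) up to the additive constant `B`),
all of (2.6)–(2.9) with the printed constants once `Bγ² ≤ β₀(2+β₀)` (section F, `flowControl_of_partialSum`), and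
(2.46) for every `n ≤ K` once `Bγ² ≤ 1/2` and `(√2)^{κ₀−6}(2γ⁴/b + γ⁶) < 1` (`sumIneq246_of_avgAF`:
`Step.sum_sixth_powers_le` with `y = 1/(2g_n²)`, ratio `g_j ≤ √2·g_n`; non-vacuous: `avgAF_smallness_example`).
HEADLINES `flowControl_of_avgAF`, `flowControl_of_eventualLower`, `flowControl_of_limitLower`,
`flowControl_of_eventualOneLoopSplit` (one-loop split `B12Beta`-style with (AF-0) `2b ≤ β⁰_{j+1}` ONLY for `j ≥ k₀`,
(AF-1), and the printed two-sided bound): ALL of (2.6)–(2.9) with the printed constants AND (2.46).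
CENSUS CONSEQUENCE for the cell's β sub-cell: on the [III] side NO located consumer of the flow needs the signs of the
finitely many small-scale one-loop coefficients — they cost γ-smallness only; together with `FlowStepRuns` §10
(endpoint existence and the [Balaban1989LargeFieldII] p. 355 reading from the same limit form) the finite list of
small-k signs is consumed by the LITERAL lower half of (0.31) for all `k ≤ K` and by nothing else the cell has located.
Nothing in this section is a statement about Bałaban's β-functions (1.22). -/

section AveragedAF
variable (F : Flow) (K : ℕ) {γ β' β₀ b B : ℝ} {L p : ℕ}

/-- The DEFECTED running from averaged asymptotic freedom: (0.20) and `b(n−m) − B ≤ Σ_{j∈[m,n)} β_{j+1}(g_j)` give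
`1/g_n² + b(n−m) − B ≤ 1/g_m²` for `m ≤ n ≤ K` — the lower half of (0.31) up to the additive defect `B`. [cite: Balaban1987RG1, (0.20) p.256] -/
theorem running_of_avgAF (hrg : F.SatisfiesRG K)
    (hav : ∀ m n, m ≤ n → n ≤ K → b * ((n : ℝ) - m) - B ≤ ∑ j ∈ Finset.Ico m n, F.β (j + 1) (F.g j))
    {m n : ℕ} (hmn : m ≤ n) (hnK : n ≤ K) :
    1 / (F.g n) ^ 2 + b * ((n : ℝ) - m) - B ≤ 1 / (F.g m) ^ 2 := by
  have tel := Step.inv_sq_telescope ((Step.rgEq_iff F K).mp hrg) hmn hnK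
  have := hav m n hmn hnK
  linarith

/-- The defect is nonnegative (take `m = n`). [folklore] -/
theorem defect_nonneg_of_avgAF
    (hav : ∀ m n, m ≤ n → n ≤ K → b * ((n : ℝ) - m) - B ≤ ∑ j ∈ Finset.Ico m n, F.β (j + 1) (F.g j)) :
    0 ≤ B := by
  have := hav 0 0 le_rfl (Nat.zero_le K)
  simp at this
  linarith

/-- Averaged asymptotic freedom with `b ≥ 0` contains the partial-sum bound `−B ≤ Σ_{j∈[m,n)} β_{j+1}(g_j)` of
section F (`flowControl_of_partialSum`). [folklore] -/
theorem partialSum_of_avgAF (hb : 0 ≤ b)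
    (hav : ∀ m n, m ≤ n → n ≤ K → b * ((n : ℝ) - m) - B ≤ ∑ j ∈ Finset.Ico m n, F.β (j + 1) (F.g j)) :
    ∀ m n, m ≤ n → n ≤ K → -B ≤ ∑ j ∈ Finset.Ico m n, F.β (j + 1) (F.g j) := by
  intro m n hmn hnK
  have h := hav m n hmn hnK
  have hnm : (0 : ℝ) ≤ (n : ℝ) - m := by
    have : (m : ℝ) ≤ n := by exact_mod_cast hmn
    linarith
  have := mul_nonneg hb hnm
  linarith

/-- In a window `[m,n)` at most `k₀` indices lie below `k₀`. [folklore] -/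
theorem card_filter_lt_Ico_le (m n k₀ : ℕ) : ((Finset.Ico m n).filter (· < k₀)).card ≤ k₀ := by
  calc ((Finset.Ico m n).filter (· < k₀)).card ≤ (Finset.range k₀).card := by
        apply Finset.card_le_card
        intro j hj
        rw [Finset.mem_range]; exact (Finset.mem_filter.mp hj).2
    _ = k₀ := Finset.card_range k₀

/-- **Averaged AF from EVENTUAL AF.**  If `β_{j+1}(g_j) ≥ b ≥ 0` for `k₀ ≤ j < K` and `β_{j+1}(g_j) ≥ −β′` for all
`j < K` (`β′ ≥ 0`: the PRINTED two-sided bound "uniformly bounded on this interval" of [Balaban1987RG1] p. 264, read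
along the flow), then `b(n−m) − (b+β′)k₀ ≤ Σ_{j∈[m,n)} β_{j+1}(g_j)` for all `m ≤ n ≤ K`: the finitely many early
scales contribute a CONSTANT defect. [folklore] -/
theorem avgAF_of_eventualLower {k₀ : ℕ} (hβ' : 0 ≤ β') (hb : 0 ≤ b)
    (hlo : ∀ j, j < K → -β' ≤ F.β (j + 1) (F.g j))
    (htail : ∀ j, k₀ ≤ j → j < K → b ≤ F.β (j + 1) (F.g j)) :
    ∀ m n, m ≤ n → n ≤ K →
      b * ((n : ℝ) - m) - (b + β') * k₀ ≤ ∑ j ∈ Finset.Ico m n, F.β (j + 1) (F.g j) := by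
  intro m n hmn hnK
  have hpt : ∀ j ∈ Finset.Ico m n,
      b - (if j < k₀ then (b + β') else 0) ≤ F.β (j + 1) (F.g j) := by
    intro j hj
    have hjK : j < K := lt_of_lt_of_le (Finset.mem_Ico.mp hj).2 hnK
    by_cases hjk : j < k₀
    · rw [if_pos hjk]; have := hlo j hjK; linarith
    · rw [if_neg hjk]; have := htail j (not_lt.mp hjk) hjK; linarith
  have hsum := Finset.sum_le_sum hpt
  have hs1 : ∑ _j ∈ Finset.Ico m n, (b : ℝ) = b * ((n : ℝ) - m) := by
    rw [Finset.sum_const, Nat.card_Ico, nsmul_eq_mul, Nat.cast_sub hmn]; ring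
  have hs2 : ∑ j ∈ Finset.Ico m n, (if j < k₀ then (b + β') else 0)
      = (((Finset.Ico m n).filter (· < k₀)).card : ℝ) * (b + β') := by
    rw [Finset.sum_ite, Finset.sum_const_zero, add_zero, Finset.sum_const, nsmul_eq_mul]
  rw [Finset.sum_sub_distrib, hs1, hs2] at hsum
  have hcard : (((Finset.Ico m n).filter (· < k₀)).card : ℝ) ≤ k₀ := by
    exact_mod_cast card_filter_lt_Ico_le m n k₀
  have hbb : 0 ≤ b + β' := by linarith
  have h1 : (((Finset.Ico m n).filter (· < k₀)).card : ℝ) * (b + β') ≤ (k₀ : ℝ) * (b + β') :=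
    mul_le_mul_of_nonneg_right hcard hbb
  linarith

/-- **Averaged AF from the LIMIT FORM** (the shape produced on the [I] side by `FlowStepRuns` §10 from geometric
convergence of the one-loop coefficients plus (AF-1)): if `β_{j+1}(g_j) ≥ −c₀θ^j` for all `j < K` (`c₀ ≥ 0`,
`0 ≤ θ < 1`) and `β_{j+1}(g_j) ≥ b ≥ 0` for `k₀ ≤ j < K`, then `b(n−m) − (bk₀ + c₀/(1−θ)) ≤ Σ_{j∈[m,n)} β_{j+1}(g_j)`
for all `m ≤ n ≤ K`. [folklore] -/
theorem avgAF_of_limitLower {k₀ : ℕ} {c₀ θ : ℝ} (hθ0 : 0 ≤ θ) (hθ1 : θ < 1) (hc₀ : 0 ≤ c₀) (hb : 0 ≤ b)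
    (hlo : ∀ j, j < K → -(c₀ * θ ^ j) ≤ F.β (j + 1) (F.g j))
    (htail : ∀ j, k₀ ≤ j → j < K → b ≤ F.β (j + 1) (F.g j)) :
    ∀ m n, m ≤ n → n ≤ K →
      b * ((n : ℝ) - m) - (b * k₀ + c₀ / (1 - θ)) ≤ ∑ j ∈ Finset.Ico m n, F.β (j + 1) (F.g j) := by
  intro m n hmn hnK
  have hpt : ∀ j ∈ Finset.Ico m n,
      b - (if j < k₀ then b else 0) - c₀ * θ ^ j ≤ F.β (j + 1) (F.g j) := by
    intro j hj
    have hjK : j < K := lt_of_lt_of_le (Finset.mem_Ico.mp hj).2 hnK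
    have hcθ : 0 ≤ c₀ * θ ^ j := by positivity
    by_cases hjk : j < k₀
    · rw [if_pos hjk]; have := hlo j hjK; linarith
    · rw [if_neg hjk]; have := htail j (not_lt.mp hjk) hjK; linarith
  have hsum := Finset.sum_le_sum hpt
  have hs1 : ∑ _j ∈ Finset.Ico m n, (b : ℝ) = b * ((n : ℝ) - m) := by
    rw [Finset.sum_const, Nat.card_Ico, nsmul_eq_mul, Nat.cast_sub hmn]; ring
  have hs2 : ∑ j ∈ Finset.Ico m n, (if j < k₀ then b else 0)
      = (((Finset.Ico m n).filter (· < k₀)).card : ℝ) * b := by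
    rw [Finset.sum_ite, Finset.sum_const_zero, add_zero, Finset.sum_const, nsmul_eq_mul]
  have hs3 : ∑ j ∈ Finset.Ico m n, c₀ * θ ^ j ≤ c₀ / (1 - θ) := by
    have h1θ : 0 < 1 - θ := by linarith
    have hgeom : ∑ j ∈ Finset.Ico m n, θ ^ j ≤ θ ^ m / (1 - θ) := geom_sum_Ico_le_of_lt_one hθ0 hθ1
    have hθm : θ ^ m / (1 - θ) ≤ 1 / (1 - θ) :=
      div_le_div_of_nonneg_right (pow_le_one₀ hθ0 hθ1.le) h1θ.le
    rw [← Finset.mul_sum]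
    calc c₀ * ∑ j ∈ Finset.Ico m n, θ ^ j ≤ c₀ * (1 / (1 - θ)) :=
          mul_le_mul_of_nonneg_left (hgeom.trans hθm) hc₀
      _ = c₀ / (1 - θ) := mul_one_div c₀ (1 - θ)
  rw [Finset.sum_sub_distrib, Finset.sum_sub_distrib, hs1, hs2] at hsum
  have hcard : (((Finset.Ico m n).filter (· < k₀)).card : ℝ) ≤ k₀ := by
    exact_mod_cast card_filter_lt_Ico_le m n k₀
  have h1 : (((Finset.Ico m n).filter (· < k₀)).card : ℝ) * b ≤ (k₀ : ℝ) * b :=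
    mul_le_mul_of_nonneg_right hcard hb
  linarith

/-- **(2.46), middle member, from AVERAGED asymptotic freedom with a defect** (no pointwise sign, no small-scale
sign): along (0.20) with `0 < g_k ≤ γ`, `b(n−m) − B ≤ Σ_{j∈[m,n)} β_{j+1}(g_j)` for all `m ≤ n ≤ K` (`b > 0`),
`Bγ² ≤ 1/2`, `κ₀ ≥ 6` and the explicit smallness `(√2)^{κ₀−6}(2γ⁴/b + γ⁶) < 1` ("for κ₀ ≥ 7 and g sufficiently
small", now depending on `κ₀`, `b` and through `Bγ² ≤ 1/2` on the defect): `Σ_{j=1}^{n} g_j^{κ₀} < g_n^{κ₀−6}` for every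
`n ≤ K`.  Mechanism: the defected running gives `1/(2g_n²) + b(n−j) ≤ 1/g_j²` for `j < n` (the defect is absorbed by
`B ≤ 1/(2γ²) ≤ 1/(2g_n²)`), so `Step.sum_sixth_powers_le` with `y = 1/(2g_n²)` yields `Σ_{j<n} g_j⁶ ≤ 2g_n⁴/b`, and
`g_j ≤ √2·g_n` for `j ≤ n`. [cite: Balaban1988Convergent, (2.46) p.263] -/
theorem sumIneq246_of_avgAF (hb : 0 < b) (hrg : F.SatisfiesRG K) (hI : F.InInterval γ K)
    (hav : ∀ m n, m ≤ n → n ≤ K → b * ((n : ℝ) - m) - B ≤ ∑ j ∈ Finset.Ico m n, F.β (j + 1) (F.g j))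
    (hBγ : B * γ ^ 2 ≤ 1 / 2) {κ₀ : ℕ} (hκ : 6 ≤ κ₀)
    (hsmall : Real.sqrt 2 ^ (κ₀ - 6) * (2 * γ ^ 4 / b + γ ^ 6) < 1) :
    SumIneq246 F.g κ₀ K := by
  intro n hnK
  have hpos : ∀ j, j ≤ K → 0 < F.g j := fun j hj => (hI j hj).1
  have hn : 0 < F.g n := hpos n hnK
  have hnγ : F.g n ≤ γ := (hI n hnK).2
  have hγ : 0 < γ := lt_of_lt_of_le hn hnγ
  -- the defect is absorbed: B ≤ 1/(2 g_n²)
  have hBn : B ≤ 1 / (2 * (F.g n) ^ 2) := by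
    have hg2 : (F.g n) ^ 2 ≤ γ ^ 2 := pow_le_pow_left₀ hn.le hnγ 2
    have h1 : B ≤ 1 / (2 * γ ^ 2) := by
      rw [le_div_iff₀ (by positivity)]; linarith
    have h2 : 1 / (2 * γ ^ 2) ≤ 1 / (2 * (F.g n) ^ 2) :=
      one_div_le_one_div_of_le (by positivity) (by linarith)
    exact h1.trans h2
  set y := 1 / (2 * (F.g n) ^ 2) with hy
  have hy0 : 0 < y := by rw [hy]; positivity
  have hyn : y ≤ 1 / (F.g n) ^ 2 - B := by
    have e : 1 / (F.g n) ^ 2 = 2 * y := by rw [hy]; field_simp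
    linarith
  have hrun : ∀ j, j < n → y + b * ((n : ℝ) - j) ≤ 1 / (F.g j) ^ 2 := by
    intro j hj
    have := running_of_avgAF F K hrg hav hj.le hnK
    linarith
  have h6 : ∑ j ∈ Finset.range n, (F.g j) ^ 6 ≤ 1 / (2 * b * y ^ 2) :=
    Step.sum_sixth_powers_le hy0 hb (fun j hj => hpos j (le_trans hj.le hnK)) hrun
  have h6' : ∑ j ∈ Finset.range n, (F.g j) ^ 6 ≤ 2 * (F.g n) ^ 4 / b := by
    have e : 1 / (2 * b * y ^ 2) = 2 * (F.g n) ^ 4 / b := by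
      rw [hy]; field_simp
    rw [e] at h6; exact h6
  -- ratio bound g_j ≤ √2 g_n for j ≤ n
  have hratio : ∀ j, j ≤ n → F.g j ≤ Real.sqrt 2 * F.g n := by
    intro j hj
    have hj0 : 0 < F.g j := hpos j (le_trans hj hnK)
    have hinv : y ≤ 1 / (F.g j) ^ 2 := by
      rcases Nat.lt_or_ge j n with hlt | hge
      · have hr := hrun j hlt
        have hnj : (0 : ℝ) ≤ (n : ℝ) - j := by
          have : (j : ℝ) ≤ n := by exact_mod_cast hlt.le
          linarith
        have := mul_nonneg hb.le hnj
        linarith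
      · have hjn : j = n := le_antisymm hj hge
        rw [hjn, hy]
        exact one_div_le_one_div_of_le (by positivity) (by nlinarith [pow_pos hn 2])
    have h2 : (F.g j) ^ 2 ≤ 2 * (F.g n) ^ 2 := by
      rw [hy] at hinv
      have hgj2 : 0 < (F.g j) ^ 2 := by positivity
      have hgn2 : 0 < 2 * (F.g n) ^ 2 := by positivity
      exact (one_div_le_one_div hgn2 hgj2).mp hinv
    have h3 : (F.g j) ^ 2 ≤ (Real.sqrt 2 * F.g n) ^ 2 := by
      rw [mul_pow, Real.sq_sqrt (by norm_num : (0:ℝ) ≤ 2)]; exact h2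
    exact (pow_le_pow_iff_left₀ hj0.le (by positivity) two_ne_zero).1 h3
  -- assemble (as in `sumIneq246_of_discrete031`, with the fixed ratio √2)
  have hterm : ∀ j ∈ Finset.Icc 1 n, (F.g j) ^ κ₀ ≤ (F.g j) ^ 6 * (Real.sqrt 2 * F.g n) ^ (κ₀ - 6) := by
    intro j hj
    have hjn : j ≤ n := (Finset.mem_Icc.mp hj).2
    have hj0 : 0 < F.g j := hpos j (le_trans hjn hnK)
    have e : (F.g j) ^ κ₀ = (F.g j) ^ 6 * (F.g j) ^ (κ₀ - 6) := by
      rw [← pow_add]; congr 1; omega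
    rw [e]
    exact mul_le_mul_of_nonneg_left (pow_le_pow_left₀ hj0.le (hratio j hjn) _) (by positivity)
  have h1 : ∑ j ∈ Finset.Icc 1 n, (F.g j) ^ κ₀ ≤
      (∑ j ∈ Finset.Icc 1 n, (F.g j) ^ 6) * (Real.sqrt 2 * F.g n) ^ (κ₀ - 6) := by
    rw [Finset.sum_mul]; exact Finset.sum_le_sum hterm
  have h2 : ∑ j ∈ Finset.Icc 1 n, (F.g j) ^ 6 ≤ ∑ j ∈ Finset.range (n + 1), (F.g j) ^ 6 := by
    apply Finset.sum_le_sum_of_subset_of_nonneg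
    · intro j hj
      rw [Finset.mem_range]; exact Nat.lt_succ_of_le (Finset.mem_Icc.mp hj).2
    · intro j _ _; positivity
  have h4 : ∑ j ∈ Finset.range (n + 1), (F.g j) ^ 6 ≤ 2 * (F.g n) ^ 4 / b + (F.g n) ^ 6 := by
    rw [Finset.sum_range_succ]; linarith
  have hS : Real.sqrt 2 ^ (κ₀ - 6) * (2 * (F.g n) ^ 4 / b + (F.g n) ^ 6) < 1 := by
    have hg4 : (F.g n) ^ 4 ≤ γ ^ 4 := pow_le_pow_left₀ hn.le hnγ 4
    have hg6 : (F.g n) ^ 6 ≤ γ ^ 6 := pow_le_pow_left₀ hn.le hnγ 6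
    have hA : 2 * (F.g n) ^ 4 / b + (F.g n) ^ 6 ≤ 2 * γ ^ 4 / b + γ ^ 6 := by
      have : 2 * (F.g n) ^ 4 / b ≤ 2 * γ ^ 4 / b := by
        apply div_le_div_of_nonneg_right _ hb.le
        linarith
      linarith
    calc Real.sqrt 2 ^ (κ₀ - 6) * (2 * (F.g n) ^ 4 / b + (F.g n) ^ 6)
        ≤ Real.sqrt 2 ^ (κ₀ - 6) * (2 * γ ^ 4 / b + γ ^ 6) :=
          mul_le_mul_of_nonneg_left hA (by positivity)
      _ < 1 := hsmall
  have hpow : 0 < (F.g n) ^ (κ₀ - 6) := by positivity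
  calc ∑ j ∈ Finset.Icc 1 n, (F.g j) ^ κ₀
      ≤ (∑ j ∈ Finset.Icc 1 n, (F.g j) ^ 6) * (Real.sqrt 2 * F.g n) ^ (κ₀ - 6) := h1
    _ ≤ (2 * (F.g n) ^ 4 / b + (F.g n) ^ 6) * (Real.sqrt 2 * F.g n) ^ (κ₀ - 6) :=
        mul_le_mul_of_nonneg_right (le_trans h2 h4) (by positivity)
    _ = (Real.sqrt 2 ^ (κ₀ - 6) * (2 * (F.g n) ^ 4 / b + (F.g n) ^ 6)) * (F.g n) ^ (κ₀ - 6) := by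
        rw [mul_pow]; ring
    _ < 1 * (F.g n) ^ (κ₀ - 6) := mul_lt_mul_of_pos_right hS hpow
    _ = (F.g n) ^ (κ₀ - 6) := one_mul _

/-- Non-vacuity of the smallness clause of `sumIneq246_of_avgAF` at the printed `κ₀ = 7` with `γ = 1/10`, `b = 1/20`
(`√2·(2·10⁻⁴·20 + 10⁻⁶) < 1`). [folklore] -/
theorem avgAF_smallness_example :
    Real.sqrt 2 ^ (7 - 6) * (2 * (1 / 10 : ℝ) ^ 4 / (1 / 20) + (1 / 10) ^ 6) < 1 := by
  have h2 : Real.sqrt 2 ≤ 2 := by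
    rw [show (2 : ℝ) = Real.sqrt (2 ^ 2) from (Real.sqrt_sq (by norm_num)).symm]
    exact Real.sqrt_le_sqrt (by norm_num)
  have h0 : 0 ≤ Real.sqrt 2 := Real.sqrt_nonneg 2
  norm_num
  nlinarith

/-- **T11.F from AVERAGED asymptotic freedom with a defect** — every located consumer, (2.46) included, no pointwise
and no small-scale sign.  Along (0.20) in `]0,γ]` with the printed `β_{j+1}(g_j) ≤ β′`, `SmallnessFor γ β′ β₀ L p`,
sizes by (2.5), and `b(n−m) − B ≤ Σ_{j∈[m,n)} β_{j+1}(g_j)` for all `m ≤ n ≤ K` (`b > 0`) with `Bγ² ≤ β₀(2+β₀)`,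
`Bγ² ≤ 1/2`, `(√2)^{κ₀−6}(2γ⁴/b + γ⁶) < 1`: ALL of (2.6)–(2.9) with the printed constants (`flowControl_of_partialSum`)
AND (2.46) for every `κ₀ ≥ 6` (`sumIneq246_of_avgAF`; the printed binder is `κ₀ ≥ 7`). [cite: Balaban1988Convergent, (2.6)–(2.9) pp.255–256 and (2.46) p.263] -/
theorem flowControl_of_avgAF (S : SmallnessFor γ β' β₀ L p) {A₀ : ℝ} (hA₀ : 0 ≤ A₀)
    (R : ℕ → ℕ) (hR : ∀ j, j ≤ K → B14.IsRj L p (F.g j) (R j))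
    (hrg : F.SatisfiesRG K) (hI : F.InInterval γ K) (hub : ∀ j, j < K → F.β (j + 1) (F.g j) ≤ β')
    (hb : 0 < b)
    (hav : ∀ m n, m ≤ n → n ≤ K → b * ((n : ℝ) - m) - B ≤ ∑ j ∈ Finset.Ico m n, F.β (j + 1) (F.g j))
    (hBγ : B * γ ^ 2 ≤ β₀ * (2 + β₀)) (hBγ' : B * γ ^ 2 ≤ 1 / 2) {κ₀ : ℕ} (hκ : 6 ≤ κ₀)
    (hsmall : Real.sqrt 2 ^ (κ₀ - 6) * (2 * γ ^ 4 / b + γ ^ 6) < 1) :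
    (B14.FlowIneq26 F.g β' β₀ K ∧ B14.FlowIneq27 F.g β' β₀ p K ∧
      B14.FlowIneq28 (epsK A₀ p F) F.g β' β₀ K ∧ FlowIneq29 R F.g L β' β₀ K) ∧ SumIneq246 F.g κ₀ K :=
  ⟨flowControl_of_partialSum F K S hA₀ R hR hrg hI hub (partialSum_of_avgAF F K hb.le hav) hBγ,
   sumIneq246_of_avgAF F K hb hrg hI hav hBγ' hκ hsmall⟩

/-- **T11.F from EVENTUAL asymptotic freedom**: all of (2.6)–(2.9) with the printed constants and (2.46), from
`b ≤ β_{j+1}(g_j)` for `k₀ ≤ j < K` only (`b > 0`), the PRINTED two-sided bound `−β′ ≤ β_{j+1}(g_j) ≤ β′` for all `j < K`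
([Balaban1987RG1] p. 264), and γ-smallness now depending on `k₀`: `(b+β′)k₀γ² ≤ β₀(2+β₀)`, `(b+β′)k₀γ² ≤ 1/2`,
`(√2)^{κ₀−6}(2γ⁴/b + γ⁶) < 1`.  The finitely many scales `j < k₀` cost γ-smallness, nothing else. [cite: Balaban1988Convergent, (2.6)–(2.9) pp.255–256 and (2.46) p.263] -/
theorem flowControl_of_eventualLower (S : SmallnessFor γ β' β₀ L p) {A₀ : ℝ} (hA₀ : 0 ≤ A₀) {k₀ : ℕ}
    (R : ℕ → ℕ) (hR : ∀ j, j ≤ K → B14.IsRj L p (F.g j) (R j))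
    (hrg : F.SatisfiesRG K) (hI : F.InInterval γ K) (hub : ∀ j, j < K → F.β (j + 1) (F.g j) ≤ β')
    (hlo : ∀ j, j < K → -β' ≤ F.β (j + 1) (F.g j)) (hb : 0 < b)
    (htail : ∀ j, k₀ ≤ j → j < K → b ≤ F.β (j + 1) (F.g j))
    (hk₀ : (b + β') * k₀ * γ ^ 2 ≤ β₀ * (2 + β₀)) (hk₀' : (b + β') * k₀ * γ ^ 2 ≤ 1 / 2) {κ₀ : ℕ} (hκ : 6 ≤ κ₀)
    (hsmall : Real.sqrt 2 ^ (κ₀ - 6) * (2 * γ ^ 4 / b + γ ^ 6) < 1) :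
    (B14.FlowIneq26 F.g β' β₀ K ∧ B14.FlowIneq27 F.g β' β₀ p K ∧
      B14.FlowIneq28 (epsK A₀ p F) F.g β' β₀ K ∧ FlowIneq29 R F.g L β' β₀ K) ∧ SumIneq246 F.g κ₀ K :=
  flowControl_of_avgAF F K S hA₀ R hR hrg hI hub hb
    (avgAF_of_eventualLower F K S.β'_nonneg hb.le hlo htail) hk₀ hk₀' hκ hsmall

/-- **T11.F from the LIMIT FORM** (realised values; the [III]-side companion of `FlowStepRuns` §10): all of
(2.6)–(2.9) with the printed constants and (2.46), from `β_{j+1}(g_j) ≥ −c₀θ^j` for all `j < K` (`c₀ ≥ 0`,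
`0 ≤ θ < 1`), `β_{j+1}(g_j) ≥ b > 0` for `k₀ ≤ j < K`, the printed upper bound, and γ-smallness depending on the defect
`B = bk₀ + c₀/(1−θ)`: `Bγ² ≤ β₀(2+β₀)`, `Bγ² ≤ 1/2`, `(√2)^{κ₀−6}(2γ⁴/b + γ⁶) < 1`. [cite: Balaban1988Convergent, (2.6)–(2.9) pp.255–256 and (2.46) p.263] -/
theorem flowControl_of_limitLower (S : SmallnessFor γ β' β₀ L p) {A₀ : ℝ} (hA₀ : 0 ≤ A₀) {k₀ : ℕ} {c₀ θ : ℝ}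
    (R : ℕ → ℕ) (hR : ∀ j, j ≤ K → B14.IsRj L p (F.g j) (R j))
    (hrg : F.SatisfiesRG K) (hI : F.InInterval γ K) (hub : ∀ j, j < K → F.β (j + 1) (F.g j) ≤ β')
    (hθ0 : 0 ≤ θ) (hθ1 : θ < 1) (hc₀ : 0 ≤ c₀) (hb : 0 < b)
    (hlo : ∀ j, j < K → -(c₀ * θ ^ j) ≤ F.β (j + 1) (F.g j))
    (htail : ∀ j, k₀ ≤ j → j < K → b ≤ F.β (j + 1) (F.g j))
    (hBγ : (b * k₀ + c₀ / (1 - θ)) * γ ^ 2 ≤ β₀ * (2 + β₀)) (hBγ' : (b * k₀ + c₀ / (1 - θ)) * γ ^ 2 ≤ 1 / 2)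
    {κ₀ : ℕ} (hκ : 6 ≤ κ₀) (hsmall : Real.sqrt 2 ^ (κ₀ - 6) * (2 * γ ^ 4 / b + γ ^ 6) < 1) :
    (B14.FlowIneq26 F.g β' β₀ K ∧ B14.FlowIneq27 F.g β' β₀ p K ∧
      B14.FlowIneq28 (epsK A₀ p F) F.g β' β₀ K ∧ FlowIneq29 R F.g L β' β₀ K) ∧ SumIneq246 F.g κ₀ K :=
  flowControl_of_avgAF F K S hA₀ R hR hrg hI hub hb
    (avgAF_of_limitLower F K hθ0 hθ1 hc₀ hb.le hlo htail) hBγ hBγ' hκ hsmall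

/-- **T11.F from [I]'s one-loop split with (AF-0) ONLY FROM SOME SCALE ON** (the β sub-cell's limit form on the [III]
side).  Along a flow in `]0,γ]` solving (0.20) whose β-functions split as `β_j(x) = β⁰_j + r_j(x)` (`B12Beta`:
bookkeeping on [Balaban1987RG1] (1.3)/(1.6) and (2.12)–(2.14)), with (AF-0) `2b ≤ β⁰_{j+1}` only for `j ≥ k₀`, (AF-1)
`|r_j(x)| ≤ Cx` on `]0,γ]` (`0 ≤ C`, `Cγ ≤ b`, `0 < b`), the PRINTED two-sided bound `−β′ ≤ β_j(x) ≤ β′` on `]0,γ]`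
([Balaban1987RG1] p. 264 "uniformly bounded on this interval": `Step.BetaUpper` and its lower companion),
`SmallnessFor γ β′ β₀ L p`, sizes by (2.5) and the γ-smallness of `flowControl_of_eventualLower`: ALL of (2.6)–(2.9)
with the printed constants AND (2.46).  Compare `flowControl_of_oneLoopSplit` (section I), which assumed (AF-0) for
EVERY scale: the signs of the finitely many small-scale one-loop coefficients are not consumed by any located [III]-side
use of the flow.  (AF-0) on the tail and (AF-1) remain located UNPRINTED inputs (cell GAPS G-b12-1, G-b12-2); nothing
of the series is asserted. [cite: Balaban1988Convergent, (2.6)–(2.9) pp.255–256 and (2.46) p.263] -/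
theorem flowControl_of_eventualOneLoopSplit (S : SmallnessFor γ β' β₀ L p) {A₀ C : ℝ} (hA₀ : 0 ≤ A₀) {k₀ : ℕ}
    (β0 : ℕ → ℝ) (r : ℕ → ℝ → ℝ) (hsplit : ∀ j x, F.β j x = β0 j + r j x)
    (hAF0 : ∀ j, k₀ ≤ j → 2 * b ≤ β0 (j + 1))
    (hAF1 : ∀ j x, 0 < x → x ≤ γ → |r j x| ≤ C * x) (hC : 0 ≤ C) (hCγ : C * γ ≤ b) (hb : 0 < b)
    (hU : Step.BetaUpper β' γ F.β) (hLo : ∀ j x, 0 < x → x ≤ γ → -β' ≤ F.β j x)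
    (R : ℕ → ℕ) (hR : ∀ j, j ≤ K → B14.IsRj L p (F.g j) (R j))
    (hrg : F.SatisfiesRG K) (hI : F.InInterval γ K)
    (hk₀ : (b + β') * k₀ * γ ^ 2 ≤ β₀ * (2 + β₀)) (hk₀' : (b + β') * k₀ * γ ^ 2 ≤ 1 / 2) {κ₀ : ℕ} (hκ : 6 ≤ κ₀)
    (hsmall : Real.sqrt 2 ^ (κ₀ - 6) * (2 * γ ^ 4 / b + γ ^ 6) < 1) :
    (B14.FlowIneq26 F.g β' β₀ K ∧ B14.FlowIneq27 F.g β' β₀ p K ∧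
      B14.FlowIneq28 (epsK A₀ p F) F.g β' β₀ K ∧ FlowIneq29 R F.g L β' β₀ K) ∧ SumIneq246 F.g κ₀ K := by
  have hub : ∀ j, j < K → F.β (j + 1) (F.g j) ≤ β' := fun j hj =>
    hU (j + 1) (F.g j) (hI j hj.le).1 (hI j hj.le).2
  have hlo : ∀ j, j < K → -β' ≤ F.β (j + 1) (F.g j) := fun j hj =>
    hLo (j + 1) (F.g j) (hI j hj.le).1 (hI j hj.le).2
  have htail : ∀ j, k₀ ≤ j → j < K → b ≤ F.β (j + 1) (F.g j) := by
    intro j hj hjK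
    have hx := (hI j hjK.le).1
    have hxγ := (hI j hjK.le).2
    have h1 := hAF1 (j + 1) (F.g j) hx hxγ
    have h2 : C * F.g j ≤ C * γ := mul_le_mul_of_nonneg_left hxγ hC
    have h3 : -(C * F.g j) ≤ r (j + 1) (F.g j) := (abs_le.mp h1).1
    rw [hsplit (j + 1) (F.g j)]
    linarith [hAF0 j hj]
  exact flowControl_of_eventualLower F K S hA₀ R hR hrg hI hub hlo hb htail hk₀ hk₀' hκ hsmall

/-- NECESSITY bookkeeping (census): along (0.20) with positive couplings, (AvAF) with constants `b`, `B` is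
EQUIVALENT to the defected running `1/g_n² + b(n−m) − B ≤ 1/g_m²` for all `m ≤ n ≤ K` — so "averaged asymptotic
freedom with a defect" is exactly "(0.31), lower half, up to an additive constant", the weakest coupling-level
statement from which this module derives (2.46). [cite: Balaban1987RG1, (0.20) p.256 and (0.31) p.259] -/
theorem avgAF_iff_defectedRunning (hrg : F.SatisfiesRG K) :
    (∀ m n, m ≤ n → n ≤ K → b * ((n : ℝ) - m) - B ≤ ∑ j ∈ Finset.Ico m n, F.β (j + 1) (F.g j)) ↔
      ∀ m n, m ≤ n → n ≤ K → 1 / (F.g n) ^ 2 + b * ((n : ℝ) - m) - B ≤ 1 / (F.g m) ^ 2 := by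
  constructor
  · intro hav m n hmn hnK
    exact running_of_avgAF F K hrg hav hmn hnK
  · intro hrun m n hmn hnK
    have tel := Step.inv_sq_telescope ((Step.rgEq_iff F K).mp hrg) hmn hnK
    have := hrun m n hmn hnK
    linarith

/-! ### (v1.7) Two more sources of (AvAF): any SUMMABLE lower envelope; AF off an exceptional set of bounded size -/

/-- **Averaged AF from a SUMMABLE lower envelope** (any rate, not only geometric): if `β_{j+1}(g_j) ≥ −c_j` for all
`j < K` with `c_j ≥ 0` and `Σ_{j<n} c_j ≤ C_tot` for every `n`, and `β_{j+1}(g_j) ≥ b ≥ 0` for `k₀ ≤ j < K`, then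
`b(n−m) − (bk₀ + C_tot) ≤ Σ_{j∈[m,n)} β_{j+1}(g_j)` for all `m ≤ n ≤ K` (`avgAF_of_limitLower` is the case
`c_j = c₀θ^j`, `C_tot = c₀/(1−θ)`). [folklore] -/
theorem avgAF_of_summableLower {k₀ : ℕ} {c : ℕ → ℝ} {Ctot : ℝ} (hc : ∀ j, 0 ≤ c j)
    (hsum : ∀ n, ∑ j ∈ Finset.range n, c j ≤ Ctot) (hb : 0 ≤ b)
    (hlo : ∀ j, j < K → -(c j) ≤ F.β (j + 1) (F.g j))
    (htail : ∀ j, k₀ ≤ j → j < K → b ≤ F.β (j + 1) (F.g j)) :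
    ∀ m n, m ≤ n → n ≤ K →
      b * ((n : ℝ) - m) - (b * k₀ + Ctot) ≤ ∑ j ∈ Finset.Ico m n, F.β (j + 1) (F.g j) := by
  intro m n hmn hnK
  have hpt : ∀ j ∈ Finset.Ico m n,
      b - (if j < k₀ then b else 0) - c j ≤ F.β (j + 1) (F.g j) := by
    intro j hj
    have hjK : j < K := lt_of_lt_of_le (Finset.mem_Ico.mp hj).2 hnK
    have hcj := hc j
    by_cases hjk : j < k₀
    · rw [if_pos hjk]; have := hlo j hjK; linarith
    · rw [if_neg hjk]; have := htail j (not_lt.mp hjk) hjK; linarith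
  have hsum' := Finset.sum_le_sum hpt
  have hs1 : ∑ _j ∈ Finset.Ico m n, (b : ℝ) = b * ((n : ℝ) - m) := by
    rw [Finset.sum_const, Nat.card_Ico, nsmul_eq_mul, Nat.cast_sub hmn]; ring
  have hs2 : ∑ j ∈ Finset.Ico m n, (if j < k₀ then b else 0)
      = (((Finset.Ico m n).filter (· < k₀)).card : ℝ) * b := by
    rw [Finset.sum_ite, Finset.sum_const_zero, add_zero, Finset.sum_const, nsmul_eq_mul]
  have hs3 : ∑ j ∈ Finset.Ico m n, c j ≤ Ctot := by
    refine le_trans ?_ (hsum n)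
    apply Finset.sum_le_sum_of_subset_of_nonneg
    · intro j hj
      rw [Finset.mem_range]; exact (Finset.mem_Ico.mp hj).2
    · intro j _ _; exact hc j
  rw [Finset.sum_sub_distrib, Finset.sum_sub_distrib, hs1, hs2] at hsum'
  have hcard : (((Finset.Ico m n).filter (· < k₀)).card : ℝ) ≤ k₀ := by
    exact_mod_cast card_filter_lt_Ico_le m n k₀
  have h1 : (((Finset.Ico m n).filter (· < k₀)).card : ℝ) * b ≤ (k₀ : ℝ) * b :=
    mul_le_mul_of_nonneg_right hcard hb
  linarith

/-- **Averaged AF from AF OFF AN EXCEPTIONAL SET of bounded size** — the shape of Bauerschmidt–Brydges–Slade's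
assumption (A1), Ann. Henri Poincaré 16 (2015) 1033 = arXiv:1211.2477, §1: *"There exists c>0 such that β_j ≥ c
for all but c⁻¹ values of j ≤ j_Ω."*  If `β_{j+1}(g_j) ≥ b ≥ 0` for `j < K`, `j ∉ E` (`E` a finite set with
`#E ≤ N₀`) and `β_{j+1}(g_j) ≥ −β′` for all `j < K` (`β′ ≥ 0`, the printed two-sided bound), then
`b(n−m) − (b+β′)N₀ ≤ Σ_{j∈[m,n)} β_{j+1}(g_j)` for all `m ≤ n ≤ K` (`avgAF_of_eventualLower` is the case
`E = {j < k₀}`).  Quoted for the SHAPE only: (A1) is a hypothesis of that paper about a φ⁴-type flow, not a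
statement about [Balaban1987RG1] (1.22). [folklore] -/
theorem avgAF_of_exceptional {E : Finset ℕ} {N₀ : ℕ} (hE : E.card ≤ N₀) (hβ' : 0 ≤ β') (hb : 0 ≤ b)
    (hlo : ∀ j, j < K → -β' ≤ F.β (j + 1) (F.g j))
    (hgood : ∀ j, j < K → j ∉ E → b ≤ F.β (j + 1) (F.g j)) :
    ∀ m n, m ≤ n → n ≤ K →
      b * ((n : ℝ) - m) - (b + β') * N₀ ≤ ∑ j ∈ Finset.Ico m n, F.β (j + 1) (F.g j) := by
  classical
  intro m n hmn hnK
  have hpt : ∀ j ∈ Finset.Ico m n,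
      b - (if j ∈ E then (b + β') else 0) ≤ F.β (j + 1) (F.g j) := by
    intro j hj
    have hjK : j < K := lt_of_lt_of_le (Finset.mem_Ico.mp hj).2 hnK
    by_cases hjE : j ∈ E
    · rw [if_pos hjE]; have := hlo j hjK; linarith
    · rw [if_neg hjE]; have := hgood j hjK hjE; linarith
  have hsum := Finset.sum_le_sum hpt
  have hs1 : ∑ _j ∈ Finset.Ico m n, (b : ℝ) = b * ((n : ℝ) - m) := by
    rw [Finset.sum_const, Nat.card_Ico, nsmul_eq_mul, Nat.cast_sub hmn]; ring
  have hs2 : ∑ j ∈ Finset.Ico m n, (if j ∈ E then (b + β') else 0)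
      = (((Finset.Ico m n).filter (· ∈ E)).card : ℝ) * (b + β') := by
    rw [Finset.sum_ite, Finset.sum_const_zero, add_zero, Finset.sum_const, nsmul_eq_mul]
  rw [Finset.sum_sub_distrib, hs1, hs2] at hsum
  have hcardN : ((Finset.Ico m n).filter (· ∈ E)).card ≤ N₀ := by
    refine le_trans (Finset.card_le_card ?_) hE
    intro j hj
    exact (Finset.mem_filter.mp hj).2
  have hcard : (((Finset.Ico m n).filter (· ∈ E)).card : ℝ) ≤ N₀ := by exact_mod_cast hcardN
  have hbb : 0 ≤ b + β' := by linarith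
  have h1 : (((Finset.Ico m n).filter (· ∈ E)).card : ℝ) * (b + β') ≤ (N₀ : ℝ) * (b + β') :=
    mul_le_mul_of_nonneg_right hcard hbb
  linarith

/-- **T11.F from AF off an exceptional set of bounded size** ((A1)-shape): all of (2.6)–(2.9) with the printed
constants and (2.46), from `b ≤ β_{j+1}(g_j)` (`b > 0`) for `j < K` outside a finite set `E` with `#E ≤ N₀`, the
printed two-sided bound `−β′ ≤ β_{j+1}(g_j) ≤ β′` for all `j < K`, and γ-smallness `(b+β′)N₀γ² ≤ β₀(2+β₀)`,
`(b+β′)N₀γ² ≤ 1/2`, `(√2)^{κ₀−6}(2γ⁴/b + γ⁶) < 1`. [cite: Balaban1988Convergent, (2.6)–(2.9) pp.255–256 and (2.46) p.263] -/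
theorem flowControl_of_exceptional (S : SmallnessFor γ β' β₀ L p) {A₀ : ℝ} (hA₀ : 0 ≤ A₀) {E : Finset ℕ} {N₀ : ℕ}
    (R : ℕ → ℕ) (hR : ∀ j, j ≤ K → B14.IsRj L p (F.g j) (R j))
    (hrg : F.SatisfiesRG K) (hI : F.InInterval γ K) (hub : ∀ j, j < K → F.β (j + 1) (F.g j) ≤ β')
    (hlo : ∀ j, j < K → -β' ≤ F.β (j + 1) (F.g j)) (hb : 0 < b) (hE : E.card ≤ N₀)
    (hgood : ∀ j, j < K → j ∉ E → b ≤ F.β (j + 1) (F.g j))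
    (hN₀ : (b + β') * N₀ * γ ^ 2 ≤ β₀ * (2 + β₀)) (hN₀' : (b + β') * N₀ * γ ^ 2 ≤ 1 / 2) {κ₀ : ℕ} (hκ : 6 ≤ κ₀)
    (hsmall : Real.sqrt 2 ^ (κ₀ - 6) * (2 * γ ^ 4 / b + γ ^ 6) < 1) :
    (B14.FlowIneq26 F.g β' β₀ K ∧ B14.FlowIneq27 F.g β' β₀ p K ∧
      B14.FlowIneq28 (epsK A₀ p F) F.g β' β₀ K ∧ FlowIneq29 R F.g L β' β₀ K) ∧ SumIneq246 F.g κ₀ K :=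
  flowControl_of_avgAF F K S hA₀ R hR hrg hI hub hb
    (avgAF_of_exceptional F K hE S.β'_nonneg hb.le hlo hgood) hN₀ hN₀' hκ hsmall

/-- **T11.F from a summable lower envelope + eventual AF**: all of (2.6)–(2.9) with the printed constants and (2.46),
from `β_{j+1}(g_j) ≥ −c_j` (`c_j ≥ 0`, `Σ_{j<n} c_j ≤ C_tot`), `β_{j+1}(g_j) ≥ b > 0` for `k₀ ≤ j < K`, the printed
upper bound, and γ-smallness in the defect `B = bk₀ + C_tot`. [cite: Balaban1988Convergent, (2.6)–(2.9) pp.255–256 and (2.46) p.263] -/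
theorem flowControl_of_summableLower (S : SmallnessFor γ β' β₀ L p) {A₀ : ℝ} (hA₀ : 0 ≤ A₀) {k₀ : ℕ} {c : ℕ → ℝ}
    {Ctot : ℝ} (R : ℕ → ℕ) (hR : ∀ j, j ≤ K → B14.IsRj L p (F.g j) (R j))
    (hrg : F.SatisfiesRG K) (hI : F.InInterval γ K) (hub : ∀ j, j < K → F.β (j + 1) (F.g j) ≤ β')
    (hc : ∀ j, 0 ≤ c j) (hsum : ∀ n, ∑ j ∈ Finset.range n, c j ≤ Ctot) (hb : 0 < b)
    (hlo : ∀ j, j < K → -(c j) ≤ F.β (j + 1) (F.g j))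
    (htail : ∀ j, k₀ ≤ j → j < K → b ≤ F.β (j + 1) (F.g j))
    (hBγ : (b * k₀ + Ctot) * γ ^ 2 ≤ β₀ * (2 + β₀)) (hBγ' : (b * k₀ + Ctot) * γ ^ 2 ≤ 1 / 2)
    {κ₀ : ℕ} (hκ : 6 ≤ κ₀) (hsmall : Real.sqrt 2 ^ (κ₀ - 6) * (2 * γ ^ 4 / b + γ ^ 6) < 1) :
    (B14.FlowIneq26 F.g β' β₀ K ∧ B14.FlowIneq27 F.g β' β₀ p K ∧
      B14.FlowIneq28 (epsK A₀ p F) F.g β' β₀ K ∧ FlowIneq29 R F.g L β' β₀ K) ∧ SumIneq246 F.g κ₀ K :=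
  flowControl_of_avgAF F K S hA₀ R hR hrg hI hub hb
    (avgAF_of_summableLower F K hc hsum hb.le hlo htail) hBγ hBγ' hκ hsmall

/-! ### (v1.8) Two adapters for downstream consumers -/

/-- **"Similar inequalities hold for other constants" — SIGN-FREE.**  The (2.8)-shaped inequalities for the radii
`α_{0,j} = g_j C₀ (log g_j⁻²)^{q₀}`, `α_{1,j} = g_j C₁ (log g_j⁻²)^{q₁}` of (2.28) p. 259 (`B14.alphaJ C q`) hold for ALL
pairs along a run solving (0.20) in `]0,γ]` from the printed `β ≤ β′`, a partial-sum bound `−B ≤ Σ_{j∈[m,n)} β_{j+1}(g_j)`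
with `Bγ² ≤ β₀(2+β₀)`, and `SmallnessFor γ β′ β₀ L q` — no monotonicity of the couplings (section E's
`flowIneq28_alphaJ_of_26_monotone` needed it); same proof as for `ε_j` (`flowControl_of_partialSum` with `A₀ ↦ C`,
`p ↦ q`, sizes produced by `isRj_exists` and discarded). [cite: Balaban1988Convergent, (2.28) p.259 and p.256 "Similar inequalities hold for other constants"] -/
theorem flowIneq28_alphaJ_of_partialSum {q : ℕ} (S : SmallnessFor γ β' β₀ L q) {C : ℝ} (hC : 0 ≤ C)
    (hrg : F.SatisfiesRG K) (hI : F.InInterval γ K) (hub : ∀ j, j < K → F.β (j + 1) (F.g j) ≤ β')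
    (hps : ∀ m n, m ≤ n → n ≤ K → -B ≤ ∑ j ∈ Finset.Ico m n, F.β (j + 1) (F.g j))
    (hBγ : B * γ ^ 2 ≤ β₀ * (2 + β₀)) :
    B14.FlowIneq28 (fun k => B14.alphaJ C q (F.g k)) F.g β' β₀ K := by
  classical
  choose R hR using fun j => isRj_exists S.hL q (F.g j)
  have h := (flowControl_of_partialSum F K S hC R (fun j _ => hR j) hrg hI hub hps hBγ).2.2.1
  have e : (fun k => B14.alphaJ C q (F.g k)) = epsK C q F := by
    funext k; unfold B14.alphaJ epsK p0Profile; ring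
  rw [e]; exact h

/-- ADAPTER to the consumer's shape: `SumIneq246 g κ₀ K` (strict, all `n ≤ K`) yields the hypothesis `hsum` of
`B14Thm2.bound246_of_244` / `bounds245to249_of_perScale` (non-strict, `1 ≤ n ≤ k`) at every step `k ≤ K`. [cite: Balaban1988Convergent, (2.46) p.263] -/
theorem hsum_of_sumIneq246 {g : ℕ → ℝ} {κ₀ K : ℕ} (h : SumIneq246 g κ₀ K) {k : ℕ} (hk : k ≤ K) :
    ∀ n, 1 ≤ n → n ≤ k → ∑ j ∈ Finset.Icc 1 n, (g j) ^ κ₀ ≤ (g n) ^ (κ₀ - 6) :=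
  fun n _ hn => (h n (hn.trans hk)).le

/-! ### (v1.9) (AvAF) from a DRIFT of the coupling-free parts plus uniformly small remainders — the [III]-side use of
the β sub-cell's (T-drift) form (cell BETA-SPEC §6) -/

/-- **Averaged AF from a DRIFT of the one-loop parts.**  Along a run whose β-functions split as
`β_j(x) = β⁰_j + r_j(x)`: if the coupling-free parts have positive drift up to a constant,
`b(n−m) − A ≤ Σ_{j∈[m,n)} β⁰_{j+1}` for all `m ≤ n ≤ K`, and the remainders are uniformly small along the run,
`|r_{j+1}(g_j)| ≤ ρ` for `j < K`, then (AvAF) holds with constants `b − ρ` and `A`: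
`(b−ρ)(n−m) − A ≤ Σ_{j∈[m,n)} β_{j+1}(g_j)`.  (With `|r_{j+1}(x)| ≤ Cx` on `]0,γ]` one takes `ρ = Cγ`.)  The drift and the
remainder bound are located UNPRINTED inputs; nothing about [Balaban1987RG1] (1.22) is asserted. [folklore] -/
theorem avgAF_of_driftSplit {A ρ : ℝ} (β0 : ℕ → ℝ) (r : ℕ → ℝ → ℝ) (hsplit : ∀ j x, F.β j x = β0 j + r j x)
    (hdrift : ∀ m n, m ≤ n → n ≤ K → b * ((n : ℝ) - m) - A ≤ ∑ j ∈ Finset.Ico m n, β0 (j + 1))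
    (hrem : ∀ j, j < K → |r (j + 1) (F.g j)| ≤ ρ) :
    ∀ m n, m ≤ n → n ≤ K →
      (b - ρ) * ((n : ℝ) - m) - A ≤ ∑ j ∈ Finset.Ico m n, F.β (j + 1) (F.g j) := by
  intro m n hmn hnK
  have hsum : ∑ j ∈ Finset.Ico m n, F.β (j + 1) (F.g j)
      = ∑ j ∈ Finset.Ico m n, β0 (j + 1) + ∑ j ∈ Finset.Ico m n, r (j + 1) (F.g j) := by
    rw [← Finset.sum_add_distrib]
    exact Finset.sum_congr rfl fun j _ => hsplit (j + 1) (F.g j)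
  have hr : -(ρ * ((n : ℝ) - m)) ≤ ∑ j ∈ Finset.Ico m n, r (j + 1) (F.g j) := by
    have h1 : ∑ _j ∈ Finset.Ico m n, (-ρ) ≤ ∑ j ∈ Finset.Ico m n, r (j + 1) (F.g j) :=
      Finset.sum_le_sum fun j hj =>
        (abs_le.mp (hrem j (lt_of_lt_of_le (Finset.mem_Ico.mp hj).2 hnK))).1
    have h2 : ∑ _j ∈ Finset.Ico m n, (-ρ) = -(ρ * ((n : ℝ) - m)) := by
      rw [Finset.sum_const, Nat.card_Ico, nsmul_eq_mul, Nat.cast_sub hmn]; ring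
    linarith
  have hd := hdrift m n hmn hnK
  rw [hsum]
  nlinarith

/-- **T11.F from the DRIFT form**: all of (2.6)–(2.9) with the printed constants and (2.46) along a run in `]0,γ]`
solving (0.20), from the split `β_j = β⁰_j + r_j`, the drift `b(n−m) − A ≤ Σ_{[m,n)} β⁰_{j+1}`, uniformly small
remainders `|r_{j+1}(g_j)| ≤ ρ` with `ρ < b`, the printed upper bound, `SmallnessFor`, sizes by (2.5), and γ-smallness
in the defect `A`: `Aγ² ≤ β₀(2+β₀)`, `Aγ² ≤ 1/2`, `(√2)^{κ₀−6}(2γ⁴/(b−ρ) + γ⁶) < 1`. [cite: Balaban1988Convergent, (2.6)–(2.9) pp.255–256 and (2.46) p.263] -/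
theorem flowControl_of_driftSplit (S : SmallnessFor γ β' β₀ L p) {A₀ A ρ : ℝ} (hA₀ : 0 ≤ A₀)
    (β0 : ℕ → ℝ) (r : ℕ → ℝ → ℝ) (hsplit : ∀ j x, F.β j x = β0 j + r j x)
    (hdrift : ∀ m n, m ≤ n → n ≤ K → b * ((n : ℝ) - m) - A ≤ ∑ j ∈ Finset.Ico m n, β0 (j + 1))
    (hrem : ∀ j, j < K → |r (j + 1) (F.g j)| ≤ ρ) (hρb : ρ < b)
    (R : ℕ → ℕ) (hR : ∀ j, j ≤ K → B14.IsRj L p (F.g j) (R j))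
    (hrg : F.SatisfiesRG K) (hI : F.InInterval γ K) (hub : ∀ j, j < K → F.β (j + 1) (F.g j) ≤ β')
    (hAγ : A * γ ^ 2 ≤ β₀ * (2 + β₀)) (hAγ' : A * γ ^ 2 ≤ 1 / 2) {κ₀ : ℕ} (hκ : 6 ≤ κ₀)
    (hsmall : Real.sqrt 2 ^ (κ₀ - 6) * (2 * γ ^ 4 / (b - ρ) + γ ^ 6) < 1) :
    (B14.FlowIneq26 F.g β' β₀ K ∧ B14.FlowIneq27 F.g β' β₀ p K ∧
      B14.FlowIneq28 (epsK A₀ p F) F.g β' β₀ K ∧ FlowIneq29 R F.g L β' β₀ K) ∧ SumIneq246 F.g κ₀ K :=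
  flowControl_of_avgAF F K S hA₀ R hR hrg hI hub (sub_pos.mpr hρb)
    (avgAF_of_driftSplit F K β0 r hsplit hdrift hrem) hAγ hAγ' hκ hsmall

end AveragedAF

/-! ## K. (v1.10) WHERE the coupling-sum input of (2.46) is consumed — the GLOBAL budget of (2.49)/(2.50) does not
need it; the PER-LAYER (k-uniform) size of 𝐑_k does

[Balaban1988Convergent] p. 260 [18], after (2.31), verbatim: *"After the vacuum energy renormalization we obtain a
sum of marginal terms, i.e., terms with bounds O(1)(Lʲη)⁴g_j^{κ₀}exp(−κd_j(X)). The sum over X is controlled by the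
exponential factor, and by the factor (Lʲη)⁴. The sum over j is controlled by g_j^{κ₀}."*  p. 263 [21], Theorem 2:
*"The volumes are taken in the corresponding scales, i.e. |Γ_n∩Ω| means the number of points in the set
Γ_n∩Ω ⊂ T₁⁽ⁿ⁾."*  p. 264 [22], (2.50): *"χ_k(T_η) exp[−(1/g_k²)A(U_k(V_k)) − E₋|T_η|] ≤ ρ_k(V_k) ≤ e^{E₊|T_η|}"*.
Two bookkeeping facts over real sequences (nothing of the series is asserted):
(K-a) GLOBAL.  A subset of the n-th unit lattice has at most `|T₁⁽ⁿ⁾| = L^{−4n}|T_η|` points (d = 4).  Hence the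
FIRST member of (2.46) alone — (2.44) summed over j, `B14Thm2.bound246a_of_244` — together with the interval
hypothesis `0 ≤ g_j ≤ γ` gives `|𝐑_k(U_k)| ≤ R₁ Σ_n |Γ_n| Σ_{j≤n} g_j^{κ₀} ≤ R₁ γ^{κ₀} (Σ_n n L^{−4n}) |T_η| ≤
R₁ γ^{κ₀} |T_η| / 14` for `L ≥ 2` (`sum246_first_le_global`, `rk_le_global_of_244`; (2.49) in this form:
`ineq249T_of_223`): an `|T_η|`-extensive bound of the kind (2.50) consumes, uniform in k, with NO hypothesis on the
β-functions and no *"g sufficiently small"*.  So the (2.49) → (2.50) use of (2.46) is NOT a consumer of the positive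
lower bound / averaged asymptotic freedom of sections D/J.
(K-b) PER LAYER.  What the middle member of (2.46) delivers beyond (K-a) is a bound on `Σ_{j≤n} g_j^{κ₀}` UNIFORM IN
n (indeed `< g_n^{κ₀−6}`), i.e. a size `O(1)·|Γ_n|` of the accumulated marginal 𝐑-terms per point of EACH layer at
its own scale — the form meant by the p. 260 sentence, by the treatment of `𝐑′_k ⊂ 𝐄_k` in the (k+1)-th step
(p. 271; p. 276 *"the analylsis [sic] presented in [16] for three-dimensional models is enough here"*, [16] =
[Balaban1985UV3], where the couplings scale by powers of L) and by [Balaban1989LargeFieldII] (1.69) p. 377 together with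
its per-large-field-domain budget p. 380 ll. 12–17 (every non-Wilson term of the exponential of (1.71) over X~ booked as
`O(1)`, resp. `O(log g_j⁻²)`, per point of each large-field domain Z_j at its own scale) — cell MISSING-B14.md v4/v5 §8
C13, GAPS G-adv6-10 / G-B14s-18 / G-sb14-3 / G-sb14-3a.  NO k-uniform per-layer bound follows from (0.20) + the
interval hypothesis + the sign: `layerSum_unbounded_printOnly` (constant flow: every proposed bound S is exceeded by
some layer sum); under averaged asymptotic freedom it is `sumIneq246_of_avgAF` (section J).
HONEST FRAMING: (K-a)/(K-b) RELOCATE the [III]-side consumer of asymptotic freedom inside (2.46); they neither remove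
it from the series nor assert anything about Bałaban's β-functions (1.22). -/

section Global246

/-- Arithmetic–geometric partial sums: `Σ_{n=1}^{k} n xⁿ ≤ x/(1−x)²` for `0 ≤ x < 1`. [folklore] -/
theorem sum_nat_mul_geom_le {x : ℝ} (hx0 : 0 ≤ x) (hx1 : x < 1) (k : ℕ) :
    ∑ n ∈ Finset.Icc 1 k, (n : ℝ) * x ^ n ≤ x / (1 - x) ^ 2 := by
  have hnorm : ‖x‖ < 1 := by
    rw [Real.norm_eq_abs, abs_of_nonneg hx0]; exact hx1
  have hs := hasSum_coe_mul_geometric_of_norm_lt_one hnorm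
  exact sum_le_hasSum (Finset.Icc 1 k) (fun n _ => by positivity) hs

/-- For block size `L ≥ 2` (d = 4): `Σ_{n=1}^{k} n (L⁴)⁻ⁿ ≤ 1/14` (`x = L⁻⁴ ≤ 1/16`, `x/(1−x)² ≤ 16/225`). [folklore] -/
theorem sum_nat_mul_geom_L4_le {L : ℝ} (hL : 2 ≤ L) (k : ℕ) :
    ∑ n ∈ Finset.Icc 1 k, (n : ℝ) * ((L ^ 4)⁻¹) ^ n ≤ 1 / 14 := by
  have hL4 : (16 : ℝ) ≤ L ^ 4 := by
    have h2 : (2 : ℝ) ^ 4 ≤ L ^ 4 := pow_le_pow_left₀ (by norm_num) hL 4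
    norm_num at h2
    exact h2
  have hx0 : 0 ≤ (L ^ 4)⁻¹ := inv_nonneg.mpr (by linarith)
  have hx16 : (L ^ 4)⁻¹ ≤ 1 / 16 := by
    rw [one_div]; exact inv_anti₀ (by norm_num) hL4
  have hx1 : (L ^ 4)⁻¹ < 1 := by linarith
  refine le_trans (sum_nat_mul_geom_le hx0 hx1 k) ?_
  have hden : 0 < (1 - (L ^ 4)⁻¹) ^ 2 := by nlinarith
  rw [div_le_div_iff₀ hden (by norm_num)]
  nlinarith [sq_nonneg ((L ^ 4)⁻¹)]

/-- Inner sum of (2.46), trivially: `0 ≤ g_j ≤ γ` for `1 ≤ j ≤ n` gives `Σ_{j=1}^{n} g_j^{κ₀} ≤ n γ^{κ₀}`. [folklore] -/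
theorem layerSum_le_card_mul {g : ℕ → ℝ} {γ : ℝ} {κ₀ n : ℕ}
    (hg : ∀ j, 1 ≤ j → j ≤ n → 0 ≤ g j ∧ g j ≤ γ) :
    ∑ j ∈ Finset.Icc 1 n, (g j) ^ κ₀ ≤ (n : ℝ) * γ ^ κ₀ := by
  have h : ∀ j ∈ Finset.Icc 1 n, (g j) ^ κ₀ ≤ γ ^ κ₀ := by
    intro j hj
    rw [Finset.mem_Icc] at hj
    obtain ⟨h0, hγ⟩ := hg j hj.1 hj.2
    exact pow_le_pow_left₀ h0 hγ _
  calc ∑ j ∈ Finset.Icc 1 n, (g j) ^ κ₀ ≤ ∑ _j ∈ Finset.Icc 1 n, γ ^ κ₀ := Finset.sum_le_sum h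
    _ = (n : ℝ) * γ ^ κ₀ := by
        rw [Finset.sum_const, Nat.card_Icc, nsmul_eq_mul, Nat.add_sub_cancel]

/-- **(K-a) The global, sign-free bound on the first member of (2.46).**  With layer volumes
`0 ≤ |Γ_n| ≤ L^{−4n}·V` (`V = |T_η|`; a subset of `T₁⁽ⁿ⁾` has at most `|T₁⁽ⁿ⁾| = L^{−4n}|T_η|` points, p. 263) and
couplings `0 ≤ g_j ≤ γ`: `Σ_{n=1}^{k} |Γ_n| Σ_{j=1}^{n} g_j^{κ₀} ≤ γ^{κ₀} V Σ_{n=1}^{k} n L^{−4n}` — no hypothesis on the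
β-functions, uniform in k. [cite: Balaban1988Convergent, (2.46) p.263] -/
theorem sum246_first_le_global (k κ₀ : ℕ) (Γ g : ℕ → ℝ) {γ L V : ℝ} (hV : 0 ≤ V) (hL : 0 < L)
    (hΓ : ∀ n, 1 ≤ n → n ≤ k → Γ n ≤ ((L ^ 4)⁻¹) ^ n * V)
    (hg : ∀ j, 1 ≤ j → j ≤ k → 0 ≤ g j ∧ g j ≤ γ) :
    ∑ n ∈ Finset.Icc 1 k, Γ n * ∑ j ∈ Finset.Icc 1 n, (g j) ^ κ₀ ≤
      γ ^ κ₀ * V * ∑ n ∈ Finset.Icc 1 k, (n : ℝ) * ((L ^ 4)⁻¹) ^ n := by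
  rw [Finset.mul_sum]
  refine Finset.sum_le_sum fun n hn => ?_
  rw [Finset.mem_Icc] at hn
  have hgn : ∀ j, 1 ≤ j → j ≤ n → 0 ≤ g j ∧ g j ≤ γ := fun j hj1 hjn => hg j hj1 (le_trans hjn hn.2)
  have hin0 : 0 ≤ ∑ j ∈ Finset.Icc 1 n, (g j) ^ κ₀ :=
    Finset.sum_nonneg fun j hj =>
      pow_nonneg (hgn j (Finset.mem_Icc.mp hj).1 (Finset.mem_Icc.mp hj).2).1 _
  have hin : ∑ j ∈ Finset.Icc 1 n, (g j) ^ κ₀ ≤ (n : ℝ) * γ ^ κ₀ := layerSum_le_card_mul hgn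
  have hx0 : 0 ≤ ((L ^ 4)⁻¹) ^ n * V := mul_nonneg (pow_nonneg (inv_nonneg.mpr (by positivity)) _) hV
  calc Γ n * ∑ j ∈ Finset.Icc 1 n, (g j) ^ κ₀ ≤ (((L ^ 4)⁻¹) ^ n * V) * ((n : ℝ) * γ ^ κ₀) :=
        mul_le_mul (hΓ n hn.1 hn.2) hin hin0 hx0
    _ = γ ^ κ₀ * V * ((n : ℝ) * ((L ^ 4)⁻¹) ^ n) := by ring

/-- (K-a) with the numerical constant, `L ≥ 2`: `Σ_{n=1}^{k} |Γ_n| Σ_{j=1}^{n} g_j^{κ₀} ≤ γ^{κ₀} |T_η| / 14`. [cite: Balaban1988Convergent, (2.46) p.263] -/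
theorem sum246_first_le_global' (k κ₀ : ℕ) (Γ g : ℕ → ℝ) {γ L V : ℝ} (hγ : 0 ≤ γ) (hV : 0 ≤ V) (hL : 2 ≤ L)
    (hΓ : ∀ n, 1 ≤ n → n ≤ k → Γ n ≤ ((L ^ 4)⁻¹) ^ n * V)
    (hg : ∀ j, 1 ≤ j → j ≤ k → 0 ≤ g j ∧ g j ≤ γ) :
    ∑ n ∈ Finset.Icc 1 k, Γ n * ∑ j ∈ Finset.Icc 1 n, (g j) ^ κ₀ ≤ γ ^ κ₀ * V / 14 := by
  have h := sum246_first_le_global k κ₀ Γ g hV (by linarith) hΓ hg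
  have hs : γ ^ κ₀ * V * ∑ n ∈ Finset.Icc 1 k, (n : ℝ) * ((L ^ 4)⁻¹) ^ n ≤ γ ^ κ₀ * V * (1 / 14) :=
    mul_le_mul_of_nonneg_left (sum_nat_mul_geom_L4_le hL k) (by positivity)
  calc ∑ n ∈ Finset.Icc 1 k, Γ n * ∑ j ∈ Finset.Icc 1 n, (g j) ^ κ₀
      ≤ γ ^ κ₀ * V * (1 / 14) := le_trans h hs
    _ = γ ^ κ₀ * V / 14 := by ring

/-- **(K-a) for 𝐑_k itself.**  The instances of (2.44) (`|r_j| ≤ R₁ g_j^{κ₀} Σ_{n=j}^{k} |Γ_n|`, `R₁ ≥ 0`, as in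
`B14Thm2.bound246a_of_244`), layer volumes `≤ L^{−4n}|T_η|`, couplings in `[0,γ]` and `L ≥ 2` give
`|𝐑_k(U_k)| = |Σ_j r_j| ≤ R₁ γ^{κ₀} |T_η| / 14` — the `|T_η|`-extensive form that (2.50) consumes, with no
hypothesis on the β-functions and no *"g sufficiently small"*. [cite: Balaban1988Convergent, (2.44)–(2.46) p.263 and (2.50) p.264] -/
theorem rk_le_global_of_244 (k κ₀ : ℕ) (r Γ g : ℕ → ℝ) {R₁ γ L V : ℝ} (hR : 0 ≤ R₁) (hγ : 0 ≤ γ) (hV : 0 ≤ V)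
    (hL : 2 ≤ L) (hΓ : ∀ n, 1 ≤ n → n ≤ k → Γ n ≤ ((L ^ 4)⁻¹) ^ n * V)
    (hg : ∀ j, 1 ≤ j → j ≤ k → 0 ≤ g j ∧ g j ≤ γ)
    (h244 : ∀ j, 1 ≤ j → j ≤ k → |r j| ≤ R₁ * (g j) ^ κ₀ * ∑ n ∈ Finset.Icc j k, Γ n) :
    |∑ j ∈ Finset.Icc 1 k, r j| ≤ R₁ * (γ ^ κ₀ * V / 14) :=
  le_trans (B14Thm2.bound246a_of_244 k κ₀ r Γ g R₁ h244)
    (mul_le_mul_of_nonneg_left (sum246_first_le_global' k κ₀ Γ g hγ hV hL hΓ hg) hR)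

/-- **(2.49) with the 𝐑-part booked against `|T_η|`** — the variant of `B14Thm2.ineq249_of_223` WITHOUT the middle
and last members of (2.46) (`hsum`, `hsmall`) among its hypotheses: from (2.23), the (2.45)-bound on `𝐄_k`, ANY
bound `|𝐑_k| ≤ R_T` (e.g. `rk_le_global_of_244`: `R_T = R₁γ^{κ₀}|T_η|/14`), (2.48) on `𝐁_k` and the vacuum-energy
sentence: `|A_k + A(1/g_k², U_k) − (log terms)| ≤ (E₁(1−L^{−β})^{−1} + 2B₁ + E₂) Σ_n |Γ_n| + R_T`.  Since (2.50) is
`|T_η|`-extensive (and `Σ_n |Γ_n| ≤ (Σ_n L^{−4n})|T_η|` anyway), this serves the p. 264 derivation exactly as (2.49)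
does; content: the triangle inequality. [cite: Balaban1988Convergent, (2.49)–(2.50) p.264] -/
theorem ineq249T_of_223 (k : ℕ) (Ak Awil Etot Rtot Btot EkLog EkRest : ℝ) (E₁ B₁ L β E₂ RT : ℝ) (Γ : ℕ → ℝ)
    (h223 : B14Thm2.Eq223 Ak Awil Etot Rtot Btot (EkLog + EkRest))
    (hE : |Etot| ≤ E₁ * (1 - L ^ (-β))⁻¹ * ∑ n ∈ Finset.Icc 1 k, Γ n)
    (hRt : |Rtot| ≤ RT)
    (hB : |Btot| ≤ 2 * B₁ * ∑ n ∈ Finset.Icc 1 k, Γ n)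
    (hvac : B14Thm2.VacuumRestBound EkRest E₂ Γ k) :
    |Ak + Awil - -EkLog| ≤
      (E₁ * (1 - L ^ (-β))⁻¹ + 2 * B₁ + E₂) * ∑ n ∈ Finset.Icc 1 k, Γ n + RT := by
  unfold B14Thm2.Eq223 at h223
  unfold B14Thm2.VacuumRestBound at hvac
  have hsum : Ak + Awil - -EkLog = Etot + Rtot + Btot - EkRest := by
    rw [h223]; ring
  rw [hsum]
  have key : |Etot + Rtot + Btot - EkRest| ≤ |Etot| + |Rtot| + |Btot| + |EkRest| := by
    refine abs_le.mpr ⟨?_, ?_⟩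
    · linarith [neg_abs_le Etot, neg_abs_le Rtot, neg_abs_le Btot, le_abs_self EkRest]
    · linarith [le_abs_self Etot, le_abs_self Rtot, le_abs_self Btot, neg_abs_le EkRest]
  calc |Etot + Rtot + Btot - EkRest| ≤ |Etot| + |Rtot| + |Btot| + |EkRest| := key
    _ ≤ E₁ * (1 - L ^ (-β))⁻¹ * ∑ n ∈ Finset.Icc 1 k, Γ n + RT
          + 2 * B₁ * ∑ n ∈ Finset.Icc 1 k, Γ n + E₂ * ∑ n ∈ Finset.Icc 1 k, Γ n := by
        linarith
    _ = (E₁ * (1 - L ^ (-β))⁻¹ + 2 * B₁ + E₂) * ∑ n ∈ Finset.Icc 1 k, Γ n + RT := by ring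

/-- **(K-b) NECESSITY for the per-layer form.**  No bound `Σ_{j=1}^{n} g_j^{κ₀} ≤ S` uniform in n follows from
(0.20), the interval hypothesis and the sign of β: for every `S` the constant flow `g ≡ 1/2`, `β ≡ 0` (which solves
(0.20), lies in `]0,1/2]`, has `0 ≤ β ≤ β′` for any `β′ ≥ 0`) has a layer sum `Σ_{j=1}^{K} g_j⁷ = K·2⁻⁷ > S` at
`K = 128(⌈S⌉₊+1)`.  Cf. `sumIneq246_needs_positive_b` (one fixed K). [cite: Balaban1988Convergent, (2.46) p.263] -/
theorem layerSum_unbounded_printOnly (S : ℝ) :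
    ∃ K : ℕ, ∃ F : Flow, F.SatisfiesRG K ∧ F.InInterval (1 / 2) K ∧
      (∀ j, j < K → 0 ≤ F.β (j + 1) (F.g j) ∧ F.β (j + 1) (F.g j) ≤ 0) ∧
      S < ∑ j ∈ Finset.Icc 1 K, (F.g j) ^ 7 := by
  refine ⟨128 * (⌈S⌉₊ + 1), ⟨fun _ => 1 / 2, fun _ _ => 0⟩, ?_, ?_, ?_, ?_⟩
  · intro k _; simp
  · intro k _; norm_num
  · intro j _; simp
  · simp only [Finset.sum_const, Nat.card_Icc, Nat.add_sub_cancel, nsmul_eq_mul]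
    have hS : S ≤ (⌈S⌉₊ : ℝ) := Nat.le_ceil S
    push_cast
    nlinarith

end Global246

/-! ### (v1.11) The EXACT strength the per-layer form needs: K-uniform layer summability from POWER-LAW positivity

Generalising `Step.sum_sixth_powers_le` (the case `M = 0`, used by section D): if along (0.20)
`β_{j+1}(g_j) ≥ c·g_j^M` with `c > 0` for `k₀ ≤ j < K`, then for every `q ≥ 1` Bernoulli's inequality gives the
one-step telescoping `q·c·g_j^{2q+2+M} ≤ g_{j+1}^{2q} − g_j^{2q}` (`pow_step_of_betaPowerLower`), hence
`Σ_{j∈[k₀,n)} g_j^{2q+2+M} ≤ g_n^{2q}/(qc)` (`powSum_le_of_betaPowerLower`) and, along a run in `]0,γ]` with the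
power-law bound at every scale, `Σ_{j=1}^{n} g_j^{κ₀} ≤ (g_n^{2q}/(qc) + g_n^{2q+2+M})·g_n^{κ₀−(2q+2+M)}` for every
`κ₀ ≥ 2q+2+M` (`layerSum_le_of_betaPowerLower`).  So the per-layer k-uniform size of the accumulated 𝐑-terms (section K,
(K-b); cell MISSING-B14 v4 §8 C13 / §9.6) is served by positivity of the β-functions at ANY fixed polynomial rate
`c·g^M` with `M < κ₀ − 2` — far weaker than a uniform positive lower bound; `M = 0`, `q = 2` is `sum246_sharp`'s
`g_n⁴/(2b)`.  Bookkeeping over real sequences; for Bałaban's `β = β⁰ + β¹` with `β⁰` coupling-free the weakening is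
academic unless `β⁰_∞ = 0`; recorded for census honesty (what EXACTLY is consumed), nothing about (1.22) asserted. -/

section PowerLaw
variable (F : Flow) (K : ℕ)

/-- One step: from (0.20) at `j`, positive couplings and `c·g_j^M ≤ β_{j+1}(g_j)` (`c ≥ 0`):
`q·c·g_j^{2q+2+M} ≤ g_{j+1}^{2q} − g_j^{2q}`.  (With `a = g_j²`, `a′ = g_{j+1}²`: `a′ − a = a a′ β ≥ a²β`, then Bernoulli
`(a + a²β)^q ≥ a^q (1 + q a β)`.) [folklore] -/
theorem pow_step_of_betaPowerLower {q M : ℕ} {c : ℝ} (hc : 0 ≤ c) {j : ℕ} (hjK : j < K)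
    (hpos : ∀ i, i ≤ K → 0 < F.g i) (hrg : F.SatisfiesRG K)
    (hlb : c * (F.g j) ^ M ≤ F.β (j + 1) (F.g j)) :
    (q : ℝ) * c * (F.g j) ^ (2 * q + 2 + M) ≤ (F.g (j + 1)) ^ (2 * q) - (F.g j) ^ (2 * q) := by
  have hj : 0 < F.g j := hpos j hjK.le
  have hj1 : 0 < F.g (j + 1) := hpos (j + 1) hjK
  set a := (F.g j) ^ 2 with ha
  set a' := (F.g (j + 1)) ^ 2 with ha'
  set β := F.β (j + 1) (F.g j) with hβ
  have ha0 : 0 < a := by rw [ha]; positivity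
  have ha'0 : 0 < a' := by rw [ha']; positivity
  have hβ0 : 0 ≤ β := le_trans (mul_nonneg hc (pow_nonneg hj.le M)) hlb
  have hstep : 1 / a = 1 / a' + β := hrg j hjK
  -- a' - a = a * a' * β ≥ a² β
  have hdiff : a' - a = a * a' * β := by
    field_simp at hstep
    linear_combination hstep
  have haa' : a ≤ a' := by nlinarith [mul_pos ha0 ha'0]
  have hge : a + a ^ 2 * β ≤ a' := by nlinarith [mul_nonneg ha0.le hβ0]
  -- Bernoulli
  have hB : 1 + (q : ℝ) * (a * β) ≤ (1 + a * β) ^ q :=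
    one_add_mul_le_pow (by nlinarith [mul_nonneg ha0.le hβ0]) q
  have h1 : a ^ q * (1 + (q : ℝ) * (a * β)) ≤ a ^ q * (1 + a * β) ^ q :=
    mul_le_mul_of_nonneg_left hB (pow_nonneg ha0.le q)
  have h2 : a ^ q * (1 + a * β) ^ q = (a + a ^ 2 * β) ^ q := by
    rw [← mul_pow]; congr 1; ring
  have h3 : (a + a ^ 2 * β) ^ q ≤ a' ^ q := pow_le_pow_left₀ (by positivity) hge q
  have hmain : (q : ℝ) * (a ^ (q + 1) * β) ≤ a' ^ q - a ^ q := by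
    have : a ^ q * (1 + (q : ℝ) * (a * β)) = a ^ q + (q : ℝ) * (a ^ (q + 1) * β) := by ring
    linarith [h1, h2.le, h2.ge, h3]
  -- translate back to g
  have e1 : (F.g j) ^ (2 * q + 2 + M) = a ^ (q + 1) * (F.g j) ^ M := by
    rw [ha, ← pow_mul, ← pow_add, show 2 * (q + 1) + M = 2 * q + 2 + M by ring]
  have e2 : (F.g (j + 1)) ^ (2 * q) = a' ^ q := by rw [ha', ← pow_mul]
  have e3 : (F.g j) ^ (2 * q) = a ^ q := by rw [ha, ← pow_mul]
  rw [e1, e2, e3]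
  have hcβ : a ^ (q + 1) * (c * (F.g j) ^ M) ≤ a ^ (q + 1) * β :=
    mul_le_mul_of_nonneg_left hlb (pow_nonneg ha0.le _)
  have hq0 : (0 : ℝ) ≤ q := Nat.cast_nonneg q
  calc (q : ℝ) * c * (a ^ (q + 1) * (F.g j) ^ M) = (q : ℝ) * (a ^ (q + 1) * (c * (F.g j) ^ M)) := by ring
    _ ≤ (q : ℝ) * (a ^ (q + 1) * β) := mul_le_mul_of_nonneg_left hcβ hq0
    _ ≤ a' ^ q - a ^ q := hmain

/-- **Telescoped**: `β_{j+1}(g_j) ≥ c·g_j^M` (`c > 0`) for `k₀ ≤ j < K` along (0.20) with positive couplings gives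
`Σ_{j∈[k₀,n)} g_j^{2q+2+M} ≤ g_n^{2q}/(qc)` for every `q ≥ 1` and `k₀ ≤ n ≤ K` — uniformly in `n`, `K`. [folklore] -/
theorem powSum_le_of_betaPowerLower {q M k₀ : ℕ} (hq : 1 ≤ q) {c : ℝ} (hc : 0 < c)
    (hpos : ∀ i, i ≤ K → 0 < F.g i) (hrg : F.SatisfiesRG K)
    (hlb : ∀ j, k₀ ≤ j → j < K → c * (F.g j) ^ M ≤ F.β (j + 1) (F.g j))
    {n : ℕ} (hk : k₀ ≤ n) (hnK : n ≤ K) :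
    ∑ j ∈ Finset.Ico k₀ n, (F.g j) ^ (2 * q + 2 + M) ≤ (F.g n) ^ (2 * q) / (q * c) := by
  have hqc : 0 < (q : ℝ) * c := mul_pos (by exact_mod_cast hq) hc
  have hsteps : ∀ j ∈ Finset.Ico k₀ n,
      (q : ℝ) * c * (F.g j) ^ (2 * q + 2 + M) ≤ (F.g (j + 1)) ^ (2 * q) - (F.g j) ^ (2 * q) := by
    intro j hj
    rw [Finset.mem_Ico] at hj
    exact pow_step_of_betaPowerLower F K hc.le (lt_of_lt_of_le hj.2 hnK) hpos hrg (hlb j hj.1 (lt_of_lt_of_le hj.2 hnK))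
  have hsum := Finset.sum_le_sum hsteps
  have htel : ∑ j ∈ Finset.Ico k₀ n, ((F.g (j + 1)) ^ (2 * q) - (F.g j) ^ (2 * q)) =
      (F.g n) ^ (2 * q) - (F.g k₀) ^ (2 * q) := by
    rw [Finset.sum_Ico_eq_sum_range]
    have := Finset.sum_range_sub (fun i => (F.g (k₀ + i)) ^ (2 * q)) (n - k₀)
    rw [show k₀ + (n - k₀) = n by omega, Nat.add_zero] at this
    rw [← this]
    refine Finset.sum_congr rfl fun i _ => ?_
    rw [show k₀ + i + 1 = k₀ + (i + 1) by ring]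
  rw [← Finset.mul_sum] at hsum
  rw [htel] at hsum
  have hk0 : 0 ≤ (F.g k₀) ^ (2 * q) := pow_nonneg (hpos k₀ (hk.trans hnK)).le _
  rw [le_div_iff₀ hqc]
  calc (∑ j ∈ Finset.Ico k₀ n, (F.g j) ^ (2 * q + 2 + M)) * (q * c)
      = (q : ℝ) * c * ∑ j ∈ Finset.Ico k₀ n, (F.g j) ^ (2 * q + 2 + M) := by ring
    _ ≤ (F.g n) ^ (2 * q) - (F.g k₀) ^ (2 * q) := hsum
    _ ≤ (F.g n) ^ (2 * q) := by linarith

/-- **Layer summability from power-law positivity along the whole run** (`k₀ = 0`): with `β_{j+1}(g_j) ≥ c·g_j^M`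
(`c > 0`) for all `j < K`, positive couplings and `κ₀ ≥ 2q+2+M` (`q ≥ 1`), every layer sum obeys
`Σ_{j=1}^{n} g_j^{κ₀} ≤ (g_n^{2q}/(qc) + g_n^{2q+2+M}) · g_n^{κ₀−(2q+2+M)}` (`n ≤ K`) — bounded, indeed small, UNIFORMLY
in `n` and `K`; with `q = 2`, `M = 0` this is `sum246_sharp`'s bound, and for `M ≤ 2` (`q = 1`, `κ₀ ≥ 6`) it still
yields the printed middle member of (2.46) once `g_n²/c + g_n^{4+M} < 1`.  The EXACT coupling-flow content of the
per-layer form of section K (cell MISSING-B14 v4 §8 C13): positivity at any fixed polynomial rate `M < κ₀ − 2`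
suffices. [cite: Balaban1988Convergent, (2.46) p.263 and p.260 (after (2.31))] -/
theorem layerSum_le_of_betaPowerLower {q M : ℕ} (hq : 1 ≤ q) {c : ℝ} (hc : 0 < c)
    (hpos : ∀ i, i ≤ K → 0 < F.g i) (hrg : F.SatisfiesRG K)
    (hlb : ∀ j, j < K → c * (F.g j) ^ M ≤ F.β (j + 1) (F.g j))
    {κ₀ : ℕ} (hκ : 2 * q + 2 + M ≤ κ₀) {n : ℕ} (hnK : n ≤ K) :
    ∑ j ∈ Finset.Icc 1 n, (F.g j) ^ κ₀ ≤
      ((F.g n) ^ (2 * q) / (q * c) + (F.g n) ^ (2 * q + 2 + M)) * (F.g n) ^ (κ₀ - (2 * q + 2 + M)) := by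
  have hn : 0 < F.g n := hpos n hnK
  have hlb0 : ∀ j, j < K → 0 ≤ F.β (j + 1) (F.g j) := fun j hj =>
    le_trans (mul_nonneg hc.le (pow_nonneg (hpos j hj.le).le M)) (hlb j hj)
  set e := 2 * q + 2 + M with he
  have hterm : ∀ j ∈ Finset.Icc 1 n, (F.g j) ^ κ₀ ≤ (F.g j) ^ e * (F.g n) ^ (κ₀ - e) := by
    intro j hj
    have hjn : j ≤ n := (Finset.mem_Icc.mp hj).2
    have hj0 : 0 < F.g j := hpos j (le_trans hjn hnK)
    have hle : F.g j ≤ F.g n := g_mono_of_betaNonneg F K hpos hrg hlb0 hjn hnK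
    have eq : (F.g j) ^ κ₀ = (F.g j) ^ e * (F.g j) ^ (κ₀ - e) := by
      rw [← pow_add]; congr 1; omega
    rw [eq]
    exact mul_le_mul_of_nonneg_left (pow_le_pow_left₀ hj0.le hle _) (by positivity)
  have h1 : ∑ j ∈ Finset.Icc 1 n, (F.g j) ^ κ₀ ≤ (∑ j ∈ Finset.Icc 1 n, (F.g j) ^ e) * (F.g n) ^ (κ₀ - e) := by
    rw [Finset.sum_mul]; exact Finset.sum_le_sum hterm
  have h2 : ∑ j ∈ Finset.Icc 1 n, (F.g j) ^ e ≤ ∑ j ∈ Finset.range (n + 1), (F.g j) ^ e := by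
    apply Finset.sum_le_sum_of_subset_of_nonneg
    · intro j hj
      rw [Finset.mem_range]; exact Nat.lt_succ_of_le (Finset.mem_Icc.mp hj).2
    · intro j hj _
      exact pow_nonneg (hpos j (Nat.le_of_lt_succ (Finset.mem_range.mp hj) |>.trans hnK)).le _
  have h3 : ∑ j ∈ Finset.range n, (F.g j) ^ e ≤ (F.g n) ^ (2 * q) / (q * c) := by
    have := powSum_le_of_betaPowerLower F K (k₀ := 0) hq hc hpos hrg (fun j _ hj => hlb j hj) (Nat.zero_le n) hnK
    rwa [he, Finset.range_eq_Ico]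
  have h4 : ∑ j ∈ Finset.range (n + 1), (F.g j) ^ e ≤ (F.g n) ^ (2 * q) / (q * c) + (F.g n) ^ e := by
    rw [Finset.sum_range_succ]; linarith
  calc ∑ j ∈ Finset.Icc 1 n, (F.g j) ^ κ₀
      ≤ (∑ j ∈ Finset.Icc 1 n, (F.g j) ^ e) * (F.g n) ^ (κ₀ - e) := h1
    _ ≤ ((F.g n) ^ (2 * q) / (q * c) + (F.g n) ^ e) * (F.g n) ^ (κ₀ - e) :=
        mul_le_mul_of_nonneg_right (h2.trans h4) (by positivity)

end PowerLaw

end Literature.MathematicalPhysics.QuantumFieldTheory.Balaban1983to89.B14FlowStep
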